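import Literature.NumberTheory.Sieve.BombieriFriedlanderIwaniecTheorem7Core
import Literature.NumberTheory.Sieve.BombieriFriedlanderIwaniecTheorem7StarSieve
import Literature.NumberTheory.Sieve.BombieriFriedlanderIwaniecTheorem7StarFromTheorem7
import HarnessLib

/-!
# Bombieri–Friedlander–Iwaniec 1986, Theorem 7 (§14) — step 6: numerics, merges and the assembly

Topic `Literature/NumberTheory/Sieve`; continuation of `…Theorem7Core`.  This file completes the
conditional proof of BFI's Theorem 7 in the regime (14.4) `Q²R ≤ x` from the uniform, corrected
Lemma 1 (`BFI.Lemma1BoundUniform κ`): the range computation of p. 246 for the corrected `𝓘`, the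
two elementary merges used to dispose of short ranges of `n` and `q` (`n` is absorbed into `l`,
`q` into `r`, the new outer variables running over sparse sets), the three stages (a piece with
smooth weights; the range of `q`; the range of `n`), the treatment of one dyadic block (small /
trivial regime / Stage N), the dyadic decomposition of the initial ranges of the tree's
`BFI.deltaStar`, and the final bookkeeping of the powers of `x`.

Main results: `BFI.theorem7_smooth_of_DI` (Theorem 7 with a power saving for unsieved variables,
`Q²R ≤ x`, from `BFI.Lemma1BoundUniform κ`) and
`BombieriFriedlanderIwaniecTheorem7Star.restricted_of_DI` (the statement of the named fact
`Literature.NumberTheory.Sieve.BombieriFriedlanderIwaniecTheorem7Star` for all `(M,N,L,Q,R)` with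
`Q²R ≤ x`, from `BFI.Lemma1BoundUniform κ`, through `…Theorem7Star.restricted_of_smooth`).  The
hypothesis is the Deshouillers–Iwaniec bound for sums of Kloosterman sums (BFI's Lemma 1) in the
uniform form of Drappeau with the corrected `𝓘` of BFI 2019, which is not in the tree; the
complementary regime `Q²R > x` (removed in BFI by the `q ↔ s` symmetry of §13) is not treated.
Everything here is PROVED; no named fact is introduced.

## References

* E. Bombieri, J. B. Friedlander, H. Iwaniec, Acta Math. 156 (1986), 203–251: §14 pp. 244–246.
  [BombieriFriedlanderIwaniecActa1986]
* E. Bombieri, J. B. Friedlander, H. Iwaniec, arXiv:1903.01371 (2019), §2 Lemma 2.1.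
  [BombieriFriedlanderIwaniec2019]
-/

noncomputable section

open Finset Real MeasureTheory
open scoped ArithmeticFunction.sigma ContDiff FourierTransform

namespace Literature.NumberTheory.Sieve

namespace BFI

/-! ### The range computation of p. 246 for the corrected `𝓘` -/

/-- **`𝓘_corr²` in the regime of §14** (p. 246 with the corrected third term of BFI 2019): for
`C ≤ 4N`, `D ≤ 4Q`, `S = a'L`, `N' ≤ a'²H`, `H ≤ T'·LR` ("`H < x^ε LR`"), `N + QR ≤ U·QR`
(`N < x^ε QR`), all sizes nonnegative and `a', T', U ≥ 1`:
`𝓘_corr(C,D,N',R,S)² ≤ 32a'³T'U·(QRLN)(LR) + 128a'³T'U·(QRLN)(NL^{1/2}) + 16a'²Q²R·H`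
(the last term is the corrected `D²N'R`, kept with `H` exact).
[cite: BombieriFriedlanderIwaniecActa1986, §14 p. 246] [cite: BombieriFriedlanderIwaniec2019, §2 Lemma 2.1] -/
theorem lemma1Icorr_sq_block_le {a' C D N' R S L N Q H T' U : ℝ} (ha : 1 ≤ a') (hL : 0 ≤ L)
    (hN : 0 ≤ N) (hQ : 0 ≤ Q) (hR : 0 ≤ R) (hT' : 1 ≤ T') (hU : 1 ≤ U) (hC0 : 0 ≤ C)
    (hD0 : 0 ≤ D) (hN'0 : 0 ≤ N')
    (hC : C ≤ 4 * N) (hD : D ≤ 4 * Q) (hS : S = a' * L) (hN' : N' ≤ a' ^ 2 * H) (hHT : H ≤ T' * (L * R))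
    (hNU : N + Q * R ≤ U * (Q * R)) :
    lemma1Icorr C D N' R S ^ 2 ≤
      32 * a' ^ 3 * T' * U * (Q * R * L * N) * (L * R) +
        128 * a' ^ 3 * T' * U * (Q * R * L * N) * (N * L ^ (1 / 2 : ℝ)) + 16 * a' ^ 2 * Q ^ 2 * R * H := by
  have ha0 : 0 ≤ a' := by linarith
  have ha2 : a' ≤ a' ^ 2 := by nlinarith
  have ha3 : a' ^ 2 ≤ a' ^ 3 := by nlinarith
  have hS0 : 0 ≤ S := by rw [hS]; positivity
  -- `RS + N' ≤ 2 a'² T' LR`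
  have hRS : R * S + N' ≤ 2 * a' ^ 2 * T' * (L * R) := by
    rw [hS]
    have h1 : R * (a' * L) ≤ a' ^ 2 * T' * (L * R) := by
      have : R * (a' * L) = a' * 1 * (L * R) := by ring
      rw [this]; gcongr
    have h2 : N' ≤ a' ^ 2 * T' * (L * R) :=
      hN'.trans (by nlinarith [mul_le_mul_of_nonneg_left hHT (sq_nonneg a')])
    linarith
  -- `C + DR ≤ 4 U QR`
  have hCD : C + D * R ≤ 4 * U * (Q * R) := by nlinarith [mul_nonneg hQ hR]
  unfold lemma1Icorr
  rw [Real.sq_sqrt (by positivity)]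
  -- term by term
  have h1 : C * S * (R * S + N') * (C + D * R) ≤ 32 * a' ^ 3 * T' * U * (Q * R * L * N) * (L * R) := by
    calc C * S * (R * S + N') * (C + D * R)
        ≤ (4 * N) * (a' * L) * (2 * a' ^ 2 * T' * (L * R)) * (4 * U * (Q * R)) := by
          rw [hS] at hS0 ⊢
          have : 0 ≤ R * (a' * L) + N' := by positivity
          gcongr
          · rw [← hS]; exact hRS
    _ = 32 * a' ^ 3 * T' * U * (Q * R * L * N) * (L * R) := by ring
  have h2 : C ^ 2 * D * S * Real.sqrt ((R * S + N') * R) ≤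
      128 * a' ^ 3 * T' * U * (Q * R * L * N) * (N * L ^ (1 / 2 : ℝ)) := by
    have hsq : Real.sqrt ((R * S + N') * R) ≤ 2 * a' * T' * R * L ^ (1 / 2 : ℝ) := by
      have hle : (R * S + N') * R ≤ (2 * a' ^ 2 * T' * (L * R)) * R := mul_le_mul_of_nonneg_right hRS hR
      refine (Real.sqrt_le_sqrt hle).trans ?_
      have heq : (2 * a' ^ 2 * T' * (L * R)) * R = (a' * R) ^ 2 * ((2 * T') * L) := by ring
      rw [heq, Real.sqrt_mul (by positivity), Real.sqrt_sq (by positivity), Real.sqrt_mul (by positivity),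
        Real.sqrt_eq_rpow L]
      have h2T : Real.sqrt (2 * T') ≤ 2 * T' := by
        rw [Real.sqrt_le_left (by positivity)]
        nlinarith
      calc a' * R * (Real.sqrt (2 * T') * L ^ (1 / 2 : ℝ)) ≤ a' * R * ((2 * T') * L ^ (1 / 2 : ℝ)) := by
            gcongr
        _ = 2 * a' * T' * R * L ^ (1 / 2 : ℝ) := by ring
    calc C ^ 2 * D * S * Real.sqrt ((R * S + N') * R)
        ≤ (4 * N) ^ 2 * (4 * Q) * (a' * L) * (2 * a' * T' * R * L ^ (1 / 2 : ℝ)) := by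
          rw [hS]; gcongr; rw [← hS]; exact hsq
      _ = 128 * (a' ^ 2 * T') * (Q * R * L * N) * (N * L ^ (1 / 2 : ℝ)) := by ring
      _ ≤ 128 * (a' ^ 3 * T' * U) * (Q * R * L * N) * (N * L ^ (1 / 2 : ℝ)) := by
          have : a' ^ 2 * T' ≤ a' ^ 3 * T' * U := by
            calc a' ^ 2 * T' = a' ^ 2 * T' * 1 := by ring
              _ ≤ a' ^ 3 * T' * U := by gcongr
          have h0 : 0 ≤ (Q * R * L * N) * (N * L ^ (1 / 2 : ℝ)) := by positivity
          nlinarith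
      _ = 128 * a' ^ 3 * T' * U * (Q * R * L * N) * (N * L ^ (1 / 2 : ℝ)) := by ring
  have h3 : D ^ 2 * N' * R ≤ 16 * a' ^ 2 * Q ^ 2 * R * H := by
    calc D ^ 2 * N' * R ≤ (4 * Q) ^ 2 * (a' ^ 2 * H) * R := by gcongr
      _ = 16 * a' ^ 2 * Q ^ 2 * R * H := by ring
  linarith

/-- **The main term in the regime (14.4)–(14.6)** (p. 246, last display, corrected): with
`x_B = LMN ≤ x`, `LR ≤ x^{1/2−e}` ((14.5)), `L^{1/2}R ≤ V·M x^{−e}` ((14.6) with slack `V`),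
`Q²R ≤ c₀ x` ((14.4)), `H·M ≤ T·QR` (the length of the dual sum), and the bound of
`lemma1Icorr_sq_block_le`:
`T·(ML/Q)·𝓘² ≤ (32 + 128 V) a'³TT'U x^{2−e} + 16a'²T²c₀ x^{2−e}`.
[cite: BombieriFriedlanderIwaniecActa1986, §14 (14.4)–(14.6) p. 246] -/
theorem main_sq_le {a' C D N' R S L M N Q H T T' U V c₀ x e : ℝ} (ha : 1 ≤ a') (hL : 1 / 2 ≤ L)
    (hM : 0 < M) (hN : 0 ≤ N) (hQ : 0 < Q) (hR : 0 ≤ R) (hT : 1 ≤ T) (hT' : 1 ≤ T')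
    (hU : 1 ≤ U) (hV : 1 ≤ V) (hc₀ : 1 ≤ c₀) (hx : 1 ≤ x) (he : 0 ≤ e) (hC0 : 0 ≤ C) (hD0 : 0 ≤ D)
    (hN'0 : 0 ≤ N') (hC : C ≤ 4 * N) (hD : D ≤ 4 * Q) (hS : S = a' * L) (hN' : N' ≤ a' ^ 2 * H)
    (hHT : H ≤ T' * (L * R)) (hNU : N + Q * R ≤ U * (Q * R)) (hHM : H * M ≤ T * (Q * R))
    (hxB : L * M * N ≤ x) (h5 : L * R ≤ x ^ (1 / 2 - e)) (h6 : L ^ (1 / 2 : ℝ) * R ≤ V * M * x ^ (-e))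
    (hQ2R : Q ^ 2 * R ≤ c₀ * x) :
    T * (M * L / Q) * lemma1Icorr C D N' R S ^ 2 ≤
      ((32 + 128 * V) * a' ^ 3 * T * T' * U + 16 * a' ^ 2 * T ^ 2 * c₀) * x ^ (2 - e) := by
  have hx0 : 0 < x := by linarith
  have hL0 : 0 ≤ L := by linarith
  have hI := lemma1Icorr_sq_block_le ha hL0 hN hQ.le hR hT' hU hC0 hD0 hN'0 hC hD hS hN' hHT hNU
  have hpre : 0 ≤ T * (M * L / Q) := by positivity
  refine (mul_le_mul_of_nonneg_left hI hpre).trans ?_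
  -- the three products
  have e1 : T * (M * L / Q) * (32 * a' ^ 3 * T' * U * (Q * R * L * N) * (L * R)) =
      32 * a' ^ 3 * T * T' * U * ((L * M * N) * (L * R) ^ 2) := by
    field_simp
  have e2 : T * (M * L / Q) * (128 * a' ^ 3 * T' * U * (Q * R * L * N) * (N * L ^ (1 / 2 : ℝ))) =
      128 * a' ^ 3 * T * T' * U * ((L * M * N) * (L ^ (1 / 2 : ℝ) * R) * (L * N)) := by
    field_simp
  have e3 : T * (M * L / Q) * (16 * a' ^ 2 * Q ^ 2 * R * H) = 16 * a' ^ 2 * T * (L * (Q * R) * (H * M)) := by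
    field_simp
  -- the three estimates
  have hx2e : x ^ (2 - e) = x * x ^ (1 - e) := by
    rw [show (2 : ℝ) - e = 1 + (1 - e) by ring, Real.rpow_add hx0, Real.rpow_one]
  have hx1e : x ^ (1 - e) = x ^ (1 / 2 - e) * x ^ (1 / 2 : ℝ) := by
    rw [← Real.rpow_add hx0]; ring_nf
  have hxhalf : x ^ (1 / 2 : ℝ) ≥ 1 := Real.one_le_rpow hx (by norm_num)
  have hLR0 : 0 ≤ L * R := by positivity
  have b1 : (L * M * N) * (L * R) ^ 2 ≤ x ^ (2 - e) := by
    have hsq : (L * R) ^ 2 ≤ x ^ (1 / 2 - e) * x ^ (1 / 2 - e) := by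
      rw [sq]; exact mul_le_mul h5 h5 hLR0 (by positivity)
    have : x ^ (1 / 2 - e) * x ^ (1 / 2 - e) = x ^ (1 - 2 * e) := by rw [← Real.rpow_add hx0]; ring_nf
    rw [this] at hsq
    have hle : x ^ (1 - 2 * e) ≤ x ^ (1 - e) := Real.rpow_le_rpow_of_exponent_le hx (by linarith)
    calc (L * M * N) * (L * R) ^ 2 ≤ x * x ^ (1 - e) := mul_le_mul hxB (hsq.trans hle) (by positivity) hx0.le
      _ = x ^ (2 - e) := hx2e.symm
  have b2 : (L * M * N) * (L ^ (1 / 2 : ℝ) * R) * (L * N) ≤ V * x ^ (2 - e) := by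
    -- `x_B (L^{1/2}R)(LN) ≤ x_B · V M x^{-e} · LN = V x_B² x^{-e} ≤ V x^{2-e}`
    have hLN : 0 ≤ L * N := by positivity
    calc (L * M * N) * (L ^ (1 / 2 : ℝ) * R) * (L * N) ≤ (L * M * N) * (V * M * x ^ (-e)) * (L * N) := by
          gcongr
      _ = V * x ^ (-e) * ((L * M * N) * (L * M * N)) := by ring
      _ ≤ V * x ^ (-e) * (x * x) := by
          have : (L * M * N) * (L * M * N) ≤ x * x := mul_le_mul hxB hxB (by positivity) hx0.le
          exact mul_le_mul_of_nonneg_left this (by positivity)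
      _ = V * x ^ (2 - e) := by
          rw [show (2 : ℝ) - e = -e + 1 + 1 by ring, Real.rpow_add hx0, Real.rpow_add hx0, Real.rpow_one]; ring
  have b3 : L * (Q * R) * (H * M) ≤ T * c₀ * x ^ (2 - e) := by
    -- `L (QR)(HM) ≤ L QR · T QR = T L (Q²R) R ≤ T c₀ x · LR ≤ T c₀ x · x^{1/2-e} ≤ T c₀ x^{2-e}`
    calc L * (Q * R) * (H * M) ≤ L * (Q * R) * (T * (Q * R)) := by gcongr
      _ = T * ((Q ^ 2 * R) * (L * R)) := by ring
      _ ≤ T * ((c₀ * x) * x ^ (1 / 2 - e)) := by gcongr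
      _ = T * c₀ * (x * x ^ (1 / 2 - e)) := by ring
      _ ≤ T * c₀ * x ^ (2 - e) := by
          refine mul_le_mul_of_nonneg_left ?_ (by positivity)
          rw [hx2e, hx1e]
          have : x * x ^ (1 / 2 - e) = x * x ^ (1 / 2 - e) * 1 := by ring
          rw [this, ← mul_assoc]
          exact mul_le_mul_of_nonneg_left hxhalf (by positivity)
  rw [mul_add, mul_add, e1, e2, e3]
  have hK1 : 0 ≤ 32 * a' ^ 3 * T * T' * U := by positivity
  have hK2 : 0 ≤ 128 * a' ^ 3 * T * T' * U := by positivity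
  have hK3 : 0 ≤ 16 * a' ^ 2 * T := by positivity
  calc 32 * a' ^ 3 * T * T' * U * ((L * M * N) * (L * R) ^ 2) +
        128 * a' ^ 3 * T * T' * U * ((L * M * N) * (L ^ (1 / 2 : ℝ) * R) * (L * N)) +
          16 * a' ^ 2 * T * (L * (Q * R) * (H * M))
      ≤ 32 * a' ^ 3 * T * T' * U * x ^ (2 - e) + 128 * a' ^ 3 * T * T' * U * (V * x ^ (2 - e)) +
          16 * a' ^ 2 * T * (T * c₀ * x ^ (2 - e)) :=
        add_le_add (add_le_add (mul_le_mul_of_nonneg_left b1 hK1) (mul_le_mul_of_nonneg_left b2 hK2))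
          (mul_le_mul_of_nonneg_left b3 hK3)
    _ = ((32 + 128 * V) * a' ^ 3 * T * T' * U + 16 * a' ^ 2 * T ^ 2 * c₀) * x ^ (2 - e) := by ring

/-! ### The `q → r` merge: short ranges of `q` are absorbed into the modulus -/

/-- At `SQ = {1}` the `q`-sum is the single bracket at the modulus `k`:
`setQSum a z SM SN {1} k l = setCongrCount a z SM SN l k − setCoprimeCount z SM SN k / φ(k)`. [folklore] -/
theorem setQSum_singleton_one (a : ℤ) (z : ℝ) (SM SN : Finset ℕ) (k l : ℕ) :
    setQSum a z SM SN {1} k l = setCongrCount a z SM SN l k - setCoprimeCount z SM SN k / (Nat.totient k : ℝ) := by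
  unfold setQSum
  have h1 : IsCoprime ((1 : ℕ) : ℤ) (a * l) := by rw [Nat.cast_one]; exact isCoprime_one_left
  rw [Finset.filter_singleton, if_pos h1, Finset.sum_singleton, one_mul]

/-- **The `q → r` merge**: `Δ_sets(SM, SN, SL; SQ, SR) ≤ ∑_{q ∈ SQ} Δ_sets(SM, SN, SL; {1}, q·SR)`:
after the triangle inequality in `q`, for each fixed `q` the map `r ↦ k = qr` is a bijection from
`SR` onto the sparse set `q·SR`, the conditions `(r,a) = 1`, `(l,r) = 1`, `(q,al) = 1` imply
`(k,a) = 1`, `(l,k) = 1`, and the bracket depends on `(q, r)` only through `k`.  (Used for blocks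
with `q` short; the moduli sets `q·SR` are kept sparse.) [cite: BombieriFriedlanderIwaniecActa1986, §14 p. 244] -/
theorem deltaStarSets_qmerge_le (a : ℤ) (z : ℝ) (SM SN SL SQ SR : Finset ℕ) (hSQ : ∀ q ∈ SQ, 0 < q) :
    deltaStarSets a z SM SN SL SQ SR ≤
      ∑ q ∈ SQ, deltaStarSets a z SM SN SL {1} (SR.image (fun r => q * r)) := by
  classical
  -- the bracket at the modulus `k`
  set B : ℕ → ℕ → ℝ := fun l k => setCongrCount a z SM SN l k - setCoprimeCount z SM SN k / (Nat.totient k : ℝ) with hB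
  -- `g(k) = [(k,a)=1] ∑_{l ∈ SL, (l,k)=1} ρ(l) |B(l,k)|`
  set g : ℕ → ℝ := fun k => if IsCoprime (k : ℤ) a then
      ∑ l ∈ SL.filter (fun l : ℕ => l.Coprime k), roughIndicator z l * |B l k| else 0 with hg
  have hg0 : ∀ k, 0 ≤ g k := fun k => by
    simp only [hg]; split_ifs
    · exact Finset.sum_nonneg fun l _ => mul_nonneg (roughIndicator_nonneg z l) (abs_nonneg _)
    · exact le_rfl
  -- the right-hand side blocks as `∑_{k ∈ q·SR} g(k)`
  have hRHS : ∀ S : Finset ℕ, deltaStarSets a z SM SN SL {1} S = ∑ k ∈ S, g k := by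
    intro S
    unfold deltaStarSets
    rw [Finset.sum_filter]
    refine Finset.sum_congr rfl fun k _ => ?_
    simp only [hg, hB, setQSum_singleton_one]
  -- Step 1: triangle inequality in `q` and reordering
  have h1 : deltaStarSets a z SM SN SL SQ SR ≤
      ∑ q ∈ SQ, ∑ r ∈ SR, (if IsCoprime (r : ℤ) a then
        ∑ l ∈ SL.filter (fun l : ℕ => l.Coprime r), roughIndicator z l *
          (if IsCoprime (q : ℤ) (a * l) then |B l (q * r)| else 0) else 0) := by
    unfold deltaStarSets
    rw [Finset.sum_comm, Finset.sum_filter]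
    refine Finset.sum_le_sum fun r _ => ?_
    split_ifs with hra
    · rw [Finset.sum_comm]
      refine Finset.sum_le_sum fun l _ => ?_
      rw [← Finset.mul_sum]
      refine mul_le_mul_of_nonneg_left ?_ (roughIndicator_nonneg z l)
      unfold setQSum
      rw [Finset.sum_filter]
      refine (Finset.abs_sum_le_sum_abs _ _).trans (Finset.sum_le_sum fun q _ => ?_)
      split_ifs
      · rfl
      · rw [abs_zero]
    · simp
  refine h1.trans (Finset.sum_le_sum fun q hq => ?_)
  have hq0 : 0 < q := hSQ q hq
  -- termwise `term(q,r) ≤ g(qr)`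
  have hterm : ∀ r ∈ SR, (if IsCoprime (r : ℤ) a then
      ∑ l ∈ SL.filter (fun l : ℕ => l.Coprime r), roughIndicator z l *
        (if IsCoprime (q : ℤ) (a * l) then |B l (q * r)| else 0) else 0) ≤ g (q * r) := by
    intro r _
    split_ifs with hra
    · by_cases hka : IsCoprime ((q * r : ℕ) : ℤ) a
      · simp only [hg, if_pos hka]
        rw [show ∑ l ∈ SL.filter (fun l : ℕ => l.Coprime r), roughIndicator z l *
            (if IsCoprime (q : ℤ) (a * l) then |B l (q * r)| else 0) =
            ∑ l ∈ (SL.filter (fun l : ℕ => l.Coprime r)).filter (fun l : ℕ => IsCoprime (q : ℤ) (a * l)),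
              roughIndicator z l * |B l (q * r)| by
          rw [Finset.sum_filter (p := fun l : ℕ => IsCoprime (q : ℤ) (a * l))]
          refine Finset.sum_congr rfl fun l _ => ?_
          split_ifs <;> simp]
        refine Finset.sum_le_sum_of_subset_of_nonneg ?_ fun l _ _ => mul_nonneg (roughIndicator_nonneg z l) (abs_nonneg _)
        intro l hl
        rw [Finset.mem_filter, Finset.mem_filter] at hl
        rw [Finset.mem_filter]
        refine ⟨hl.1.1, Nat.Coprime.mul_right ?_ hl.1.2⟩
        exact (Nat.isCoprime_iff_coprime.1 (IsCoprime.of_mul_right_right hl.2)).symm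
      · have hzero : ∀ l ∈ SL.filter (fun l : ℕ => l.Coprime r),
            roughIndicator z l * (if IsCoprime (q : ℤ) (a * l) then |B l (q * r)| else 0) = 0 := by
          intro l _
          rw [if_neg, mul_zero]
          intro hq'
          apply hka
          rw [Nat.cast_mul]
          exact IsCoprime.mul_left (IsCoprime.of_mul_right_left hq') hra
        rw [Finset.sum_eq_zero hzero]
        exact hg0 _
    · exact hg0 _
  calc _ ≤ ∑ r ∈ SR, g (q * r) := Finset.sum_le_sum hterm
    _ = ∑ k ∈ SR.image (fun r => q * r), g k := by
        rw [Finset.sum_image]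
        intro r₁ _ r₂ _ h
        exact Nat.eq_of_mul_eq_mul_left hq0 h
    _ = _ := (hRHS _).symm

/-! ### The `n → l` merge: short ranges of `n` are absorbed into `l` -/

/-- **The `n → l` merge at the level of the `q`-sums** (`z ≤ 2`): for `(r, a) = 1`,
`setQSum a z SM SN SQ r l = ∑_{n ∈ SN, (n,r)=1} setQSum a z SM {1} SQ r (ln)` — an exact identity:
the terms with `(n, r) > 1` or `(q, n) > 1` vanish on both sides.
[cite: BombieriFriedlanderIwaniecActa1986, §14 p. 244] -/
theorem setQSum_nmerge {z : ℝ} (hz : z ≤ 2) {a : ℤ} (SM SN SQ : Finset ℕ) {r : ℕ}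
    (hra : IsCoprime (r : ℤ) a) (l : ℕ) :
    setQSum a z SM SN SQ r l = ∑ n ∈ SN.filter (fun n => n.Coprime r), setQSum a z SM {1} SQ r (l * n) := by
  classical
  -- the summands `X(q, n)` of the left side and `X'(q, n)` of the right side
  set X : ℕ → ℕ → ℝ := fun q n =>
    (∑ m ∈ SM, (if ((l * m * n : ℕ) : ZMod (q * r)) = (a : ZMod (q * r)) then (1 : ℝ) else 0)) -
      (∑ m ∈ SM, (if (m * n).Coprime (q * r) then (1 : ℝ) else 0)) / (Nat.totient (q * r) : ℝ) with hX
  -- the left side as `∑_n ∑_{q, (q,al)=1} X(q,n)`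
  have hL : setQSum a z SM SN SQ r l =
      ∑ n ∈ SN, ∑ q ∈ SQ.filter (fun q : ℕ => IsCoprime (q : ℤ) (a * l)), X q n := by
    unfold setQSum setCongrCount setCoprimeCount
    rw [Finset.sum_comm]
    refine Finset.sum_congr rfl fun q _ => ?_
    simp only [roughIndicator_of_le_two hz, mul_one, hX]
    rw [Finset.sum_sub_distrib, Finset.sum_comm, ← Finset.sum_div, Finset.sum_comm (s := SM)]
  -- the right side summand at `n`
  have hR : ∀ n : ℕ, setQSum a z SM {1} SQ r (l * n) =
      ∑ q ∈ SQ.filter (fun q : ℕ => IsCoprime (q : ℤ) (a * ((l * n : ℕ) : ℤ))),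
        ((∑ m ∈ SM, (if (((l * n) * m : ℕ) : ZMod (q * r)) = (a : ZMod (q * r)) then (1 : ℝ) else 0)) -
          (∑ m ∈ SM, (if m.Coprime (q * r) then (1 : ℝ) else 0)) / (Nat.totient (q * r) : ℝ)) := by
    intro n
    unfold setQSum setCongrCount setCoprimeCount
    simp only [roughIndicator_of_le_two hz, mul_one, Finset.sum_singleton]
  rw [hL, Finset.sum_filter]
  refine Finset.sum_congr rfl fun n _ => ?_
  by_cases hnr : n.Coprime r
  · rw [if_pos hnr, hR n]
    -- split the `q`-filter of the left side according to `(q, n) = 1`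
    have hsplit : SQ.filter (fun q : ℕ => IsCoprime (q : ℤ) (a * l)) =
        SQ.filter (fun q : ℕ => IsCoprime (q : ℤ) (a * ((l * n : ℕ) : ℤ))) ∪
          SQ.filter (fun q : ℕ => IsCoprime (q : ℤ) (a * l) ∧ ¬ q.Coprime n) := by
      ext q
      simp only [Finset.mem_filter, Finset.mem_union]
      constructor
      · intro ⟨hq, hc⟩
        by_cases hqn : q.Coprime n
        · left
          refine ⟨hq, ?_⟩
          rw [show a * ((l * n : ℕ) : ℤ) = a * l * (n : ℤ) by push_cast; ring]
          exact IsCoprime.mul_right hc (Nat.isCoprime_iff_coprime.2 hqn)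
        · right; exact ⟨hq, hc, hqn⟩
      · rintro (⟨hq, hc⟩ | ⟨hq, hc, -⟩)
        · refine ⟨hq, ?_⟩
          rw [show a * ((l * n : ℕ) : ℤ) = a * l * (n : ℤ) by push_cast; ring] at hc
          exact IsCoprime.of_mul_right_left hc
        · exact ⟨hq, hc⟩
    have hdisj : Disjoint (SQ.filter (fun q : ℕ => IsCoprime (q : ℤ) (a * ((l * n : ℕ) : ℤ))))
        (SQ.filter (fun q : ℕ => IsCoprime (q : ℤ) (a * l) ∧ ¬ q.Coprime n)) := by
      rw [Finset.disjoint_left]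
      intro q h1 h2
      rw [Finset.mem_filter] at h1 h2
      apply h2.2.2
      have hc := h1.2
      rw [show a * ((l * n : ℕ) : ℤ) = a * l * (n : ℤ) by push_cast; ring] at hc
      exact Nat.isCoprime_iff_coprime.1 (IsCoprime.of_mul_right_right hc)
    rw [hsplit, Finset.sum_union hdisj]
    -- the second part vanishes
    have hvan : ∑ q ∈ SQ.filter (fun q : ℕ => IsCoprime (q : ℤ) (a * l) ∧ ¬ q.Coprime n), X q n = 0 := by
      refine Finset.sum_eq_zero fun q hq => ?_
      rw [Finset.mem_filter] at hq
      obtain ⟨-, hqal, hqn⟩ := hq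
      have hqa : IsCoprime (q : ℤ) a := IsCoprime.of_mul_right_left hqal
      simp only [hX]
      have h1 : ∀ m ∈ SM, (if ((l * m * n : ℕ) : ZMod (q * r)) = (a : ZMod (q * r)) then (1 : ℝ) else 0) = 0 := by
        intro m _
        rw [if_neg]
        intro hcong
        -- `(qr, a) = 1` and `lmn ≡ a (qr)` force `(n, qr) = 1`, contradicting `(q, n) ≠ 1`
        have hka : IsCoprime ((q * r : ℕ) : ℤ) a := by
          rw [Nat.cast_mul]; exact IsCoprime.mul_left hqa hra
        have := coprime_of_natCast_mul_eq hka (m := n) (n := l * m) (by rwa [show n * (l * m) = l * m * n by ring])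
        exact hqn (Nat.Coprime.coprime_dvd_left (dvd_mul_right q r) this)
      have h2 : ∀ m ∈ SM, (if (m * n).Coprime (q * r) then (1 : ℝ) else 0) = 0 := by
        intro m _
        rw [if_neg]
        intro hc
        exact hqn (Nat.Coprime.coprime_dvd_right (dvd_mul_right q r) (Nat.Coprime.coprime_mul_left hc)).symm
      rw [Finset.sum_eq_zero h1, Finset.sum_eq_zero h2]
      simp
    rw [hvan, add_zero]
    refine Finset.sum_congr rfl fun q hq => ?_
    rw [Finset.mem_filter] at hq
    have hc := hq.2
    rw [show a * ((l * n : ℕ) : ℤ) = a * l * (n : ℤ) by push_cast; ring] at hc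
    have hqn : q.Coprime n := Nat.isCoprime_iff_coprime.1 (IsCoprime.of_mul_right_right hc)
    have hnqr : n.Coprime (q * r) := Nat.Coprime.mul_right hqn.symm hnr
    simp only [hX]
    congr 1
    · refine Finset.sum_congr rfl fun m _ => ?_
      rw [show l * n * m = l * m * n by ring]
    · congr 1
      refine Finset.sum_congr rfl fun m _ => ?_
      have : (m * n).Coprime (q * r) ↔ m.Coprime (q * r) :=
        ⟨fun h => Nat.Coprime.coprime_mul_right h, fun h => Nat.Coprime.mul_left h hnqr⟩
      simp only [this]
  · rw [if_neg hnr]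
    -- every `X(q, n)` vanishes when `(n, r) > 1`
    refine Finset.sum_eq_zero fun q hq => ?_
    rw [Finset.mem_filter] at hq
    have hqa : IsCoprime (q : ℤ) a := IsCoprime.of_mul_right_left hq.2
    simp only [hX]
    have h1 : ∀ m ∈ SM, (if ((l * m * n : ℕ) : ZMod (q * r)) = (a : ZMod (q * r)) then (1 : ℝ) else 0) = 0 := by
      intro m _
      rw [if_neg]
      intro hcong
      have hka : IsCoprime ((q * r : ℕ) : ℤ) a := by
        rw [Nat.cast_mul]; exact IsCoprime.mul_left hqa hra
      have := coprime_of_natCast_mul_eq hka (m := n) (n := l * m) (by rwa [show n * (l * m) = l * m * n by ring])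
      exact hnr (Nat.Coprime.coprime_dvd_left (dvd_mul_left r q) this).symm
    have h2 : ∀ m ∈ SM, (if (m * n).Coprime (q * r) then (1 : ℝ) else 0) = 0 := by
      intro m _
      rw [if_neg]
      intro hc
      exact hnr (Nat.Coprime.coprime_dvd_right (dvd_mul_left r q) (Nat.Coprime.coprime_mul_left hc))
    rw [Finset.sum_eq_zero h1, Finset.sum_eq_zero h2]
    simp

/-- **The `n → l` merge**: for `z ≤ 2`,
`Δ_sets(SM; SN, SL; SQ, SR) ≤ ∑_{n ∈ SN} Δ_sets(SM; {1}, SL·n; SQ, SR)` (the map `l ↦ l' = ln` is a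
bijection from `SL` onto the sparse set `SL·n`, and `(ln, r) = 1` when `(l,r) = (n,r) = 1`).  Used
for blocks with `n` short. [cite: BombieriFriedlanderIwaniecActa1986, §14 p. 244] -/
theorem deltaStarSets_nmerge_le {z : ℝ} (hz : z ≤ 2) (a : ℤ) (SM SN SL SQ SR : Finset ℕ)
    (hSN : ∀ n ∈ SN, 0 < n) :
    deltaStarSets a z SM SN SL SQ SR ≤
      ∑ n ∈ SN, deltaStarSets a z SM {1} (SL.image (fun l => l * n)) SQ SR := by
  classical
  unfold deltaStarSets
  simp only [roughIndicator_of_le_two hz, one_mul]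
  rw [Finset.sum_comm]
  refine Finset.sum_le_sum fun r hr => ?_
  have hr' := Finset.mem_filter.1 hr
  have hra := hr'.2
  calc ∑ l ∈ SL.filter (fun l : ℕ => l.Coprime r), |setQSum a z SM SN SQ r l|
      ≤ ∑ l ∈ SL.filter (fun l : ℕ => l.Coprime r),
          ∑ n ∈ SN.filter (fun n => n.Coprime r), |setQSum a z SM {1} SQ r (l * n)| := by
        refine Finset.sum_le_sum fun l _ => ?_
        rw [setQSum_nmerge hz SM SN SQ hra l]
        exact Finset.abs_sum_le_sum_abs _ _
    _ = ∑ n ∈ SN.filter (fun n => n.Coprime r), ∑ l ∈ SL.filter (fun l : ℕ => l.Coprime r),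
          |setQSum a z SM {1} SQ r (l * n)| := Finset.sum_comm
    _ ≤ ∑ n ∈ SN, ∑ l' ∈ (SL.image (fun l => l * n)).filter (fun l' : ℕ => l'.Coprime r),
          |setQSum a z SM {1} SQ r l'| := by
        refine le_trans ?_ (Finset.sum_le_sum_of_subset_of_nonneg
          (Finset.filter_subset (fun n : ℕ => n.Coprime r) SN) fun n _ _ =>
          Finset.sum_nonneg fun l _ => abs_nonneg _)
        refine Finset.sum_le_sum fun n hn => ?_
        have hn' := Finset.mem_filter.1 hn
        have hn0 : 0 < n := hSN n hn'.1
        have himg : ∑ l ∈ SL.filter (fun l : ℕ => l.Coprime r), |setQSum a z SM {1} SQ r (l * n)| =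
            ∑ l' ∈ (SL.filter (fun l : ℕ => l.Coprime r)).image (fun l => l * n), |setQSum a z SM {1} SQ r l'| :=
          (Finset.sum_image (f := fun l' => |setQSum a z SM {1} SQ r l'|) (g := fun l => l * n)
            fun l₁ _ l₂ _ h => Nat.eq_of_mul_eq_mul_right hn0 h).symm
        rw [himg]
        refine Finset.sum_le_sum_of_subset_of_nonneg ?_ fun l _ _ => abs_nonneg _
        intro l' hl'
        rw [Finset.mem_image] at hl'
        obtain ⟨l, hl, rfl⟩ := hl'
        have hl'' := Finset.mem_filter.1 hl
        rw [Finset.mem_filter, Finset.mem_image]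
        exact ⟨⟨l, hl''.1, rfl⟩, Nat.Coprime.mul_left hl''.2 hn'.2⟩

/-! ### The weighted `q → r` merge (after smoothing `m`, `n`) -/

/-- **The `q → r` merge with weights**: for any weights `α, β` and the indicator of a set `SQ` of
positive integers on `q`,
`Δ(α, β, 1_{SQ}; SL, SR) ≤ ∑_{q ∈ SQ} Δ(α, β, 1_{{1}}; SL, q·SR)` with `Xq = 1` on the right
(for fixed `q`, `r ↦ qr` is a bijection `SR → q·SR`; `(r,a)=1, (l,r)=1, (q,al)=1 ⇒ (qr,a)=1, (l,qr)=1`).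
[cite: BombieriFriedlanderIwaniecActa1986, §14 p. 244] -/
theorem tripleTS_qmerge_le (a : ℤ) (Xm Xn Xq : ℕ) (α β : ℕ → ℝ) (SQ SL SR : Finset ℕ)
    (hSQ : ∀ q ∈ SQ, 0 < q) :
    tripleTS a Xm Xn Xq α β (ind SQ) SL SR ≤
      ∑ q ∈ SQ, tripleTS a Xm Xn 1 α β (ind {1}) SL (SR.image (fun r => q * r)) := by
  classical
  set Bk : ℕ → ℕ → ℝ := fun l k => bracketT a Xm Xn α β l k with hBk
  -- `g(k) = [(k,a)=1] ∑_{l ∈ SL, (l,k)=1} |B(l,k)|`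
  set g : ℕ → ℝ := fun k => if IsCoprime (k : ℤ) a then
      ∑ l ∈ SL.filter (fun l : ℕ => l.Coprime k), |Bk l k| else 0 with hg
  have hg0 : ∀ k, 0 ≤ g k := fun k => by
    simp only [hg]; split_ifs
    · exact Finset.sum_nonneg fun l _ => abs_nonneg _
    · exact le_rfl
  -- the right-hand side pieces as `∑_{k ∈ q·SR} g(k)`
  have hRHS : ∀ S : Finset ℕ, tripleTS a Xm Xn 1 α β (ind {1}) SL S = ∑ k ∈ S, g k := by
    intro S
    unfold tripleTS
    rw [Finset.sum_filter]
    refine Finset.sum_congr rfl fun k _ => ?_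
    simp only [hg]
    split_ifs with hka
    · refine Finset.sum_congr rfl fun l _ => ?_
      unfold qSumT
      have h1 : IsCoprime ((1 : ℕ) : ℤ) (a * l) := by rw [Nat.cast_one]; exact isCoprime_one_left
      rw [show Icc 1 1 = ({1} : Finset ℕ) by rfl, Finset.filter_singleton, if_pos h1, Finset.sum_singleton,
        ind_of_mem (Finset.mem_singleton_self 1), one_mul, one_mul]
    · rfl
  -- Step 1: `|qSumT| ≤ ∑_{q ∈ SQ} [(q,al)=1] |B(l, qr)|`, then reorder
  have h1 : tripleTS a Xm Xn Xq α β (ind SQ) SL SR ≤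
      ∑ q ∈ SQ, ∑ r ∈ SR, (if IsCoprime (r : ℤ) a then
        ∑ l ∈ SL.filter (fun l : ℕ => l.Coprime r),
          (if IsCoprime (q : ℤ) (a * l) then |Bk l (q * r)| else 0) else 0) := by
    unfold tripleTS
    rw [Finset.sum_comm, Finset.sum_filter]
    refine Finset.sum_le_sum fun r _ => ?_
    split_ifs with hra
    · rw [Finset.sum_comm]
      refine Finset.sum_le_sum fun l _ => ?_
      unfold qSumT
      calc |∑ q ∈ (Icc 1 Xq).filter (fun q : ℕ => IsCoprime (q : ℤ) (a * l)), ind SQ q * bracketT a Xm Xn α β l (q * r)|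
          ≤ ∑ q ∈ (Icc 1 Xq).filter (fun q : ℕ => IsCoprime (q : ℤ) (a * l)), |ind SQ q * bracketT a Xm Xn α β l (q * r)| :=
            Finset.abs_sum_le_sum_abs _ _
        _ = ∑ q ∈ Icc 1 Xq, (if IsCoprime (q : ℤ) (a * l) then |ind SQ q * bracketT a Xm Xn α β l (q * r)| else 0) :=
            Finset.sum_filter _ _
        _ ≤ ∑ q ∈ Icc 1 Xq, (if q ∈ SQ then (if IsCoprime (q : ℤ) (a * l) then |Bk l (q * r)| else 0) else 0) := by
            refine Finset.sum_le_sum fun q _ => ?_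
            by_cases hqS : q ∈ SQ
            · rw [if_pos hqS, ind_of_mem hqS, one_mul]
            · rw [if_neg hqS, ind_of_not_mem hqS, zero_mul, abs_zero]; split_ifs <;> rfl
        _ = ∑ q ∈ (Icc 1 Xq).filter (fun q => q ∈ SQ), (if IsCoprime (q : ℤ) (a * l) then |Bk l (q * r)| else 0) :=
            (Finset.sum_filter _ _).symm
        _ ≤ ∑ q ∈ SQ, (if IsCoprime (q : ℤ) (a * l) then |Bk l (q * r)| else 0) :=
            Finset.sum_le_sum_of_subset_of_nonneg (fun q hq => (Finset.mem_filter.1 hq).2) fun q _ _ => by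
              split_ifs
              · exact abs_nonneg _
              · exact le_rfl
    · simp
  refine h1.trans (Finset.sum_le_sum fun q hq => ?_)
  have hq0 : 0 < q := hSQ q hq
  have hterm : ∀ r ∈ SR, (if IsCoprime (r : ℤ) a then
      ∑ l ∈ SL.filter (fun l : ℕ => l.Coprime r),
        (if IsCoprime (q : ℤ) (a * l) then |Bk l (q * r)| else 0) else 0) ≤ g (q * r) := by
    intro r _
    split_ifs with hra
    · by_cases hka : IsCoprime ((q * r : ℕ) : ℤ) a
      · simp only [hg, if_pos hka]
        rw [show ∑ l ∈ SL.filter (fun l : ℕ => l.Coprime r),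
            (if IsCoprime (q : ℤ) (a * l) then |Bk l (q * r)| else 0) =
            ∑ l ∈ (SL.filter (fun l : ℕ => l.Coprime r)).filter (fun l : ℕ => IsCoprime (q : ℤ) (a * l)),
              |Bk l (q * r)| from (Finset.sum_filter _ _).symm]
        refine Finset.sum_le_sum_of_subset_of_nonneg ?_ fun l _ _ => abs_nonneg _
        intro l hl
        rw [Finset.mem_filter, Finset.mem_filter] at hl
        rw [Finset.mem_filter]
        refine ⟨hl.1.1, Nat.Coprime.mul_right ?_ hl.1.2⟩
        exact (Nat.isCoprime_iff_coprime.1 (IsCoprime.of_mul_right_right hl.2)).symm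
      · have hzero : ∀ l ∈ SL.filter (fun l : ℕ => l.Coprime r),
            (if IsCoprime (q : ℤ) (a * l) then |Bk l (q * r)| else 0) = 0 := by
          intro l _
          rw [if_neg]
          intro hq'
          apply hka
          rw [Nat.cast_mul]
          exact IsCoprime.mul_left (IsCoprime.of_mul_right_left hq') hra
        rw [Finset.sum_eq_zero hzero]
        exact hg0 _
    · exact hg0 _
  calc _ ≤ ∑ r ∈ SR, g (q * r) := Finset.sum_le_sum hterm
    _ = ∑ k ∈ SR.image (fun r => q * r), g k := by
        rw [Finset.sum_image]
        intro r₁ _ r₂ _ h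
        exact Nat.eq_of_mul_eq_mul_left hq0 h
    _ = _ := (hRHS _).symm

/-- Smoothing `m` and `n` only (keeping `γ`):
`Δ(1_M, 1_N, γ) ≤ Δ(α, β, γ) + Δ(α − 1_M, 1_N, γ) + Δ(α, β − 1_N, γ)`. [folklore] -/
theorem tripleTS_indicator_le_split_mn (a : ℤ) (Xm Xn Xq : ℕ) (α β γ : ℕ → ℝ) (SM SN SL SR : Finset ℕ) :
    tripleTS a Xm Xn Xq (ind SM) (ind SN) γ SL SR ≤
      tripleTS a Xm Xn Xq α β γ SL SR + tripleTS a Xm Xn Xq (α - ind SM) (ind SN) γ SL SR +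
        tripleTS a Xm Xn Xq α (β - ind SN) γ SL SR := by
  have h1 := tripleTS_sub_le_alpha a Xm Xn Xq α (α - ind SM) (ind SN) γ SL SR
  have h2 := tripleTS_sub_le_beta a Xm Xn Xq α β (β - ind SN) γ SL SR
  rw [sub_sub_cancel] at h1 h2
  linarith

/-- Smoothing `m` only: `Δ(1_M, β, γ) ≤ Δ(α, β, γ) + Δ(α − 1_M, β, γ)`. [folklore] -/
theorem tripleTS_indicator_le_split_m (a : ℤ) (Xm Xn Xq : ℕ) (α β γ : ℕ → ℝ) (SM SL SR : Finset ℕ) :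
    tripleTS a Xm Xn Xq (ind SM) β γ SL SR ≤
      tripleTS a Xm Xn Xq α β γ SL SR + tripleTS a Xm Xn Xq (α - ind SM) β γ SL SR := by
  have h1 := tripleTS_sub_le_alpha a Xm Xn Xq α (α - ind SM) β γ SL SR
  rw [sub_sub_cancel] at h1
  linarith

/-! ### Powers of the logarithm -/

/-- `(1 + log 2x)^k ≤ C_{k,δ} x^δ` for `x ≥ 1`. [folklore] -/
theorem one_add_log_pow_le {δ : ℝ} (hδ : 0 < δ) (k : ℕ) :
    ∃ C : ℝ, 0 < C ∧ ∀ x : ℝ, 1 ≤ x → (1 + Real.log (2 * x)) ^ k ≤ C * x ^ δ := by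
  rcases Nat.eq_zero_or_pos k with hk | hk
  · refine ⟨1, one_pos, fun x hx => ?_⟩
    rw [hk, pow_zero, one_mul]
    exact Real.one_le_rpow hx hδ.le
  obtain ⟨C, hC, h⟩ := one_add_log_pow_four_le (δ := δ / k) (by positivity)
  refine ⟨C ^ k, by positivity, fun x hx => ?_⟩
  have hx0 : 0 < x := by linarith
  have hbase : 1 ≤ 1 + Real.log (2 * x) := by
    have := Real.log_nonneg (show (1 : ℝ) ≤ 2 * x by linarith)
    linarith
  calc (1 + Real.log (2 * x)) ^ k ≤ (1 + Real.log (2 * x)) ^ (4 * k) :=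
        pow_le_pow_right₀ hbase (by omega)
    _ = ((1 + Real.log (2 * x)) ^ 4) ^ k := by rw [pow_mul]
    _ ≤ (C * x ^ (δ / k)) ^ k := pow_le_pow_left₀ (by positivity) (h x hx) k
    _ = C ^ k * x ^ δ := by
        rw [mul_pow, ← Real.rpow_natCast (x ^ (δ / k)) k, ← Real.rpow_mul hx0.le]
        congr 2
        field_simp

/-! ### The three terms of `piece_chain` as powers of `x` -/

/-- `(1 + log t)^k ≤ C 2^δ' x^{δ'}`-type bound: for `1 ≤ t ≤ 4x`, `(1 + log t)^k ≤ C_{k,δ} (2x)^δ`.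
[folklore] -/
theorem one_add_log_pow_le_of_le {δ : ℝ} (hδ : 0 < δ) (k : ℕ) :
    ∃ C : ℝ, 0 < C ∧ ∀ x t : ℝ, 1 ≤ x → 1 ≤ t → t ≤ 4 * x → (1 + Real.log t) ^ k ≤ C * x ^ δ := by
  obtain ⟨C₂, hC₂, h₂⟩ := one_add_log_pow_le hδ k
  refine ⟨C₂ * 2 ^ δ, by positivity, fun x t hx ht htx => ?_⟩
  have hx0 : 0 < x := by linarith
  have h4 : t ≤ 2 * (2 * x) := by linarith
  have hlog : 1 + Real.log t ≤ 1 + Real.log (2 * (2 * x)) := by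
    have := Real.log_le_log (by linarith : 0 < t) h4
    linarith
  have h0 : 0 ≤ 1 + Real.log t := by linarith [Real.log_nonneg ht]
  calc (1 + Real.log t) ^ k ≤ (1 + Real.log (2 * (2 * x))) ^ k := pow_le_pow_left₀ h0 hlog k
    _ ≤ C₂ * (2 * x) ^ δ := h₂ (2 * x) (by linarith)
    _ = C₂ * 2 ^ δ * x ^ δ := by rw [Real.mul_rpow (by norm_num) hx0.le]; ring

/-- `∑_{q ≤ ⌊4D⌋} ∑_{r ≤ ⌊2R⌋} σ₀(qr)/φ(qr) ≤ C_δ x^δ` for `D, R ≤ x`. [folklore] -/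
theorem sum_sum_sigma_div_totient_le_rpow {δ : ℝ} (hδ : 0 < δ) :
    ∃ C : ℝ, 0 < C ∧ ∀ x D R : ℝ, 1 ≤ x → 1 / 4 ≤ D → D ≤ x → 1 / 2 ≤ R → R ≤ x →
      ∑ q ∈ Icc 1 ⌊4 * D⌋₊, ∑ r ∈ Icc 1 ⌊2 * R⌋₊, (σ 0 (q * r) : ℝ) / (Nat.totient (q * r) : ℝ) ≤ C * x ^ δ := by
  obtain ⟨C₁, hC₁, h₁⟩ := sum_sum_sigma_sq_div_totient_le_log
  obtain ⟨C₂, hC₂, h₂⟩ := one_add_log_pow_le_of_le (δ := δ / 2) (by positivity) 16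
  refine ⟨C₁ * C₂ ^ 2, by positivity, fun x D R hx hD hDx hR hRx => ?_⟩
  have hx0 : 0 < x := by linarith
  have h4D : 1 ≤ 4 * D := by linarith
  have h2R : 1 ≤ 2 * R := by linarith
  calc ∑ q ∈ Icc 1 ⌊4 * D⌋₊, ∑ r ∈ Icc 1 ⌊2 * R⌋₊, (σ 0 (q * r) : ℝ) / (Nat.totient (q * r) : ℝ)
      ≤ ∑ r ∈ Icc 1 ⌊2 * R⌋₊, ∑ q ∈ Icc 1 ⌊4 * D⌋₊, (σ 0 (q * r) : ℝ) ^ 2 / (Nat.totient (q * r) : ℝ) := by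
        rw [Finset.sum_comm]
        refine Finset.sum_le_sum fun r hr => Finset.sum_le_sum fun q hq => ?_
        have hqr : q * r ≠ 0 := Nat.mul_ne_zero (by have := (Finset.mem_Icc.1 hq).1; omega)
          (by have := (Finset.mem_Icc.1 hr).1; omega)
        have h1 : (1 : ℝ) ≤ (σ 0 (q * r) : ℝ) := by exact_mod_cast one_le_sigma_zero hqr
        refine div_le_div_of_nonneg_right ?_ (Nat.cast_nonneg _)
        nlinarith
    _ ≤ C₁ * (1 + Real.log (4 * D)) ^ 16 * (1 + Real.log (2 * R)) ^ 16 := h₁ (4 * D) (2 * R) h4D h2R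
    _ ≤ C₁ * (C₂ * x ^ (δ / 2)) * (C₂ * x ^ (δ / 2)) := by
        have hD' := h₂ x (4 * D) hx h4D (by linarith)
        have hR' := h₂ x (2 * R) hx h2R (by linarith)
        have h0 : 0 ≤ (1 + Real.log (4 * D)) ^ 16 := pow_nonneg (by linarith [Real.log_nonneg h4D]) 16
        gcongr
    _ = C₁ * C₂ ^ 2 * (x ^ (δ / 2) * x ^ (δ / 2)) := by ring
    _ = C₁ * C₂ ^ 2 * x ^ δ := by rw [← Real.rpow_add hx0]; ring_nf

/-- **The Poisson term of `piece_chain` is `≪ x^{1−ε₁/2}`** when `⌊4C⌋ #SL ≤ 45 x/M₁` and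
`x^s ≤ 8M₁` with `s ≥ 3ε₁`. [cite: BombieriFriedlanderIwaniecActa1986, §14 (14.3) p. 245] -/
theorem poisson_term_le {ε₁ s τ : ℝ} (hε₁ : 0 < ε₁) (hs : τ + 2 * ε₁ ≤ s) (j : ℕ) :
    ∃ Cp : ℝ, 0 < Cp ∧ ∀ (x M₁ C D R₁ : ℝ) (SL : Finset ℕ), 1 ≤ x → 1 ≤ M₁ → x ^ s ≤ 8 * M₁ →
      1 / 4 ≤ D → D ≤ x → 1 / 2 ≤ R₁ → R₁ ≤ x → ((⌊4 * C⌋₊ : ℕ) : ℝ) * SL.card ≤ 45 * x / M₁ →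
      ((⌊4 * C⌋₊ : ℕ) : ℝ) * ((SL.card : ℝ) * (118 * derivConst j * x ^ (3 * ε₁ / 2)) *
        ∑ q ∈ Icc 1 ⌊4 * D⌋₊, ∑ r ∈ Icc 1 ⌊2 * R₁⌋₊, (σ 0 (q * r) : ℝ) / (Nat.totient (q * r) : ℝ)) ≤
        Cp * x ^ (1 - τ) := by
  obtain ⟨Cτ, hCτ, hτ⟩ := sum_sum_sigma_div_totient_le_rpow (δ := ε₁ / 2) (by positivity)
  have hKj := one_le_derivConst j
  refine ⟨45 * 8 * (118 * derivConst j) * Cτ, by positivity, ?_⟩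
  intro x M₁ C D R₁ SL hx hM₁ hM₁s hD hDx hR hRx hCSL
  have hx0 : 0 < x := by linarith
  have hS := hτ x D R₁ hx hD hDx hR hRx
  have hS0 : 0 ≤ ∑ q ∈ Icc 1 ⌊4 * D⌋₊, ∑ r ∈ Icc 1 ⌊2 * R₁⌋₊, (σ 0 (q * r) : ℝ) / (Nat.totient (q * r) : ℝ) :=
    Finset.sum_nonneg fun q _ => Finset.sum_nonneg fun r _ => by positivity
  -- `x / M₁ ≤ 8 x^{1-s}`
  have hxM : x / M₁ ≤ 8 * x ^ (1 - s) := by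
    rw [div_le_iff₀ (by positivity), Real.rpow_sub hx0, Real.rpow_one]
    rw [show 8 * (x / x ^ s) * M₁ = x * (8 * M₁) / x ^ s by ring, le_div_iff₀ (by positivity)]
    exact mul_le_mul_of_nonneg_left hM₁s hx0.le
  calc ((⌊4 * C⌋₊ : ℕ) : ℝ) * ((SL.card : ℝ) * (118 * derivConst j * x ^ (3 * ε₁ / 2)) *
        ∑ q ∈ Icc 1 ⌊4 * D⌋₊, ∑ r ∈ Icc 1 ⌊2 * R₁⌋₊, (σ 0 (q * r) : ℝ) / (Nat.totient (q * r) : ℝ))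
      = (((⌊4 * C⌋₊ : ℕ) : ℝ) * SL.card) * (118 * derivConst j) * (x ^ (3 * ε₁ / 2) *
          ∑ q ∈ Icc 1 ⌊4 * D⌋₊, ∑ r ∈ Icc 1 ⌊2 * R₁⌋₊, (σ 0 (q * r) : ℝ) / (Nat.totient (q * r) : ℝ)) := by ring
    _ ≤ (45 * x / M₁) * (118 * derivConst j) * (x ^ (3 * ε₁ / 2) * (Cτ * x ^ (ε₁ / 2))) := by gcongr
    _ ≤ (45 * (8 * x ^ (1 - s))) * (118 * derivConst j) * (x ^ (3 * ε₁ / 2) * (Cτ * x ^ (ε₁ / 2))) := by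
        rw [mul_div_assoc]; gcongr
    _ = 45 * 8 * (118 * derivConst j) * Cτ * (x ^ (1 - s) * x ^ (3 * ε₁ / 2) * x ^ (ε₁ / 2)) := by ring
    _ = 45 * 8 * (118 * derivConst j) * Cτ * x ^ (1 - s + 2 * ε₁) := by
        rw [← Real.rpow_add hx0, ← Real.rpow_add hx0]; ring_nf
    _ ≤ 45 * 8 * (118 * derivConst j) * Cτ * x ^ (1 - τ) := by
        refine mul_le_mul_of_nonneg_left (Real.rpow_le_rpow_of_exponent_le hx ?_) (by positivity)
        linarith

/-- **The reciprocity term of `piece_chain` is `≪ |a| c₀ x^{1−ε₁/2}`** when `x^s ≤ 8M₁`, `s ≥ 5ε₁`,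
`Q₁²R₁ ≤ c₀ x`. [cite: BombieriFriedlanderIwaniecActa1986, §14 p. 245] -/
theorem recip_term_le {ε₁ s τ : ℝ} (hε₁ : 0 < ε₁) (hs : τ + 9 * ε₁ / 2 ≤ s) :
    ∃ Cr : ℝ, 0 < Cr ∧ ∀ (a : ℤ) (x M₁ Y Q₁ R₁ C c₀ : ℝ), 1 ≤ x → 1 ≤ M₁ → x ^ s ≤ 8 * M₁ →
      0 < Y → Y ≤ M₁ / 2 → 1 / 2 ≤ Q₁ → 1 / 2 ≤ R₁ → Q₁ ^ 2 * R₁ ≤ c₀ * x → 1 ≤ c₀ → 0 ≤ C → C ≤ x →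
      32 * π * |(a : ℝ)| * (M₁ + 2 * Y) *
        ((⌊x ^ (2 * ε₁) * (2 * (2 * Q₁)) * R₁ / M₁⌋₊ : ℕ) : ℝ) ^ 2 * (1 + Real.log ⌊4 * C⌋₊) / R₁ ≤
        Cr * |(a : ℝ)| * c₀ * x ^ (1 - τ) := by
  obtain ⟨Cℓ, hCℓ, hℓ⟩ := one_add_log_pow_le_of_le (δ := ε₁ / 2) (by positivity) 1
  refine ⟨1024 * π * 8 * (Cℓ + 1), by positivity, ?_⟩
  intro a x M₁ Y Q₁ R₁ C c₀ hx hM₁ hM₁s hY hYM hQ₁ hR₁ hQ2R hc₀ hC0 hCx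
  have hx0 : 0 < x := by linarith
  have hM0 : 0 < M₁ := by linarith
  have hR0 : 0 < R₁ := by linarith
  -- `H₀ ≤ 4 x^{2ε₁} Q₁ R₁ / M₁`
  set H : ℝ := x ^ (2 * ε₁) * (2 * (2 * Q₁)) * R₁ / M₁ with hH
  have hH0 : 0 ≤ H := by positivity
  have hH₀ : ((⌊H⌋₊ : ℕ) : ℝ) ≤ H := Nat.floor_le hH0
  -- the logarithm
  have hlog : 1 + Real.log ((⌊4 * C⌋₊ : ℕ) : ℝ) ≤ (Cℓ + 1) * x ^ (ε₁ / 2) := by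
    rcases Nat.eq_zero_or_pos ⌊4 * C⌋₊ with h0 | hpos
    · rw [h0]; simp
      have : (1 : ℝ) ≤ x ^ (ε₁ / 2) := Real.one_le_rpow hx (by positivity)
      nlinarith
    · have h1 : (1 : ℝ) ≤ ⌊4 * C⌋₊ := by exact_mod_cast hpos
      have h4 : ((⌊4 * C⌋₊ : ℕ) : ℝ) ≤ 4 * x := (Nat.floor_le (by positivity)).trans (by linarith)
      have := hℓ x _ hx h1 h4
      rw [pow_one] at this
      have h0 : 0 ≤ x ^ (ε₁ / 2) := by positivity
      nlinarith
  have hlog0 : 0 ≤ 1 + Real.log ((⌊4 * C⌋₊ : ℕ) : ℝ) := by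
    rcases Nat.eq_zero_or_pos ⌊4 * C⌋₊ with h0 | hpos
    · rw [h0]; simp
    · linarith [Real.log_nonneg (show (1 : ℝ) ≤ ⌊4 * C⌋₊ by exact_mod_cast hpos)]
  -- `x^{4ε₁}/M₁ ≤ 8 x^{4ε₁ - s}`
  have hxM : x ^ (4 * ε₁) * x / M₁ ≤ 8 * x ^ (1 + 4 * ε₁ - s) := by
    rw [div_le_iff₀ hM0, show (1 : ℝ) + 4 * ε₁ - s = (4 * ε₁ + 1) - s by ring, Real.rpow_sub hx0,
      Real.rpow_add hx0, Real.rpow_one]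
    rw [show 8 * (x ^ (4 * ε₁) * x / x ^ s) * M₁ = (x ^ (4 * ε₁) * x) * (8 * M₁) / x ^ s by ring,
      le_div_iff₀ (by positivity)]
    exact mul_le_mul_of_nonneg_left hM₁s (by positivity)
  calc 32 * π * |(a : ℝ)| * (M₁ + 2 * Y) * ((⌊H⌋₊ : ℕ) : ℝ) ^ 2 * (1 + Real.log ⌊4 * C⌋₊) / R₁
      ≤ 32 * π * |(a : ℝ)| * (2 * M₁) * H ^ 2 * ((Cℓ + 1) * x ^ (ε₁ / 2)) / R₁ := by
        gcongr
        · linarith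
    _ = 1024 * π * |(a : ℝ)| * (Cℓ + 1) * (x ^ (2 * ε₁) * x ^ (2 * ε₁)) * (Q₁ ^ 2 * R₁) / M₁ * x ^ (ε₁ / 2) := by
        rw [hH]; field_simp; ring
    _ ≤ 1024 * π * |(a : ℝ)| * (Cℓ + 1) * (x ^ (2 * ε₁) * x ^ (2 * ε₁)) * (c₀ * x) / M₁ * x ^ (ε₁ / 2) := by
        gcongr
    _ = 1024 * π * |(a : ℝ)| * (Cℓ + 1) * c₀ * (x ^ (4 * ε₁) * x / M₁) * x ^ (ε₁ / 2) := by
        rw [← Real.rpow_add hx0]; ring_nf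
    _ ≤ 1024 * π * |(a : ℝ)| * (Cℓ + 1) * c₀ * (8 * x ^ (1 + 4 * ε₁ - s)) * x ^ (ε₁ / 2) := by gcongr
    _ = 1024 * π * 8 * (Cℓ + 1) * |(a : ℝ)| * c₀ * (x ^ (1 + 4 * ε₁ - s) * x ^ (ε₁ / 2)) := by ring
    _ = 1024 * π * 8 * (Cℓ + 1) * |(a : ℝ)| * c₀ * x ^ (1 + 4 * ε₁ - s + ε₁ / 2) := by rw [← Real.rpow_add hx0]
    _ ≤ 1024 * π * 8 * (Cℓ + 1) * |(a : ℝ)| * c₀ * x ^ (1 - τ) := by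
        refine mul_le_mul_of_nonneg_left (Real.rpow_le_rpow_of_exponent_le hx ?_) (by positivity)
        linarith

set_option maxHeartbeats 400000 in
/-- **The main term of `piece_chain` is `≪_a K x^{1−ε₁/2}`** in the regime of §14 (the range
computation of p. 246 with the corrected `𝓘`, `main_sq_le`): with `T = 4x^{2ε₁}`,
`H = TQ₁R₁/M₁ ≤ 32x^{t'} L₁R₁`, `N₁ + Q₁R₁ ≤ 9x^{σ_T} Q₁R₁`, (14.5)–(14.6) at level `e_m` with slack
`8`, `Q₁²R₁ ≤ x`, and `3ε₁ + 14e_K + t' + σ_T ≤ e_m`.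
[cite: BombieriFriedlanderIwaniecActa1986, §14 p. 246] [cite: BombieriFriedlanderIwaniec2019, §2 Lemma 2.1] -/
theorem main_term_le {a : ℤ} (ha : a ≠ 0) {K eK x ε₁ t' σT em τ M₁ N₁ Q₁ L₁ R₁ Y C D : ℝ} {SL : Finset ℕ}
    (hK0 : 0 ≤ K) (heK : 0 ≤ eK) (hx : 1 ≤ x) (hε₁ : 0 ≤ ε₁) (hε₁' : 2 * ε₁ ≤ 1) (ht' : 2 * ε₁ ≤ t')
    (hσT : 0 ≤ σT) (hem0 : 0 ≤ em) (hexp : 2 * τ + 2 * ε₁ + 14 * eK + t' + σT ≤ em)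
    (hM₁ : 1 ≤ M₁) (hN₁ : 1 / 2 ≤ N₁) (hN₁x : N₁ ≤ x) (hQ₁ : 1 / 2 ≤ Q₁) (hQ₁x : Q₁ ≤ x)
    (hL₁ : 1 / 2 ≤ L₁) (hL₁x : L₁ ≤ x) (hR₁ : 1 / 2 ≤ R₁) (hR₁x : R₁ ≤ x) (hY0 : 0 < Y) (hY : Y ≤ M₁ / 2)
    (hC0 : 0 ≤ C) (hC : C ≤ 4 * N₁) (hD0 : 0 ≤ D) (hD : D ≤ 4 * Q₁) (hSL : (SL.card : ℝ) ≤ 4 * L₁)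
    (hHT : 4 * x ^ (2 * ε₁) * Q₁ * R₁ / M₁ ≤ 32 * x ^ t' * (L₁ * R₁))
    (hNU : N₁ + Q₁ * R₁ ≤ 9 * x ^ σT * (Q₁ * R₁)) (hxB : L₁ * M₁ * N₁ ≤ x)
    (h5 : L₁ * R₁ ≤ x ^ (1 / 2 - em)) (h6 : L₁ ^ (1 / 2 : ℝ) * R₁ ≤ 8 * M₁ * x ^ (-em)) (hQ2R : Q₁ ^ 2 * R₁ ≤ x) :
    2 * ((2 * M₁ + Y) / (Q₁ / 2) *
        ((K * (C * D * ((a.natAbs ^ 2 * ⌊x ^ (2 * ε₁) * (2 * (2 * Q₁)) * R₁ / M₁⌋₊ : ℕ) : ℝ) * R₁ *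
            ((a.natAbs : ℝ) * L₁)) ^ eK *
          lemma1Icorr C D ((a.natAbs ^ 2 * ⌊x ^ (2 * ε₁) * (2 * (2 * Q₁)) * R₁ / M₁⌋₊ : ℕ) : ℝ) R₁ ((a.natAbs : ℝ) * L₁)) *
          Real.sqrt (2 * SL.card * ⌊x ^ (2 * ε₁) * (2 * (2 * Q₁)) * R₁ / M₁⌋₊ / R₁))) ≤
      31200 * K * (64 * (a.natAbs : ℝ) ^ 3) ^ eK * (a.natAbs : ℝ) ^ 2 * x ^ (1 - τ) := by
  have hx0 : 0 < x := by linarith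
  have hM0 : 0 < M₁ := by linarith
  have hQ0 : 0 < Q₁ := by linarith
  have hR0 : 0 < R₁ := by linarith
  have hL0 : 0 < L₁ := by linarith
  set a' : ℝ := (a.natAbs : ℝ) with ha'
  have ha1 : 1 ≤ a' := by rw [ha']; exact_mod_cast Int.natAbs_pos.2 ha
  have ha0 : 0 ≤ a' := by linarith
  -- `T`, `H`, `H₀`, `N'`
  set T : ℝ := 4 * x ^ (2 * ε₁) with hT
  have hT1 : 1 ≤ T := by
    have : (1 : ℝ) ≤ x ^ (2 * ε₁) := Real.one_le_rpow hx (by positivity)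
    rw [hT]; linarith
  have hT0 : 0 < T := by linarith
  set H : ℝ := T * (Q₁ * R₁) / M₁ with hH
  have hH0 : 0 ≤ H := by positivity
  have hHeq : x ^ (2 * ε₁) * (2 * (2 * Q₁)) * R₁ / M₁ = H := by rw [hH, hT]; ring
  set H₀ : ℕ := ⌊x ^ (2 * ε₁) * (2 * (2 * Q₁)) * R₁ / M₁⌋₊ with hH₀
  have hH₀H : (H₀ : ℝ) ≤ H := by rw [hH₀, ← hHeq]; exact Nat.floor_le (by rw [hHeq]; exact hH0)
  set N' : ℝ := ((a.natAbs ^ 2 * H₀ : ℕ) : ℝ) with hN'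
  have hN'eq : N' = a' ^ 2 * H₀ := by rw [hN', ha']; push_cast; ring
  have hN'0 : 0 ≤ N' := by rw [hN']; exact Nat.cast_nonneg _
  have hN'le : N' ≤ a' ^ 2 * H := by rw [hN'eq]; exact mul_le_mul_of_nonneg_left hH₀H (by positivity)
  set II : ℝ := lemma1Icorr C D N' R₁ (a' * L₁) with hII
  have hII0 : 0 ≤ II := lemma1Icorr_nonneg _ _ _ _ _
  -- Step 1: the product `P ≤ 64 a'³ x⁷`
  set P : ℝ := C * D * N' * R₁ * (a' * L₁) with hP
  have hP0 : 0 ≤ P := by positivity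
  have hx2ε : x ^ (2 * ε₁) ≤ x := by
    calc x ^ (2 * ε₁) ≤ x ^ (1 : ℝ) := Real.rpow_le_rpow_of_exponent_le hx hε₁'
      _ = x := Real.rpow_one x
  have hHx : H ≤ 4 * x ^ 3 := by
    rw [hH, hT, div_le_iff₀ hM0]
    have h1 : x ^ (2 * ε₁) * (Q₁ * R₁) ≤ x * (x * x) := by gcongr
    calc 4 * x ^ (2 * ε₁) * (Q₁ * R₁) ≤ 4 * (x * (x * x)) := by linarith
      _ = 4 * x ^ 3 * 1 := by ring
      _ ≤ 4 * x ^ 3 * M₁ := by gcongr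
  have hPle : P ≤ 64 * a' ^ 3 * x ^ (7 : ℝ) := by
    have hx7 : x ^ (7 : ℝ) = x * x * (x ^ 3) * x * x := by
      rw [show (7 : ℝ) = (7 : ℕ) by norm_num, Real.rpow_natCast]; ring
    rw [hx7, hP]
    have h1 : C ≤ 4 * x := hC.trans (by linarith)
    have h2 : D ≤ 4 * x := hD.trans (by linarith)
    have h3 : N' ≤ a' ^ 2 * (4 * x ^ 3) := hN'le.trans (mul_le_mul_of_nonneg_left hHx (by positivity))
    have h4 : a' * L₁ ≤ a' * x := mul_le_mul_of_nonneg_left hL₁x ha0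
    calc C * D * N' * R₁ * (a' * L₁) ≤ (4 * x) * (4 * x) * (a' ^ 2 * (4 * x ^ 3)) * x * (a' * x) := by
          gcongr
      _ = 64 * a' ^ 3 * (x * x * x ^ 3 * x * x) := by ring
  have hPpow : P ^ eK ≤ (64 * a' ^ 3) ^ eK * x ^ (7 * eK) := by
    calc P ^ eK ≤ (64 * a' ^ 3 * x ^ (7 : ℝ)) ^ eK := Real.rpow_le_rpow hP0 hPle heK
      _ = (64 * a' ^ 3) ^ eK * x ^ (7 * eK) := by
          rw [Real.mul_rpow (by positivity) (by positivity), ← Real.rpow_mul hx0.le]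
  -- Step 2: `main_sq_le`
  have hT'1 : (1 : ℝ) ≤ 32 * x ^ t' := by
    have : (1 : ℝ) ≤ x ^ t' := Real.one_le_rpow hx (by linarith)
    linarith
  have hU1 : (1 : ℝ) ≤ 9 * x ^ σT := by
    have : (1 : ℝ) ≤ x ^ σT := Real.one_le_rpow hx hσT
    linarith
  have hHT' : H ≤ 32 * x ^ t' * (L₁ * R₁) := by
    have : H = T * Q₁ * R₁ / M₁ := by rw [hH]; ring
    rw [this]; exact hHT
  have hHM : H * M₁ ≤ T * (Q₁ * R₁) := le_of_eq (by rw [hH]; field_simp)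
  have hQ2R' : Q₁ ^ 2 * R₁ ≤ 1 * x := by rw [one_mul]; exact hQ2R
  have hN0 : (0 : ℝ) ≤ N₁ := by linarith
  have hV : (1 : ℝ) ≤ 8 := by norm_num
  have hmain := main_sq_le ha1 hL₁ hM0 hN0 hQ0 hR0.le hT1 hT'1 hU1 hV (le_refl (1 : ℝ)) hx hem0 hC0 hD0 hN'0 hC hD
    (rfl : a' * L₁ = a' * L₁) hN'le hHT' hNU hHM hxB h5 h6 hQ2R'
  -- Step 3: the size of the bound of `main_sq_le`
  have hpow : x ^ (4 * ε₁) ≤ x ^ (2 * ε₁ + t' + σT) := Real.rpow_le_rpow_of_exponent_le hx (by linarith)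
  have hB : ((32 + 128 * 8) * a' ^ 3 * T * (32 * x ^ t') * (9 * x ^ σT) + 16 * a' ^ 2 * T ^ 2 * 1) ≤
      1216768 * a' ^ 3 * x ^ (2 * ε₁ + t' + σT) := by
    have e1 : T * (32 * x ^ t') * (9 * x ^ σT) = 1152 * x ^ (2 * ε₁ + t' + σT) := by
      rw [hT, Real.rpow_add hx0, Real.rpow_add hx0]; ring
    have e2 : T ^ 2 = 16 * x ^ (4 * ε₁) := by
      rw [hT, mul_pow, sq (x ^ (2 * ε₁)), ← Real.rpow_add hx0]; ring_nf
    have ha23 : a' ^ 2 ≤ a' ^ 3 := by nlinarith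
    calc (32 + 128 * 8) * a' ^ 3 * T * (32 * x ^ t') * (9 * x ^ σT) + 16 * a' ^ 2 * T ^ 2 * 1
        = 1056 * a' ^ 3 * (T * (32 * x ^ t') * (9 * x ^ σT)) + 256 * a' ^ 2 * x ^ (4 * ε₁) := by rw [e2]; ring
      _ ≤ 1056 * a' ^ 3 * (1152 * x ^ (2 * ε₁ + t' + σT)) + 256 * a' ^ 3 * x ^ (2 * ε₁ + t' + σT) := by
          rw [e1]; gcongr
      _ = 1216768 * a' ^ 3 * x ^ (2 * ε₁ + t' + σT) := by ring
  have hkey : T * (M₁ * L₁ / Q₁) * II ^ 2 ≤ 1216768 * a' ^ 3 * x ^ (2 * ε₁ + t' + σT) * x ^ (2 - em) := by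
    refine hmain.trans ?_
    exact mul_le_mul_of_nonneg_right hB (by positivity)
  -- Step 4: the main term
  set Z : ℝ := M₁ / Q₁ * II * Real.sqrt (8 * L₁ * H / R₁) with hZ
  have hZ0 : 0 ≤ Z := by positivity
  have hZsq : Z ^ 2 = 8 * (T * (M₁ * L₁ / Q₁) * II ^ 2) := by
    rw [hZ, mul_pow, mul_pow, Real.sq_sqrt (by positivity), hH]
    field_simp
  set W : ℝ := 8 * (1216768 * a' ^ 3) * x ^ (2 * ε₁ + t' + σT + (2 - em)) with hW
  have hZW' : Z ^ 2 ≤ W := by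
    rw [hZsq, hW, Real.rpow_add hx0]
    have h8 := mul_le_mul_of_nonneg_left hkey (by norm_num : (0 : ℝ) ≤ 8)
    linarith [h8]
  have hZW : Z ≤ Real.sqrt W :=
    calc Z = Real.sqrt (Z ^ 2) := (Real.sqrt_sq hZ0).symm
      _ ≤ Real.sqrt W := Real.sqrt_le_sqrt hZW'
  have hsx : Real.sqrt (x ^ (2 * ε₁ + t' + σT + (2 - em))) = x ^ ((2 * ε₁ + t' + σT + (2 - em)) / 2) := by
    rw [Real.sqrt_eq_rpow, ← Real.rpow_mul hx0.le]
    ring_nf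
  have hsqrtW : Real.sqrt W ≤ 3120 * a' ^ 2 * x ^ ((2 * ε₁ + t' + σT + (2 - em)) / 2) := by
    rw [hW, Real.sqrt_mul (by positivity), hsx]
    refine mul_le_mul_of_nonneg_right ?_ (by positivity)
    rw [Real.sqrt_le_left (by positivity)]
    have h34 : a' ^ 3 ≤ a' ^ 4 := pow_le_pow_right₀ ha1 (by norm_num)
    have h40 : 0 ≤ a' ^ 4 := pow_nonneg ha0 4
    calc 8 * (1216768 * a' ^ 3) = 9734144 * a' ^ 3 := by ring
      _ ≤ 9734144 * a' ^ 4 := by linarith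
      _ ≤ 9734400 * a' ^ 4 := by linarith
      _ = (3120 * a' ^ 2) ^ 2 := by ring
  -- the pieces of the main term
  have hξ : (2 * M₁ + Y) / (Q₁ / 2) ≤ 5 * (M₁ / Q₁) := by
    rw [div_le_iff₀ (by positivity)]
    have : 5 * (M₁ / Q₁) * (Q₁ / 2) = 5 / 2 * M₁ := by field_simp
    rw [this]; linarith
  have hsq : Real.sqrt (2 * SL.card * H₀ / R₁) ≤ Real.sqrt (8 * L₁ * H / R₁) := by
    refine Real.sqrt_le_sqrt (div_le_div_of_nonneg_right ?_ hR0.le)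
    calc 2 * (SL.card : ℝ) * H₀ ≤ 2 * (4 * L₁) * H := by gcongr
      _ = 8 * L₁ * H := by ring
  have hKP : K * P ^ eK ≤ K * ((64 * a' ^ 3) ^ eK * x ^ (7 * eK)) := mul_le_mul_of_nonneg_left hPpow hK0
  -- assemble
  have hexp2 : 7 * eK + (2 * ε₁ + t' + σT + (2 - em)) / 2 ≤ 1 - τ := by linarith
  have hPe0 : 0 ≤ P ^ eK := Real.rpow_nonneg hP0 eK
  have hc64 : 0 ≤ (64 * a' ^ 3) ^ eK * x ^ (7 * eK) :=
    mul_nonneg (Real.rpow_nonneg (by positivity) eK) (Real.rpow_nonneg hx0.le _)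
  have hin1 : K * P ^ eK * II ≤ K * ((64 * a' ^ 3) ^ eK * x ^ (7 * eK)) * II :=
    mul_le_mul_of_nonneg_right hKP hII0
  have hin2 : (K * P ^ eK * II) * Real.sqrt (2 * SL.card * H₀ / R₁) ≤
      (K * ((64 * a' ^ 3) ^ eK * x ^ (7 * eK)) * II) * Real.sqrt (8 * L₁ * H / R₁) :=
    mul_le_mul hin1 hsq (Real.sqrt_nonneg _) (mul_nonneg (mul_nonneg hK0 hc64) hII0)
  have hin0 : 0 ≤ (K * P ^ eK * II) * Real.sqrt (2 * SL.card * H₀ / R₁) :=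
    mul_nonneg (mul_nonneg (mul_nonneg hK0 hPe0) hII0) (Real.sqrt_nonneg _)
  have h5MQ : 0 ≤ 5 * (M₁ / Q₁) := by positivity
  have hin3 : (2 * M₁ + Y) / (Q₁ / 2) * ((K * P ^ eK * II) * Real.sqrt (2 * SL.card * H₀ / R₁)) ≤
      (5 * (M₁ / Q₁)) * ((K * ((64 * a' ^ 3) ^ eK * x ^ (7 * eK)) * II) * Real.sqrt (8 * L₁ * H / R₁)) :=
    mul_le_mul hξ hin2 hin0 h5MQ
  calc 2 * ((2 * M₁ + Y) / (Q₁ / 2) * ((K * P ^ eK * II) * Real.sqrt (2 * SL.card * H₀ / R₁)))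
      ≤ 2 * ((5 * (M₁ / Q₁)) * ((K * ((64 * a' ^ 3) ^ eK * x ^ (7 * eK)) * II) * Real.sqrt (8 * L₁ * H / R₁))) :=
        mul_le_mul_of_nonneg_left hin3 (by norm_num)
    _ = 10 * (K * (64 * a' ^ 3) ^ eK) * x ^ (7 * eK) * Z := by rw [hZ]; ring
    _ ≤ 10 * (K * (64 * a' ^ 3) ^ eK) * x ^ (7 * eK) * (3120 * a' ^ 2 * x ^ ((2 * ε₁ + t' + σT + (2 - em)) / 2)) := by
        gcongr
        exact hZW.trans hsqrtW
    _ = 31200 * K * (64 * a' ^ 3) ^ eK * a' ^ 2 * (x ^ (7 * eK) * x ^ ((2 * ε₁ + t' + σT + (2 - em)) / 2)) := by ring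
    _ = 31200 * K * (64 * a' ^ 3) ^ eK * a' ^ 2 * x ^ (7 * eK + (2 * ε₁ + t' + σT + (2 - em)) / 2) := by
        rw [← Real.rpow_add hx0]
    _ ≤ 31200 * K * (64 * a' ^ 3) ^ eK * a' ^ 2 * x ^ (1 - τ) := by
        refine mul_le_mul_of_nonneg_left (Real.rpow_le_rpow_of_exponent_le hx hexp2) (by positivity)

/-! ### Stage P: one piece with smooth weights is `≪ x^{1−τ}` -/

/-- **Stage P.** For fixed data of the uniform Lemma 1 and fixed exponents, there is a constant
`C_P` such that every piece (smoothed weights in `m`, and in `n`, `q` either the block bumps or the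
fixed bump of the blocks `{1}`; outer variables over sets `SL ⊆ (l ∼ L₁)`, `SR ⊆ (r ∼ R₁)`) in the
regime of §14 satisfies `Δ ≤ C_P x^{1−τ}`. [cite: BombieriFriedlanderIwaniecActa1986, §14 pp. 244–246] -/
theorem piece_bound {κ ε₂ ε₀ K : ℝ} (hK0 : 0 ≤ K) (hK : UniformBoundAt κ ε₂ ε₀ K) (hκ : 0 ≤ κ)
    (hε₂ : 0 ≤ ε₂) (hε₀0 : 0 ≤ ε₀) {a : ℤ} (ha : a ≠ 0) {ε₁ s t' σT em τ : ℝ} (hε₁ : 0 < ε₁)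
    (hε₁' : 2 * ε₁ ≤ 1) (ht' : 2 * ε₁ ≤ t') (hσT : 0 ≤ σT) (hem0 : 0 ≤ em) (hsP : τ + 2 * ε₁ ≤ s)
    (hsR : τ + 9 * ε₁ / 2 ≤ s) (hexp : 2 * τ + 2 * ε₁ + 14 * (ε₂ + κ * ε₀) + t' + σT ≤ em)
    {j : ℕ} (hj : 2 ≤ j) (hjε : 2 + 2 * ε₁ ≤ j * ε₁) :
    ∃ Cpc : ℝ, 0 < Cpc ∧ ∀ (x M₁ N₁ Q₁ L₁ R₁ Y C YN D YQ lam : ℝ) (SL SR : Finset ℕ),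
      1 ≤ x → 2 ≤ x ^ ε₁ → 1 ≤ M₁ → M₁ ≤ x → x ^ s ≤ 8 * M₁ → 1 / 2 ≤ N₁ → N₁ ≤ x →
      1 / 2 ≤ Q₁ → Q₁ ≤ x → 1 / 2 ≤ L₁ → L₁ ≤ x → 1 / 2 ≤ R₁ → R₁ ≤ x → 4 * Q₁ * R₁ < x →
      Y = M₁ * x ^ (-ε₁) → SL ⊆ dyadic L₁ → SR ⊆ dyadic R₁ →
      1 ≤ C → C ≤ x → (2 * N₁ = C ∨ (N₁ = 1 / 2 ∧ YN = 1 / 4 ∧ C = 1)) → 0 < YN → YN ≤ N₁ / 2 →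
      2 * N₁ / YN ≤ 4 * C ^ ε₀ →
      1 ≤ D → D ≤ 2 * Q₁ → ((⌊4 * D⌋₊ : ℕ) : ℝ) ≤ 8 * Q₁ → 0 < YQ → YQ ≤ Q₁ / 2 → 0 ≤ lam →
      2 * Q₁ / YQ ≤ 12 * D ^ ε₀ → lam * (12 * x ^ ε₁) ≤ 12 * D ^ ε₀ →
      (∀ (d : ℕ) (ξ : ℝ), bump Q₁ YQ d * bump M₁ Y (d * ξ) =
        bump Q₁ YQ (2 * Q₁ * (d / D)) * bump M₁ Y (lam * (D * ξ) * (d / D) + (1 - lam) * ξ)) →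
      ((⌊4 * C⌋₊ : ℕ) : ℝ) * SL.card ≤ 45 * x / M₁ →
      4 * x ^ (2 * ε₁) * Q₁ * R₁ / M₁ ≤ 32 * x ^ t' * (L₁ * R₁) →
      N₁ + Q₁ * R₁ ≤ 9 * x ^ σT * (Q₁ * R₁) → L₁ * M₁ * N₁ ≤ x → L₁ * R₁ ≤ x ^ (1 / 2 - em) →
      L₁ ^ (1 / 2 : ℝ) * R₁ ≤ 8 * M₁ * x ^ (-em) → Q₁ ^ 2 * R₁ ≤ x →
      tripleTS a ⌊2 * M₁ + Y⌋₊ ⌊4 * C⌋₊ ⌊4 * D⌋₊ (bumpW M₁ Y) (bumpW N₁ YN) (bumpW Q₁ YQ) SL SR ≤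
        Cpc * x ^ (1 - τ) := by
  obtain ⟨Cp, hCp, hP⟩ := poisson_term_le hε₁ hsP j
  obtain ⟨Cr, hCr, hR⟩ := recip_term_le hε₁ hsR
  set a' : ℝ := (a.natAbs : ℝ) with ha'
  have ha1 : 1 ≤ a' := by rw [ha']; exact_mod_cast Int.natAbs_pos.2 ha
  set eK : ℝ := ε₂ + κ * ε₀ with heK
  have heK0 : 0 ≤ eK := by positivity
  set Cm : ℝ := 31200 * K * (64 * a' ^ 3) ^ eK * a' ^ 2 with hCm
  have hCm0 : 0 ≤ Cm := by positivity
  refine ⟨Cp + Cr * |(a : ℝ)| + Cm + 1, by positivity, ?_⟩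
  intro x M₁ N₁ Q₁ L₁ R₁ Y C YN D YQ lam SL SR hx hx2 hM₁ hM₁x hM₁s hN₁ hN₁x hQ₁ hQ₁x hL₁ hL₁x hR₁ hR₁x hQR
    hYdef hSL hSR hC1 hCx hCN hYN0 hYN hfeasN hD1 hD2 hDq hYQ0 hYQ hlam0 hfeasQ hfeasQ' hrep hCSL hHT hNU hxB
    h5 h6 hQ2R
  have hx0 : 0 < x := by linarith
  have hxτ : 0 ≤ x ^ (1 - τ) := by positivity
  -- `Y`
  have hY0 : 0 < Y := by rw [hYdef]; positivity
  have hYM : Y ≤ M₁ / 2 := by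
    rw [hYdef, Real.rpow_neg hx0.le]
    have h2 : (x ^ ε₁)⁻¹ ≤ 1 / 2 := by
      rw [inv_eq_one_div]; exact one_div_le_one_div_of_le (by norm_num) hx2
    have hM0 : 0 ≤ M₁ := by linarith only [hM₁]
    calc M₁ * (x ^ ε₁)⁻¹ ≤ M₁ * (1 / 2) := mul_le_mul_of_nonneg_left h2 hM0
      _ = M₁ / 2 := by ring
  -- small facts
  have hD4 : 1 / 4 ≤ D := le_trans (by norm_num) hD1
  have hQ0 : 0 ≤ Q₁ := by linarith only [hQ₁]
  have hDx : D ≤ x :=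
    calc D ≤ 2 * Q₁ := hD2
      _ = 4 * Q₁ * (1 / 2) := by ring
      _ ≤ 4 * Q₁ * R₁ := by gcongr
      _ ≤ x := hQR.le
  have hC0 : 0 ≤ C := by linarith only [hC1]
  have hC4 : C ≤ 4 * N₁ := by
    rcases hCN with h | ⟨h1, -, h3⟩
    · linarith only [h, hN₁]
    · rw [h3, h1]; norm_num
  have hD0 : 0 ≤ D := by linarith only [hD1]
  have hD4Q : D ≤ 4 * Q₁ := by linarith only [hD2, hQ₁]
  have hSLcard : (SL.card : ℝ) ≤ 4 * L₁ := by
    have h := Finset.card_le_card hSL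
    have h' := card_dyadic_le_two_mul (by linarith only [hL₁] : (0 : ℝ) ≤ L₁)
    calc (SL.card : ℝ) ≤ (dyadic L₁).card := by exact_mod_cast h
      _ ≤ 2 * L₁ + 1 := by linarith only [h']
      _ ≤ 4 * L₁ := by linarith only [hL₁]
  have hQ2R' : Q₁ ^ 2 * R₁ ≤ 1 * x := by rw [one_mul]; exact hQ2R
  -- the three terms
  have h1 := hP x M₁ C D R₁ SL hx hM₁ hM₁s hD4 hDx hR₁ hR₁x hCSL
  have h2 := hR a x M₁ Y Q₁ R₁ C 1 hx hM₁ hM₁s hY0 hYM hQ₁ hR₁ hQ2R' le_rfl hC0 hCx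
  have h3 := main_term_le (SL := SL) ha hK0 heK0 hx hε₁.le hε₁' ht' hσT hem0 hexp hM₁ hN₁ hN₁x hQ₁ hQ₁x hL₁ hL₁x
    hR₁ hR₁x hY0 hYM hC0 hC4 hD0 hD4Q hSLcard hHT hNU hxB h5 h6 hQ2R
  rw [mul_one] at h2
  rw [← ha', ← hCm] at h3
  have htot : Cp * x ^ (1 - τ) + Cr * |(a : ℝ)| * x ^ (1 - τ) + Cm * x ^ (1 - τ) ≤
      (Cp + Cr * |(a : ℝ)| + Cm + 1) * x ^ (1 - τ) := by linarith only [hxτ]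
  -- the chain
  have hchain := piece_chain hK0 hK ha hx hε₁ hx2 hj hjε hM₁ hM₁x hL₁ hR₁ hQ₁ hQR hYdef hSL hSR hC1 hCN hYN0
    hYN hfeasN hD1 hD2 hDq hYQ0 hYQ hlam0 hfeasQ hfeasQ' hrep
  linarith only [hchain, h1, h2, h3, htot]

/-! ### Helpers for the stages -/

/-- `Δ` does not see `Xq` beyond the support of `γ`. [folklore] -/
theorem tripleTS_congr_Xq (a : ℤ) (Xm Xn : ℕ) {Xq X₀ : ℕ} (α β : ℕ → ℝ) {γ : ℕ → ℝ}
    (hγ : ∀ q : ℕ, X₀ < q → γ q = 0) (hX : X₀ ≤ Xq) (SL SR : Finset ℕ) :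
    tripleTS a Xm Xn Xq α β γ SL SR = tripleTS a Xm Xn X₀ α β γ SL SR := by
  unfold tripleTS qSumT
  refine Finset.sum_congr rfl fun r _ => Finset.sum_congr rfl fun l _ => ?_
  congr 1
  symm
  refine Finset.sum_subset (Finset.filter_subset_filter _ (Finset.Icc_subset_Icc_right hX)) ?_
  intro q hq hq'
  have hq1 := Finset.mem_filter.1 hq
  have hgt : X₀ < q := by
    by_contra hle
    push Not at hle
    exact hq' (Finset.mem_filter.2 ⟨Finset.mem_Icc.2 ⟨(Finset.mem_Icc.1 hq1.1).1, hle⟩, hq1.2⟩)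
  rw [hγ q hgt, zero_mul]

/-- `Δ` does not see `Xn` beyond the support of `β`. [folklore] -/
theorem tripleTS_congr_Xn (a : ℤ) (Xm : ℕ) {Xn X₀ : ℕ} (Xq : ℕ) (α : ℕ → ℝ) {β : ℕ → ℝ} (γ : ℕ → ℝ)
    (hβ : ∀ n : ℕ, X₀ < n → β n = 0) (hX : X₀ ≤ Xn) (SL SR : Finset ℕ) :
    tripleTS a Xm Xn Xq α β γ SL SR = tripleTS a Xm X₀ Xq α β γ SL SR := by
  unfold tripleTS qSumT bracketT congrW coprW
  refine Finset.sum_congr rfl fun r _ => Finset.sum_congr rfl fun l _ => ?_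
  congr 1
  refine Finset.sum_congr rfl fun q _ => ?_
  congr 2
  · refine Finset.sum_congr rfl fun m _ => ?_
    symm
    refine Finset.sum_subset (Finset.Icc_subset_Icc_right hX) fun n hn hn' => ?_
    have hgt : X₀ < n := by
      by_contra hle; push Not at hle
      exact hn' (Finset.mem_Icc.2 ⟨(Finset.mem_Icc.1 hn).1, hle⟩)
    rw [hβ n hgt]; simp
  · congr 1
    refine Finset.sum_congr rfl fun m _ => ?_
    symm
    refine Finset.sum_subset (Finset.Icc_subset_Icc_right hX) fun n hn hn' => ?_
    have hgt : X₀ < n := by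
      by_contra hle; push Not at hle
      exact hn' (Finset.mem_Icc.2 ⟨(Finset.mem_Icc.1 hn).1, hle⟩)
    rw [hβ n hgt]; simp

/-- `dyadic Q₁ = {1}` for `1/2 ≤ Q₁ < 1`. [folklore] -/
theorem dyadic_eq_singleton_one {Q₁ : ℝ} (h1 : 1 / 2 ≤ Q₁) (h2 : Q₁ < 1) : dyadic Q₁ = {1} := by
  ext q
  rw [mem_dyadic (by linarith), Finset.mem_singleton]
  constructor
  · intro ⟨ha, hb⟩
    have hq2 : (q : ℝ) < 2 := by linarith
    have hq0 : (0 : ℝ) < q := by linarith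
    have : q < 2 := by exact_mod_cast hq2
    have : 0 < q := by exact_mod_cast hq0
    omega
  · intro hq
    subst hq
    push_cast
    exact ⟨by linarith, by linarith⟩

/-- The fixed weight of the blocks `{1}`: `bump_{1/2,1/4} = 1_{{1}}` on the naturals. [folklore] -/
theorem bumpW_half : bumpW (1 / 2) (1 / 4) = ind ({1} : Finset ℕ) := by
  funext m
  have h : (bumpW (1 / 2) (1 / 4) - ind (dyadic (1 / 2))) m = 0 := by
    by_contra hne
    have := mem_bumpDiffSupport_of_ne (by norm_num) (by norm_num) hne
    rw [bumpDiffSupport_half] at this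
    simp at this
  rw [Pi.sub_apply, sub_eq_zero] at h
  rw [h, dyadic_eq_singleton_one (by norm_num) (by norm_num)]

/-- `ind S` vanishes beyond `max S`: for `S ⊆ [1, X₀]`, `ind S q = 0` when `X₀ < q`. [folklore] -/
theorem ind_eq_zero_of_lt {S : Finset ℕ} {X₀ : ℕ} (hS : S ⊆ Icc 1 X₀) {q : ℕ} (hq : X₀ < q) : ind S q = 0 := by
  refine ind_of_not_mem fun h => ?_
  have := (Finset.mem_Icc.1 (hS h)).2
  omega

/-- The moduli `q · (r ∼ R)` lie in `(qR, 2qR]`. [folklore] -/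
theorem image_mul_dyadic_subset {R : ℝ} (hR : 0 ≤ R) {q : ℕ} (hq : 0 < q) :
    (dyadic R).image (fun r => q * r) ⊆ dyadic ((q : ℝ) * R) := by
  intro k hk
  rw [Finset.mem_image] at hk
  obtain ⟨r, hr, rfl⟩ := hk
  have hr' := (mem_dyadic hR).1 hr
  have hq0 : (0 : ℝ) < q := by exact_mod_cast hq
  rw [mem_dyadic (by positivity)]
  push_cast
  constructor
  · exact mul_lt_mul_of_pos_left hr'.1 hq0
  · calc (q : ℝ) * r ≤ q * (2 * R) := mul_le_mul_of_nonneg_left hr'.2 hq0.le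
      _ = 2 * (q * R) := by ring

/-- The sets `(l ∼ L) · n` lie in `(nL, 2nL]`. [folklore] -/
theorem image_mul_right_dyadic_subset {L : ℝ} (hL : 0 ≤ L) {n : ℕ} (hn : 0 < n) :
    (dyadic L).image (fun l => l * n) ⊆ dyadic ((n : ℝ) * L) := by
  intro k hk
  rw [Finset.mem_image] at hk
  obtain ⟨l, hl, rfl⟩ := hk
  have hl' := (mem_dyadic hL).1 hl
  have hn0 : (0 : ℝ) < n := by exact_mod_cast hn
  rw [mem_dyadic (by positivity)]
  push_cast
  constructor
  · calc (n : ℝ) * L < n * l := mul_lt_mul_of_pos_left hl'.1 hn0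
      _ = l * n := mul_comm _ _
  · calc (l : ℝ) * n ≤ (2 * L) * n := mul_le_mul_of_nonneg_right hl'.2 hn0.le
      _ = 2 * (n * L) := by ring

/-- The representation `hrep` of `piece_chain` for the general block (`D = 2Q₁`, `λ = 1`). [folklore] -/
theorem hrep_general {Q₁ YQ M Y : ℝ} (hQ : 0 < Q₁) (d : ℕ) (ξ : ℝ) :
    bump Q₁ YQ d * bump M Y (d * ξ) =
      bump Q₁ YQ (2 * Q₁ * (d / (2 * Q₁))) * bump M Y (1 * ((2 * Q₁) * ξ) * (d / (2 * Q₁)) + (1 - 1) * ξ) := by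
  have h1 : 2 * Q₁ * ((d : ℝ) / (2 * Q₁)) = d := by field_simp
  have h2 : 1 * ((2 * Q₁) * ξ) * ((d : ℝ) / (2 * Q₁)) + (1 - 1) * ξ = d * ξ := by field_simp; ring
  rw [h1, h2]

/-- The representation `hrep` of `piece_chain` for the block `q = 1` (`D = 1`, `λ = 0`). [folklore] -/
theorem hrep_special {M Y : ℝ} (d : ℕ) (ξ : ℝ) :
    bump (1 / 2) (1 / 4) d * bump M Y (d * ξ) =
      bump (1 / 2) (1 / 4) (2 * (1 / 2) * (d / 1)) * bump M Y (0 * (1 * ξ) * (d / 1) + (1 - 0) * ξ) := by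
  have h1 : 2 * (1 / 2) * ((d : ℝ) / 1) = d := by ring
  have h2 : 0 * (1 * ξ) * ((d : ℝ) / 1) + (1 - 0) * ξ = ξ := by ring
  rw [h1, h2]
  by_cases hd : d = 1
  · subst hd; simp
  · have h0 : bump (1 / 2) (1 / 4) (d : ℝ) = 0 := by
      have := congrFun bumpW_half d
      rw [bumpW, ind_of_not_mem (by simpa using hd)] at this
      exact this
    rw [h0, zero_mul, zero_mul]

/-! ### Stage Q: the range of `q` (long: smooth; `{1}`: fixed weight; short: merge into `r`) -/

set_option maxHeartbeats 1000000 in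
/-- **Stage Q.** For a block already smoothed in `m` (and in `n`: `β` the block bump or the fixed
bump of `{1}`), with `q ∼ Q₁` sharp and `r ∼ R₁`: if `q` is long (`x^η ≤ 2Q₁`) smooth `q`
(thin-weight error) and apply Stage P; if the block of `q` is `{1}` apply Stage P with the fixed
weight; if `q` is short merge `q` into the modulus (`tripleTS_qmerge_le`, at most `2x^η` sparse
pieces) and apply Stage P to each piece. [cite: BombieriFriedlanderIwaniecActa1986, §14 pp. 244–246] -/
theorem stageQ_bound {κ ε₂ ε₀ K : ℝ} (hK0 : 0 ≤ K) (hK : UniformBoundAt κ ε₂ ε₀ K) (hκ : 0 ≤ κ)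
    (hε₂ : 0 ≤ ε₂) (hε₀0 : 0 ≤ ε₀) {a : ℤ} (ha : a ≠ 0) {ε₁ s t' σT em τ η : ℝ} (hε₁ : 0 < ε₁)
    (hε₁' : 2 * ε₁ ≤ 1) (ht' : 2 * ε₁ ≤ t') (hσT : 0 ≤ σT) (hem0 : 0 ≤ em) (hsP : τ + 2 * ε₁ ≤ s)
    (hsR : τ + 9 * ε₁ / 2 ≤ s) (hexp : 2 * τ + 2 * ε₁ + 14 * (ε₂ + κ * ε₀) + t' + σT ≤ em)
    (hε₁η : ε₁ ≤ η * ε₀) (hη0 : 0 ≤ η)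
    {j : ℕ} (hj : 2 ≤ j) (hjε : 2 + 2 * ε₁ ≤ j * ε₁) :
    ∃ CQ : ℝ, 0 < CQ ∧ ∀ (x M₁ N₁ Q₁ L₁ R₁ Y C YN : ℝ) (SL : Finset ℕ),
      1 ≤ x → 2 ≤ x ^ ε₁ → 4 ≤ x ^ (η - ε₁) → |(a : ℝ)| ≤ x →
      1 ≤ M₁ → M₁ ≤ x → x ^ s ≤ 8 * M₁ → 1 / 2 ≤ N₁ → N₁ ≤ x →
      1 / 2 ≤ Q₁ → 1 / 2 ≤ L₁ → L₁ ≤ x → 1 / 2 ≤ R₁ → R₁ ≤ x → 4 * Q₁ * R₁ < x →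
      Y = M₁ * x ^ (-ε₁) → SL ⊆ dyadic L₁ →
      1 ≤ C → C ≤ x → (2 * N₁ = C ∨ (N₁ = 1 / 2 ∧ YN = 1 / 4 ∧ C = 1)) → 0 < YN → YN ≤ N₁ / 2 →
      2 * N₁ / YN ≤ 4 * C ^ ε₀ →
      ((⌊4 * C⌋₊ : ℕ) : ℝ) * SL.card ≤ 45 * x / M₁ →
      4 * x ^ (2 * ε₁) * Q₁ * R₁ / M₁ ≤ 32 * x ^ t' * (L₁ * R₁) →
      N₁ ≤ 4 * x ^ σT * (Q₁ * R₁) → L₁ * M₁ * N₁ ≤ x → L₁ * R₁ * x ^ η ≤ x ^ (1 / 2 - em) →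
      L₁ ^ (1 / 2 : ℝ) * R₁ * x ^ η ≤ 8 * M₁ * x ^ (-em) → Q₁ ^ 2 * R₁ ≤ x →
      tripleTS a ⌊2 * M₁ + Y⌋₊ ⌊4 * C⌋₊ ⌊2 * Q₁⌋₊ (bumpW M₁ Y) (bumpW N₁ YN) (ind (dyadic Q₁)) SL (dyadic R₁) ≤
        CQ * (x ^ (ε₁ / 8 - ε₁) * (((⌊2 * M₁ + Y⌋₊ : ℕ) : ℝ) * ⌊4 * C⌋₊ * SL.card + SL.card * (Q₁ * R₁)) +
          x ^ η * x ^ (1 - τ)) := by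
  obtain ⟨Cpc, hCpc, hP⟩ := piece_bound hK0 hK hκ hε₂ hε₀0 ha hε₁ hε₁' ht' hσT hem0 hsP hsR hexp hj hjε
  obtain ⟨C₃, hC₃, h₃⟩ := tripleTS_le_of_thin_gamma (δ := ε₁ / 8) (by positivity)
  refine ⟨2 * Cpc + 12 * C₃ * 4 ^ (ε₁ / 8), by positivity, ?_⟩
  intro x M₁ N₁ Q₁ L₁ R₁ Y C YN SL hx hx2 hx4 hax hM₁ hM₁x hM₁s hN₁ hN₁x hQ₁ hL₁ hL₁x hR₁ hR₁x hQR hYdef hSL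
    hC1 hCx hCN hYN0 hYN hfeasN hCSL hHT hNU hxB h5 h6 hQ2R
  have hx0 : 0 < x := by linarith
  have hQ0 : 0 < Q₁ := by linarith
  have hR0 : 0 < R₁ := by linarith
  have hL0 : 0 ≤ L₁ := by linarith
  have hM0 : 0 < M₁ := by linarith
  have h2Q₁x : 2 * Q₁ < x :=
    calc 2 * Q₁ = 4 * Q₁ * (1 / 2) := by ring
      _ ≤ 4 * Q₁ * R₁ := by gcongr
      _ < x := hQR
  have hQ₁x : Q₁ ≤ x := by linarith only [h2Q₁x, hQ₁]
  have hxη1 : 1 ≤ x ^ η := Real.one_le_rpow hx hη0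
  have hxσ1 : 1 ≤ x ^ σT := Real.one_le_rpow hx hσT
  have hxτ0 : 0 ≤ x ^ (1 - τ) := by positivity
  -- notation
  set Xm : ℕ := ⌊2 * M₁ + Y⌋₊ with hXm
  set Xn : ℕ := ⌊4 * C⌋₊ with hXn
  set mass : ℝ := (Xm : ℝ) * Xn * SL.card with hmass
  have hmass0 : 0 ≤ mass := by rw [hmass]; positivity
  set Epart : ℝ := x ^ (ε₁ / 8 - ε₁) * (mass + SL.card * (Q₁ * R₁)) with hEpart
  have hE0 : 0 ≤ Epart :=
    mul_nonneg (Real.rpow_nonneg hx0.le _) (add_nonneg hmass0 (mul_nonneg (Nat.cast_nonneg _) (by positivity)))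
  set Ppart : ℝ := x ^ η * x ^ (1 - τ) with hPpart
  have hP1 : x ^ (1 - τ) ≤ Ppart := le_mul_of_one_le_left hxτ0 hxη1
  have hP0 : 0 ≤ Ppart := mul_nonneg (by positivity) hxτ0
  -- the (14.x) inequalities at level `em` for pieces with `R' ≤ x^η R₁`, `L' = L₁`
  have h5' : ∀ R' : ℝ, 0 ≤ R' → R' ≤ x ^ η * R₁ → L₁ * R' ≤ x ^ (1 / 2 - em) := by
    intro R' hR'0 hR'
    calc L₁ * R' ≤ L₁ * (x ^ η * R₁) := mul_le_mul_of_nonneg_left hR' hL0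
      _ = L₁ * R₁ * x ^ η := by ring
      _ ≤ x ^ (1 / 2 - em) := h5
  have h6' : ∀ R' : ℝ, 0 ≤ R' → R' ≤ x ^ η * R₁ → L₁ ^ (1 / 2 : ℝ) * R' ≤ 8 * M₁ * x ^ (-em) := by
    intro R' hR'0 hR'
    calc L₁ ^ (1 / 2 : ℝ) * R' ≤ L₁ ^ (1 / 2 : ℝ) * (x ^ η * R₁) :=
          mul_le_mul_of_nonneg_left hR' (by positivity)
      _ = L₁ ^ (1 / 2 : ℝ) * R₁ * x ^ η := by ring
      _ ≤ 8 * M₁ * x ^ (-em) := h6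
  have hR₁η : R₁ ≤ x ^ η * R₁ := le_mul_of_one_le_left hR0.le hxη1
  -- the special piece (`q = 1`) at a modulus range `R' ∈ [R₁, x^η R₁]` over `SR' ⊆ (r ∼ R')`
  have hspecial : ∀ (R' : ℝ) (SR' : Finset ℕ), R₁ ≤ R' → R' ≤ x ^ η * R₁ → 2 * R' < x →
      Q₁ * R₁ ≤ R' → SR' ⊆ dyadic R' →
      tripleTS a Xm Xn 1 (bumpW M₁ Y) (bumpW N₁ YN) (ind ({1} : Finset ℕ)) SL SR' ≤ Cpc * x ^ (1 - τ) := by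
    intro R' SR' hR'1 hR'2 hR'x hQR' hSR'
    have hR'0 : 0 < R' := by linarith
    -- move to the shape of `piece_bound` with `Q₁ = 1/2`, `D = 1`
    have hcongr : tripleTS a Xm Xn 1 (bumpW M₁ Y) (bumpW N₁ YN) (ind ({1} : Finset ℕ)) SL SR' =
        tripleTS a Xm Xn ⌊4 * (1 : ℝ)⌋₊ (bumpW M₁ Y) (bumpW N₁ YN) (bumpW (1 / 2) (1 / 4)) SL SR' := by
      rw [bumpW_half]
      symm
      refine tripleTS_congr_Xq a Xm Xn (bumpW M₁ Y) (bumpW N₁ YN) (fun q hq => ?_) (by norm_num) SL SR'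
      exact ind_of_not_mem (by rw [Finset.mem_singleton]; omega)
    rw [hcongr]
    refine hP x M₁ N₁ (1 / 2) L₁ R' Y C YN 1 (1 / 4) 0 SL SR' hx hx2 hM₁ hM₁x hM₁s hN₁ hN₁x (le_refl _)
      (by linarith only [hx]) hL₁ hL₁x (by linarith only [hR'1, hR₁]) (by linarith only [hR'x, hx])
      (by linarith only [hR'x]) hYdef hSL hSR' hC1 hCx hCN hYN0 hYN hfeasN
      le_rfl (by norm_num) (by norm_num) (by norm_num) (by norm_num) le_rfl (by norm_num)
      (by rw [zero_mul]; positivity) (fun d ξ => hrep_special d ξ) hCSL ?_ ?_ ?_ ?_ ?_ ?_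
    · -- `hHT` at `Q = 1/2`
      calc 4 * x ^ (2 * ε₁) * (1 / 2) * R' / M₁ = (4 * x ^ (2 * ε₁) * Q₁ * R₁ / M₁) * (R' / (2 * Q₁ * R₁)) := by
            field_simp
        _ ≤ (32 * x ^ t' * (L₁ * R₁)) * (R' / (2 * Q₁ * R₁)) :=
            mul_le_mul_of_nonneg_right hHT (by positivity)
        _ = 32 * x ^ t' * (L₁ * R') * (1 / (2 * Q₁)) := by field_simp
        _ ≤ 32 * x ^ t' * (L₁ * R') * 1 := by
            refine mul_le_mul_of_nonneg_left ?_ (by positivity)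
            rw [div_le_one (by positivity)]; linarith
        _ = 32 * x ^ t' * (L₁ * R') := mul_one _
    · -- `hNU`
      have h1 : N₁ ≤ 8 * x ^ σT * (1 / 2 * R') := by
        calc N₁ ≤ 4 * x ^ σT * (Q₁ * R₁) := hNU
          _ ≤ 4 * x ^ σT * R' := by gcongr
          _ = 8 * x ^ σT * (1 / 2 * R') := by ring
      have h2 : 1 / 2 * R' ≤ x ^ σT * (1 / 2 * R') := le_mul_of_one_le_left (by positivity) hxσ1
      linarith only [h1, h2]
    · exact hxB
    · exact h5' R' hR'0.le hR'2
    · exact h6' R' hR'0.le hR'2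
    · have : (1 / 2 : ℝ) ^ 2 * R' = R' / 4 := by ring
      rw [this]; linarith only [hR'x, hR'0, hx]
  -- case analysis on the range of `q`
  by_cases hQlt1 : Q₁ < 1
  · -- the block of `q` is `{1}`
    have hdy : dyadic Q₁ = {1} := dyadic_eq_singleton_one hQ₁ hQlt1
    have hcongr : tripleTS a Xm Xn ⌊2 * Q₁⌋₊ (bumpW M₁ Y) (bumpW N₁ YN) (ind (dyadic Q₁)) SL (dyadic R₁) =
        tripleTS a Xm Xn 1 (bumpW M₁ Y) (bumpW N₁ YN) (ind ({1} : Finset ℕ)) SL (dyadic R₁) := by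
      rw [hdy]
      refine tripleTS_congr_Xq a Xm Xn (bumpW M₁ Y) (bumpW N₁ YN) (fun q hq => ?_) ?_ SL (dyadic R₁)
      · exact ind_of_not_mem (by rw [Finset.mem_singleton]; omega)
      · exact Nat.le_floor (by push_cast; linarith)
    rw [hcongr]
    have h2R : 2 * R₁ < x :=
      calc 2 * R₁ = 4 * (1 / 2) * R₁ := by ring
        _ ≤ 4 * Q₁ * R₁ := by gcongr
        _ < x := hQR
    refine (hspecial R₁ (dyadic R₁) le_rfl hR₁η h2R (mul_le_of_le_one_left hR0.le hQlt1.le) subset_rfl).trans ?_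
    have hK3 : 0 ≤ 12 * C₃ * 4 ^ (ε₁ / 8) := by positivity
    have p1 := mul_nonneg hCpc.le hE0
    have p2 := mul_nonneg hK3 hE0
    have p3 := mul_nonneg hK3 hP0
    have p4 := mul_nonneg hCpc.le hP0
    have p5 := mul_le_mul_of_nonneg_left hP1 hCpc.le
    linarith only [p1, p2, p3, p4, p5]
  push Not at hQlt1
  by_cases hshort : 2 * Q₁ < x ^ η
  · -- short `q`: merge into the modulus
    have hq0 : ∀ q ∈ dyadic Q₁, 0 < q := fun q hq => pos_of_mem_dyadic hQ0.le hq
    refine (tripleTS_qmerge_le a Xm Xn ⌊2 * Q₁⌋₊ (bumpW M₁ Y) (bumpW N₁ YN) (dyadic Q₁) SL (dyadic R₁) hq0).trans ?_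
    have hpiece : ∀ q ∈ dyadic Q₁,
        tripleTS a Xm Xn 1 (bumpW M₁ Y) (bumpW N₁ YN) (ind ({1} : Finset ℕ)) SL ((dyadic R₁).image (fun r => q * r)) ≤
          Cpc * x ^ (1 - τ) := by
      intro q hq
      have hq' := (mem_dyadic hQ0.le).1 hq
      have hqpos : 0 < q := hq0 q hq
      have hq0' : (0 : ℝ) < q := by exact_mod_cast hqpos
      have hqη : (q : ℝ) ≤ x ^ η := by linarith [hq'.2]
      refine hspecial ((q : ℝ) * R₁) _ ?_ ?_ ?_ ?_ (image_mul_dyadic_subset hR0.le hqpos)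
      · have : (1 : ℝ) ≤ q := by exact_mod_cast hqpos
        exact le_mul_of_one_le_left hR0.le this
      · exact mul_le_mul_of_nonneg_right hqη hR0.le
      · calc 2 * ((q : ℝ) * R₁) ≤ 2 * ((2 * Q₁) * R₁) := by gcongr; exact hq'.2
          _ = 4 * Q₁ * R₁ := by ring
          _ < x := hQR
      · exact mul_le_mul_of_nonneg_right hq'.1.le hR0.le
    calc ∑ q ∈ dyadic Q₁, tripleTS a Xm Xn 1 (bumpW M₁ Y) (bumpW N₁ YN) (ind ({1} : Finset ℕ)) SL
          ((dyadic R₁).image (fun r => q * r))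
        ≤ ∑ _q ∈ dyadic Q₁, Cpc * x ^ (1 - τ) := Finset.sum_le_sum hpiece
      _ = ((dyadic Q₁).card : ℝ) * (Cpc * x ^ (1 - τ)) := by rw [Finset.sum_const, nsmul_eq_mul]
      _ ≤ (2 * x ^ η) * (Cpc * x ^ (1 - τ)) := by
          refine mul_le_mul_of_nonneg_right ?_ (by positivity)
          have := card_dyadic_le_two_mul hQ0.le
          linarith
      _ = 2 * Cpc * Ppart := by rw [hPpart]; ring
      _ ≤ (2 * Cpc + 12 * C₃ * 4 ^ (ε₁ / 8)) * (Epart + Ppart) := by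
          have hK3 : 0 ≤ 12 * C₃ * 4 ^ (ε₁ / 8) := by positivity
          have p1 := mul_nonneg hCpc.le hE0
          have p2 := mul_nonneg hK3 hE0
          have p3 := mul_nonneg hK3 hP0
          linarith only [p1, p2, p3]
  · -- long `q`: smooth `q`
    push Not at hshort
    set D : ℝ := 2 * Q₁ with hD
    set YQ : ℝ := Q₁ * x ^ (-ε₁) with hYQ
    have hYQ0 : 0 < YQ := by positivity
    have hxε : x ^ (-ε₁) = (x ^ ε₁)⁻¹ := Real.rpow_neg hx0.le ε₁
    have hYQ2 : YQ ≤ Q₁ / 2 := by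
      rw [hYQ, hxε]
      have h2 : (x ^ ε₁)⁻¹ ≤ 1 / 2 := by
        rw [inv_eq_one_div]; exact one_div_le_one_div_of_le (by norm_num) hx2
      calc Q₁ * (x ^ ε₁)⁻¹ ≤ Q₁ * (1 / 2) := mul_le_mul_of_nonneg_left h2 hQ0.le
        _ = Q₁ / 2 := by ring
    -- feasibility: `x^{ε₁} ≤ (2Q₁)^{ε₀}`
    have hfe : x ^ ε₁ ≤ D ^ ε₀ := by
      calc x ^ ε₁ ≤ x ^ (η * ε₀) := Real.rpow_le_rpow_of_exponent_le hx hε₁η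
        _ = (x ^ η) ^ ε₀ := by rw [Real.rpow_mul hx0.le]
        _ ≤ D ^ ε₀ := Real.rpow_le_rpow (by positivity) hshort hε₀0
    have hfeasQ : 2 * Q₁ / YQ ≤ 12 * D ^ ε₀ := by
      have : 2 * Q₁ / YQ = 2 * x ^ ε₁ := by
        rw [hYQ, hxε]; field_simp
      rw [this]
      have hD0 : 0 ≤ D ^ ε₀ := Real.rpow_nonneg (by positivity) ε₀
      linarith only [hfe, hD0]
    have hfeasQ' : (1 : ℝ) * (12 * x ^ ε₁) ≤ 12 * D ^ ε₀ := by rw [one_mul]; linarith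
    -- move `Xq` to `⌊4D⌋`
    have hXq : ⌊2 * Q₁⌋₊ ≤ ⌊4 * D⌋₊ := Nat.floor_mono (by rw [hD]; linarith)
    have hvan : ∀ q : ℕ, ⌊2 * Q₁⌋₊ < q → ind (dyadic Q₁) q = 0 := fun q hq =>
      ind_eq_zero_of_lt (dyadic_subset_Icc hQ0.le) hq
    rw [← tripleTS_congr_Xq a Xm Xn (bumpW M₁ Y) (bumpW N₁ YN) hvan hXq SL (dyadic R₁)]
    -- smoothing of `q`
    have hsplit := tripleTS_sub_le_gamma a Xm Xn ⌊4 * D⌋₊ (bumpW M₁ Y) (bumpW N₁ YN) (bumpW Q₁ YQ)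
      (bumpW Q₁ YQ - ind (dyadic Q₁)) SL (dyadic R₁)
    rw [sub_sub_cancel] at hsplit
    -- the smooth piece
    have hmain : tripleTS a Xm Xn ⌊4 * D⌋₊ (bumpW M₁ Y) (bumpW N₁ YN) (bumpW Q₁ YQ) SL (dyadic R₁) ≤
        Cpc * x ^ (1 - τ) := by
      refine hP x M₁ N₁ Q₁ L₁ R₁ Y C YN D YQ 1 SL (dyadic R₁) hx hx2 hM₁ hM₁x hM₁s hN₁ hN₁x hQ₁ hQ₁x hL₁ hL₁x
        hR₁ hR₁x hQR hYdef hSL subset_rfl hC1 hCx hCN hYN0 hYN hfeasN (by rw [hD]; linarith) le_rfl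
        (by rw [hD]; exact (Nat.floor_le (by positivity)).trans (by linarith)) hYQ0 hYQ2 zero_le_one hfeasQ hfeasQ'
        (fun d ξ => ?_) hCSL hHT ?_ hxB (h5' R₁ hR0.le hR₁η) (h6' R₁ hR0.le hR₁η) hQ2R
      · rw [hD, hYQ]; exact hrep_general hQ0 d ξ
      · have h2 : Q₁ * R₁ ≤ x ^ σT * (Q₁ * R₁) := le_mul_of_one_le_left (by positivity) hxσ1
        have h3 : 0 ≤ x ^ σT * (Q₁ * R₁) := by positivity
        linarith only [hNU, h2, h3]
    -- the thin-weight error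
    set T : Finset ℕ := bumpDiffSupport Q₁ YQ with hT
    have hTcard : (T.card : ℝ) ≤ 3 * YQ := by
      have h1 := card_bumpDiffSupport_le hYQ0.le (by linarith : YQ ≤ Q₁)
      have hYQ4 : 2 ≤ YQ := by
        -- `YQ = Q₁ x^{-ε₁} ≥ (x^η/2) x^{-ε₁} = x^{η-ε₁}/2 ≥ 2`
        have hsplit' : x ^ (η - ε₁) = x ^ η * x ^ (-ε₁) := by
          rw [← Real.rpow_add hx0]; ring_nf
        have hxm : 0 ≤ x ^ (-ε₁) := by positivity
        have h1 : x ^ η / 2 * x ^ (-ε₁) ≤ Q₁ * x ^ (-ε₁) :=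
          mul_le_mul_of_nonneg_right (by linarith only [hshort]) hxm
        rw [hYQ]
        have h2 : x ^ η / 2 * x ^ (-ε₁) = x ^ (η - ε₁) / 2 := by rw [hsplit']; ring
        linarith only [h1, h2, hx4]
      rw [hT]; linarith
    have hX4 : 1 ≤ 4 * x := by linarith only [hx]
    have hY0 : 0 < Y := by rw [hYdef]; positivity
    have hYM : Y ≤ M₁ := by
      rw [hYdef, hxε]
      have : (x ^ ε₁)⁻¹ ≤ 1 := inv_le_one_of_one_le₀ (by linarith only [hx2])
      exact mul_le_of_le_one_right hM0.le this
    have hXmX : (Xm : ℝ) ≤ 4 * x :=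
      (Nat.floor_le (by positivity)).trans (by linarith only [hYM, hM₁x, hx])
    have hXnX : (Xn : ℝ) ≤ 4 * x := (Nat.floor_le (by positivity)).trans (by linarith only [hCx])
    have hXqX : ((⌊4 * D⌋₊ : ℕ) : ℝ) ≤ 4 * x :=
      (Nat.floor_le (by positivity)).trans (by rw [hD]; linarith only [h2Q₁x])
    have hXlX : ((⌊2 * L₁⌋₊ : ℕ) : ℝ) ≤ 4 * x := (Nat.floor_le (by positivity)).trans (by linarith only [hL₁x, hx])
    have hTQ : ∀ q ∈ T, Q₁ / 2 ≤ (q : ℝ) := by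
      intro q hq
      have := lt_of_mem_bumpDiffSupport hYQ0.le (by linarith only [hYQ2, hQ₁] : YQ ≤ Q₁) hq
      linarith only [this, hYQ2]
    have hN0 : 0 ≤ N₁ := by linarith only [hN₁]
    have hE := h₃ a Xm Xn ⌊4 * D⌋₊ ⌊2 * L₁⌋₊ T SL (dyadic R₁) (bumpW M₁ Y) (bumpW N₁ YN)
      (bumpW Q₁ YQ - ind (dyadic Q₁)) (4 * x) R₁ (Q₁ / 2) hX4 hXmX hXnX hXqX hXlX hR0.le (by linarith only [hR₁x, hx])
      (hSL.trans (dyadic_subset_Icc hL0)) subset_rfl (by positivity) hTQ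
      (abs_bumpW_le_one hY0 hM0.le) (abs_bumpW_le_one hYN0 hN0)
      (abs_bumpW_sub_ind_le_one hYQ0 hQ0.le)
      (fun q hq => mem_bumpDiffSupport_of_ne hYQ0 (by linarith only [hYQ2, hQ₁]) hq)
    -- size of the error
    have hXm0 : (0 : ℝ) ≤ Xm := Nat.cast_nonneg _
    have hXn0 : (0 : ℝ) ≤ Xn := Nat.cast_nonneg _
    have hSL0 : (0 : ℝ) ≤ SL.card := Nat.cast_nonneg _
    have hratio : (T.card : ℝ) / (Q₁ / 2) ≤ 6 * x ^ (-ε₁) := by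
      rw [div_le_iff₀ (by positivity)]
      calc (T.card : ℝ) ≤ 3 * YQ := hTcard
        _ = 6 * x ^ (-ε₁) * (Q₁ / 2) := by rw [hYQ]; ring
    have hplus : (T.card : ℝ) * (2 * R₁ + 1) ≤ 12 * x ^ (-ε₁) * (Q₁ * R₁) := by
      calc (T.card : ℝ) * (2 * R₁ + 1) ≤ (3 * YQ) * (4 * R₁) :=
            mul_le_mul hTcard (by linarith) (by linarith) (by positivity)
        _ = 12 * x ^ (-ε₁) * (Q₁ * R₁) := by rw [hYQ]; ring
    have h4δ : (4 * x) ^ (ε₁ / 8) = 4 ^ (ε₁ / 8) * x ^ (ε₁ / 8) := Real.mul_rpow (by norm_num) hx0.le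
    have hxx : x ^ (ε₁ / 8) * x ^ (-ε₁) = x ^ (ε₁ / 8 - ε₁) := by rw [← Real.rpow_add hx0]; ring_nf
    have hEle : C₃ * (4 * x) ^ (ε₁ / 8) * SL.card *
        ((T.card : ℝ) / (Q₁ / 2) * ((Xm : ℝ) * Xn) + T.card * (2 * R₁ + 1)) ≤ 12 * C₃ * 4 ^ (ε₁ / 8) * Epart := by
      calc C₃ * (4 * x) ^ (ε₁ / 8) * SL.card * ((T.card : ℝ) / (Q₁ / 2) * ((Xm : ℝ) * Xn) + T.card * (2 * R₁ + 1))
          ≤ C₃ * (4 * x) ^ (ε₁ / 8) * SL.card * (6 * x ^ (-ε₁) * ((Xm : ℝ) * Xn) + 12 * x ^ (-ε₁) * (Q₁ * R₁)) := by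
            refine mul_le_mul_of_nonneg_left (add_le_add ?_ hplus) (by positivity)
            exact mul_le_mul_of_nonneg_right hratio (by positivity)
        _ ≤ C₃ * (4 * x) ^ (ε₁ / 8) * SL.card * (12 * x ^ (-ε₁) * ((Xm : ℝ) * Xn) + 12 * x ^ (-ε₁) * (Q₁ * R₁)) := by
            refine mul_le_mul_of_nonneg_left (add_le_add ?_ le_rfl) (by positivity)
            refine mul_le_mul_of_nonneg_right ?_ (by positivity)
            have : 0 ≤ x ^ (-ε₁) := by positivity
            linarith only [this]
        _ = 12 * C₃ * 4 ^ (ε₁ / 8) * Epart := by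
            rw [h4δ, hEpart, hmass, ← hxx]; ring
    calc _ ≤ tripleTS a Xm Xn ⌊4 * D⌋₊ (bumpW M₁ Y) (bumpW N₁ YN) (bumpW Q₁ YQ) SL (dyadic R₁) +
          tripleTS a Xm Xn ⌊4 * D⌋₊ (bumpW M₁ Y) (bumpW N₁ YN) (bumpW Q₁ YQ - ind (dyadic Q₁)) SL (dyadic R₁) := hsplit
      _ ≤ Cpc * x ^ (1 - τ) + 12 * C₃ * 4 ^ (ε₁ / 8) * Epart := add_le_add hmain (hE.trans hEle)
      _ ≤ (2 * Cpc + 12 * C₃ * 4 ^ (ε₁ / 8)) * (Epart + Ppart) := by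
          have hK3 : 0 ≤ 12 * C₃ * 4 ^ (ε₁ / 8) := by positivity
          have p1 := mul_nonneg hCpc.le hE0
          have p3 := mul_nonneg hK3 hP0
          have p4 := mul_nonneg hCpc.le hP0
          have p5 := mul_le_mul_of_nonneg_left hP1 hCpc.le
          linarith only [p1, p3, p4, p5]

/-! ### Stage N: the range of `n` (long: smooth; `{1}`: fixed weight; short: merge into `l`) -/

/-- `#T_M ≤ 3Y` for the transition set of `bump_{M,Y}` once `Y ≥ 2`. [folklore] -/
theorem card_bumpDiffSupport_le_three {M Y : ℝ} (hY : 2 ≤ Y) (hYM : Y ≤ M) :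
    ((bumpDiffSupport M Y).card : ℝ) ≤ 3 * Y := by
  have := card_bumpDiffSupport_le (by linarith : (0 : ℝ) ≤ Y) hYM
  linarith

/-- `a < m` on the transition set of `bump_{M,Y}` when `|a| ≤ M/2` and `Y ≤ M/2`. [folklore] -/
theorem lt_of_mem_bumpDiffSupport_of_abs_le {a : ℤ} {M Y : ℝ} (hY : 0 ≤ Y) (hYM : Y ≤ M / 2)
    (haM : |(a : ℝ)| < M / 2) {m : ℕ} (hm : m ∈ bumpDiffSupport M Y) : a < (m : ℤ) := by
  have h := lt_of_mem_bumpDiffSupport hY (by linarith) hm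
  have ha : (a : ℝ) < m := by
    have := le_abs_self (a : ℝ)
    linarith
  exact_mod_cast ha

set_option maxHeartbeats 1000000 in
/-- **Stage N, the block `n = 1`** (also used for the pieces of the `n → l` merge, where `SL` is the
sparse set `(l ∼ L₁)·n ⊆ (l' ∼ L')`): smooth `m` (thin-weight error `≪ x^{δ} #T_M #SL · 4`) and apply
Stage Q with the fixed weight `bump_{1/2,1/4} = 1_{{1}}` on `n`.
[cite: BombieriFriedlanderIwaniecActa1986, §14 pp. 244–246] -/
theorem stageN_special {κ ε₂ ε₀ K : ℝ} (hK0 : 0 ≤ K) (hK : UniformBoundAt κ ε₂ ε₀ K) (hκ : 0 ≤ κ)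
    (hε₂ : 0 ≤ ε₂) (hε₀0 : 0 ≤ ε₀) {a : ℤ} (ha : a ≠ 0) {ε₁ s t' σT em τ η : ℝ} (hε₁ : 0 < ε₁)
    (hε₁' : 2 * ε₁ ≤ 1) (ht' : 2 * ε₁ ≤ t') (hσT : 0 ≤ σT) (hem0 : 0 ≤ em) (hsP : τ + 2 * ε₁ ≤ s)
    (hsR : τ + 9 * ε₁ / 2 ≤ s) (hexp : 2 * τ + 2 * ε₁ + 14 * (ε₂ + κ * ε₀) + t' + σT ≤ em)
    (hε₁η : ε₁ ≤ η * ε₀) (hη0 : 0 ≤ η)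
    {j : ℕ} (hj : 2 ≤ j) (hjε : 2 + 2 * ε₁ ≤ j * ε₁) :
    ∃ CS : ℝ, 0 < CS ∧ ∀ (x M₁ N₀ Q₁ L' R₁ : ℝ) (SL : Finset ℕ),
      1 ≤ x → 2 ≤ x ^ ε₁ → 4 ≤ x ^ (η - ε₁) → 16 ≤ x ^ (s - ε₁) → |(a : ℝ)| ≤ x → 16 * |(a : ℝ)| < x ^ s →
      1 ≤ M₁ → M₁ ≤ x → x ^ s ≤ 8 * M₁ → 1 / 2 ≤ N₀ → L' * M₁ * N₀ ≤ x →
      1 / 2 ≤ Q₁ → 1 / 2 ≤ L' → L' ≤ x → 1 / 2 ≤ R₁ → R₁ ≤ x → 4 * Q₁ * R₁ < x →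
      SL ⊆ dyadic L' → 4 * (SL.card : ℝ) ≤ 45 * x / M₁ →
      4 * x ^ (2 * ε₁) * Q₁ * R₁ / M₁ ≤ 32 * x ^ t' * (L' * R₁) →
      N₀ ≤ 4 * x ^ σT * (Q₁ * R₁) → L' * R₁ * x ^ η ≤ x ^ (1 / 2 - em) →
      L' ^ (1 / 2 : ℝ) * R₁ * x ^ η ≤ 8 * M₁ * x ^ (-em) → Q₁ ^ 2 * R₁ ≤ x →
      tripleTS a ⌊2 * M₁ + M₁ * x ^ (-ε₁)⌋₊ 4 ⌊2 * Q₁⌋₊ (ind (dyadic M₁)) (ind ({1} : Finset ℕ))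
          (ind (dyadic Q₁)) SL (dyadic R₁) ≤
        CS * (x ^ (ε₁ / 8 - ε₁) * (M₁ * SL.card + SL.card * (Q₁ * R₁)) + x ^ η * x ^ (1 - τ)) := by
  obtain ⟨CQ, hCQ, hQ⟩ := stageQ_bound hK0 hK hκ hε₂ hε₀0 ha hε₁ hε₁' ht' hσT hem0 hsP hsR hexp hε₁η hη0 hj hjε
  obtain ⟨C₁, hC₁, h₁⟩ := tripleTS_le_of_thin_alpha (δ := ε₁ / 8) (by positivity)
  refine ⟨12 * CQ + 12 * C₁ * 4 ^ (ε₁ / 8), by positivity, ?_⟩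
  intro x M₁ N₀ Q₁ L' R₁ SL hx hx2 hx4 hx16 hax hax16 hM₁ hM₁x hM₁s hN₀ hxB hQ₁ hL' hL'x hR₁ hR₁x hQR hSL hCSL hHT
    hNU h5 h6 hQ2R
  have hx0 : 0 < x := by linarith
  have hM0 : 0 < M₁ := by linarith
  have hQ0 : 0 < Q₁ := by linarith
  have hR0 : 0 < R₁ := by linarith
  have hL0 : 0 ≤ L' := by linarith
  set Y : ℝ := M₁ * x ^ (-ε₁) with hYdef
  have hY0 : 0 < Y := by positivity
  have hxε : x ^ (-ε₁) = (x ^ ε₁)⁻¹ := Real.rpow_neg hx0.le ε₁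
  have hYM2 : Y ≤ M₁ / 2 := by
    rw [hYdef, hxε]
    have h2 : (x ^ ε₁)⁻¹ ≤ 1 / 2 := by
      rw [inv_eq_one_div]; exact one_div_le_one_div_of_le (by norm_num) hx2
    calc M₁ * (x ^ ε₁)⁻¹ ≤ M₁ * (1 / 2) := mul_le_mul_of_nonneg_left h2 hM0.le
      _ = M₁ / 2 := by ring
  have hYM : Y ≤ M₁ := by linarith
  -- `Y ≥ 2` and `|a| < M₁/2`
  have hY2 : 2 ≤ Y := by
    have hsplit : x ^ (s - ε₁) = x ^ s * x ^ (-ε₁) := by rw [← Real.rpow_add hx0]; ring_nf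
    have hxm : 0 ≤ x ^ (-ε₁) := by positivity
    have h1 : x ^ s / 8 * x ^ (-ε₁) ≤ M₁ * x ^ (-ε₁) :=
      mul_le_mul_of_nonneg_right (by linarith only [hM₁s]) hxm
    have h2 : x ^ s / 8 * x ^ (-ε₁) = x ^ (s - ε₁) / 8 := by rw [hsplit]; ring
    rw [hYdef]; linarith only [h1, h2, hx16]
  have haM : |(a : ℝ)| < M₁ / 2 := by linarith only [hax16, hM₁s]
  have haT : ∀ m ∈ bumpDiffSupport M₁ Y, a < (m : ℤ) := fun m hm =>
    lt_of_mem_bumpDiffSupport_of_abs_le hY0.le hYM2 haM hm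
  set Xm : ℕ := ⌊2 * M₁ + Y⌋₊ with hXm
  -- smoothing of `m`
  have hsplit := tripleTS_indicator_le_split_m a Xm 4 ⌊2 * Q₁⌋₊ (bumpW M₁ Y) (ind ({1} : Finset ℕ)) (ind (dyadic Q₁))
    (dyadic M₁) SL (dyadic R₁)
  -- the smoothed term through Stage Q (`N = 1/2`, `C = 1`, `YN = 1/4`)
  have hmain : tripleTS a Xm 4 ⌊2 * Q₁⌋₊ (bumpW M₁ Y) (ind ({1} : Finset ℕ)) (ind (dyadic Q₁)) SL (dyadic R₁) ≤
      CQ * (x ^ (ε₁ / 8 - ε₁) * (((⌊2 * M₁ + Y⌋₊ : ℕ) : ℝ) * ⌊4 * (1 : ℝ)⌋₊ * SL.card + SL.card * (Q₁ * R₁)) +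
        x ^ η * x ^ (1 - τ)) := by
    have h4 : (4 : ℕ) = ⌊4 * (1 : ℝ)⌋₊ := by norm_num
    rw [← bumpW_half, h4]
    refine hQ x M₁ (1 / 2) Q₁ L' R₁ Y 1 (1 / 4) SL hx hx2 hx4 hax hM₁ hM₁x hM₁s le_rfl (by linarith only [hx]) hQ₁ hL'
      hL'x hR₁ hR₁x hQR rfl hSL le_rfl hx (Or.inr ⟨rfl, rfl, rfl⟩) (by norm_num) (by norm_num) ?_ ?_ hHT ?_ ?_ h5 h6 hQ2R
    · rw [Real.one_rpow]; norm_num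
    · rw [← h4]; push_cast; linarith only [hCSL]
    · linarith only [hNU, hN₀]
    · calc L' * M₁ * (1 / 2) ≤ L' * M₁ * N₀ := by gcongr
        _ ≤ x := hxB
  -- the thin-weight error in `m`
  have hX4 : 1 ≤ 4 * x := by linarith only [hx]
  have hXmX : (Xm : ℝ) ≤ 4 * x := (Nat.floor_le (by positivity)).trans (by linarith only [hYM, hM₁x, hx])
  have hE := h₁ a Xm 4 ⌊2 * Q₁⌋₊ ⌊2 * L'⌋₊ ⌊2 * R₁⌋₊ (bumpDiffSupport M₁ Y) SL (dyadic R₁)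
    (bumpW M₁ Y - ind (dyadic M₁)) (ind ({1} : Finset ℕ)) (ind (dyadic Q₁)) (4 * x) hX4 hXmX
    (by push_cast; linarith only [hx])
    ((Nat.floor_le (by positivity)).trans (by
      have : 2 * Q₁ < x := by
        calc 2 * Q₁ = 4 * Q₁ * (1 / 2) := by ring
          _ ≤ 4 * Q₁ * R₁ := by gcongr
          _ < x := hQR
      linarith only [this, hx]))
    ((Nat.floor_le (by positivity)).trans (by linarith only [hL'x, hx]))
    ((Nat.floor_le (by positivity)).trans (by linarith only [hR₁x, hx]))
    (hSL.trans (dyadic_subset_Icc hL0)) (dyadic_subset_Icc hR0.le) (by linarith only [hax, hx]) haT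
    (abs_bumpW_sub_ind_le_one hY0 hM0.le) (fun m hm => mem_bumpDiffSupport_of_ne hY0 hYM hm)
    (abs_ind_le_one _) (abs_ind_le_one _)
  have hTcard : ((bumpDiffSupport M₁ Y).card : ℝ) ≤ 3 * Y := card_bumpDiffSupport_le_three hY2 hYM
  have h4δ : (4 * x) ^ (ε₁ / 8) = 4 ^ (ε₁ / 8) * x ^ (ε₁ / 8) := Real.mul_rpow (by norm_num) hx0.le
  have hxx : x ^ (ε₁ / 8) * x ^ (-ε₁) = x ^ (ε₁ / 8 - ε₁) := by rw [← Real.rpow_add hx0]; ring_nf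
  have hSL0 : (0 : ℝ) ≤ SL.card := Nat.cast_nonneg _
  have hEle : C₁ * (4 * x) ^ (ε₁ / 8) * (bumpDiffSupport M₁ Y).card * SL.card * ((4 : ℕ) : ℝ) ≤
      12 * C₁ * 4 ^ (ε₁ / 8) * (x ^ (ε₁ / 8 - ε₁) * (M₁ * SL.card)) := by
    calc C₁ * (4 * x) ^ (ε₁ / 8) * (bumpDiffSupport M₁ Y).card * SL.card * ((4 : ℕ) : ℝ)
        ≤ C₁ * (4 * x) ^ (ε₁ / 8) * (3 * Y) * SL.card * ((4 : ℕ) : ℝ) := by gcongr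
      _ = 12 * C₁ * 4 ^ (ε₁ / 8) * (x ^ (ε₁ / 8) * x ^ (-ε₁) * (M₁ * SL.card)) := by
          rw [h4δ, hYdef]; push_cast; ring
      _ = _ := by rw [hxx]
  -- the sizes of `Xm` and the assembly
  have hXm3 : ((⌊2 * M₁ + Y⌋₊ : ℕ) : ℝ) * ((⌊4 * (1 : ℝ)⌋₊ : ℕ) : ℝ) ≤ 12 * M₁ := by
    have h1 : ((⌊2 * M₁ + Y⌋₊ : ℕ) : ℝ) ≤ 3 * M₁ := (Nat.floor_le (by positivity)).trans (by linarith only [hYM])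
    have h2 : ((⌊4 * (1 : ℝ)⌋₊ : ℕ) : ℝ) = 4 := by norm_num
    rw [h2]; linarith only [h1]
  have hxpow0 : 0 ≤ x ^ (ε₁ / 8 - ε₁) := by positivity
  have hmass : x ^ (ε₁ / 8 - ε₁) * (((⌊2 * M₁ + Y⌋₊ : ℕ) : ℝ) * ⌊4 * (1 : ℝ)⌋₊ * SL.card + SL.card * (Q₁ * R₁)) ≤
      12 * (x ^ (ε₁ / 8 - ε₁) * (M₁ * SL.card + SL.card * (Q₁ * R₁))) := by
    have h1 : ((⌊2 * M₁ + Y⌋₊ : ℕ) : ℝ) * ⌊4 * (1 : ℝ)⌋₊ * SL.card ≤ 12 * M₁ * SL.card :=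
      mul_le_mul_of_nonneg_right hXm3 hSL0
    have h2 : 0 ≤ SL.card * (Q₁ * R₁) := by positivity
    have h3 : ((⌊2 * M₁ + Y⌋₊ : ℕ) : ℝ) * ⌊4 * (1 : ℝ)⌋₊ * SL.card + SL.card * (Q₁ * R₁) ≤
        12 * (M₁ * SL.card + SL.card * (Q₁ * R₁)) := by linarith only [h1, h2]
    calc _ ≤ x ^ (ε₁ / 8 - ε₁) * (12 * (M₁ * SL.card + SL.card * (Q₁ * R₁))) :=
          mul_le_mul_of_nonneg_left h3 hxpow0
      _ = _ := by ring
  have hP0 : 0 ≤ x ^ η * x ^ (1 - τ) := by positivity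
  have hA0 : 0 ≤ x ^ (ε₁ / 8 - ε₁) * (M₁ * SL.card + SL.card * (Q₁ * R₁)) := by positivity
  have hK1 : 0 ≤ 12 * C₁ * 4 ^ (ε₁ / 8) := by positivity
  have p1 := mul_nonneg hK1 hP0
  have p2 := mul_nonneg hCQ.le hP0
  calc _ ≤ tripleTS a Xm 4 ⌊2 * Q₁⌋₊ (bumpW M₁ Y) (ind ({1} : Finset ℕ)) (ind (dyadic Q₁)) SL (dyadic R₁) +
        tripleTS a Xm 4 ⌊2 * Q₁⌋₊ (bumpW M₁ Y - ind (dyadic M₁)) (ind ({1} : Finset ℕ)) (ind (dyadic Q₁)) SL (dyadic R₁) :=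
        hsplit
    _ ≤ CQ * (12 * (x ^ (ε₁ / 8 - ε₁) * (M₁ * SL.card + SL.card * (Q₁ * R₁))) + x ^ η * x ^ (1 - τ)) +
        12 * C₁ * 4 ^ (ε₁ / 8) * (x ^ (ε₁ / 8 - ε₁) * (M₁ * SL.card)) := by
        refine add_le_add (hmain.trans ?_) (hE.trans hEle)
        exact mul_le_mul_of_nonneg_left (add_le_add hmass le_rfl) hCQ.le
    _ ≤ (12 * CQ + 12 * C₁ * 4 ^ (ε₁ / 8)) *
        (x ^ (ε₁ / 8 - ε₁) * (M₁ * SL.card + SL.card * (Q₁ * R₁)) + x ^ η * x ^ (1 - τ)) := by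
        have h1 : x ^ (ε₁ / 8 - ε₁) * (M₁ * SL.card) ≤ x ^ (ε₁ / 8 - ε₁) * (M₁ * SL.card + SL.card * (Q₁ * R₁)) :=
          mul_le_mul_of_nonneg_left (by linarith only [show (0 : ℝ) ≤ SL.card * (Q₁ * R₁) by positivity]) hxpow0
        have h2 := mul_le_mul_of_nonneg_left h1 hK1
        linarith only [h2, p1, p2]

set_option maxHeartbeats 1000000 in
/-- **Stage N, long `n`** (`x^η ≤ 2N₁`): smooth `m` and `n` with plateau bumps of relative width
`x^{−ε₁}` (thin-weight errors `≪ x^{δ−ε₁} L₁M₁N₁`), then Stage Q with `β = bump_{N₁}`, `C = 2N₁`.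
[cite: BombieriFriedlanderIwaniecActa1986, §14 pp. 244–246] -/
theorem stageN_long {κ ε₂ ε₀ K : ℝ} (hK0 : 0 ≤ K) (hK : UniformBoundAt κ ε₂ ε₀ K) (hκ : 0 ≤ κ)
    (hε₂ : 0 ≤ ε₂) (hε₀0 : 0 ≤ ε₀) {a : ℤ} (ha : a ≠ 0) {ε₁ s t' σT em τ η : ℝ} (hε₁ : 0 < ε₁)
    (hε₁' : 2 * ε₁ ≤ 1) (ht' : 2 * ε₁ ≤ t') (hσT : 0 ≤ σT) (hem0 : 0 ≤ em) (hsP : τ + 2 * ε₁ ≤ s)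
    (hsR : τ + 9 * ε₁ / 2 ≤ s) (hexp : 2 * τ + 2 * ε₁ + 14 * (ε₂ + κ * ε₀) + t' + σT ≤ em)
    (hε₁η : ε₁ ≤ η * ε₀) (hη0 : 0 ≤ η)
    {j : ℕ} (hj : 2 ≤ j) (hjε : 2 + 2 * ε₁ ≤ j * ε₁) :
    ∃ CL : ℝ, 0 < CL ∧ ∀ (x M₁ N₁ Q₁ L₁ R₁ : ℝ),
      1 ≤ x → 2 ≤ x ^ ε₁ → 4 ≤ x ^ (η - ε₁) → 16 ≤ x ^ (s - ε₁) → |(a : ℝ)| ≤ x → 16 * |(a : ℝ)| < x ^ s →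
      4 * |(a : ℝ)| < x ^ η →
      1 ≤ M₁ → M₁ ≤ x → x ^ s ≤ 8 * M₁ → x ^ η ≤ 2 * N₁ → 2 * N₁ ≤ x → L₁ * M₁ * N₁ ≤ x →
      1 / 2 ≤ Q₁ → 1 / 2 ≤ L₁ → L₁ ≤ x → 1 / 2 ≤ R₁ → R₁ ≤ x → 4 * Q₁ * R₁ < x →
      4 * x ^ (2 * ε₁) * Q₁ * R₁ / M₁ ≤ 32 * x ^ t' * (L₁ * R₁) →
      N₁ ≤ 4 * x ^ σT * (Q₁ * R₁) → L₁ * R₁ * x ^ η ≤ x ^ (1 / 2 - em) →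
      L₁ ^ (1 / 2 : ℝ) * R₁ * x ^ η ≤ 8 * M₁ * x ^ (-em) → Q₁ ^ 2 * R₁ ≤ x →
      tripleTS a ⌊2 * M₁ + M₁ * x ^ (-ε₁)⌋₊ ⌊4 * (2 * N₁)⌋₊ ⌊2 * Q₁⌋₊ (ind (dyadic M₁)) (ind (dyadic N₁))
          (ind (dyadic Q₁)) (dyadic L₁) (dyadic R₁) ≤
        CL * (x ^ (ε₁ / 8 - ε₁) * (L₁ * M₁ * N₁ + L₁ * (Q₁ * R₁)) + x ^ η * x ^ (1 - τ)) := by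
  obtain ⟨CQ, hCQ, hQ⟩ := stageQ_bound hK0 hK hκ hε₂ hε₀0 ha hε₁ hε₁' ht' hσT hem0 hsP hsR hexp hε₁η hη0 hj hjε
  obtain ⟨C₁, hC₁, h₁⟩ := tripleTS_le_of_thin_alpha (δ := ε₁ / 8) (by positivity)
  refine ⟨96 * CQ + 132 * C₁ * 4 ^ (ε₁ / 8), by positivity, ?_⟩
  intro x M₁ N₁ Q₁ L₁ R₁ hx hx2 hx4 hx16 hax hax16 hax4 hM₁ hM₁x hM₁s hNlong hN₁x hxB hQ₁ hL₁ hL₁x hR₁ hR₁x hQR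
    hHT hNU h5 h6 hQ2R
  have hx0 : 0 < x := by linarith
  have hM0 : 0 < M₁ := by linarith
  have hQ0 : 0 < Q₁ := by linarith
  have hR0 : 0 < R₁ := by linarith
  have hL0 : 0 < L₁ := by linarith
  have hxη1 : 1 ≤ x ^ η := Real.one_le_rpow hx hη0
  have hN₁ : 1 / 2 ≤ N₁ := by linarith only [hNlong, hxη1]
  have hN0 : 0 < N₁ := by linarith
  have hxε : x ^ (-ε₁) = (x ^ ε₁)⁻¹ := Real.rpow_neg hx0.le ε₁
  have hinv2 : (x ^ ε₁)⁻¹ ≤ 1 / 2 := by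
    rw [inv_eq_one_div]; exact one_div_le_one_div_of_le (by norm_num) hx2
  -- the smoothing parameters
  set Y : ℝ := M₁ * x ^ (-ε₁) with hYdef
  have hY0 : 0 < Y := by positivity
  have hYM2 : Y ≤ M₁ / 2 := by
    rw [hYdef, hxε]
    calc M₁ * (x ^ ε₁)⁻¹ ≤ M₁ * (1 / 2) := mul_le_mul_of_nonneg_left hinv2 hM0.le
      _ = M₁ / 2 := by ring
  have hYM : Y ≤ M₁ := by linarith
  set YN : ℝ := N₁ * x ^ (-ε₁) with hYNdef
  have hYN0 : 0 < YN := by positivity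
  have hYN2 : YN ≤ N₁ / 2 := by
    rw [hYNdef, hxε]
    calc N₁ * (x ^ ε₁)⁻¹ ≤ N₁ * (1 / 2) := mul_le_mul_of_nonneg_left hinv2 hN0.le
      _ = N₁ / 2 := by ring
  have hYNN : YN ≤ N₁ := by linarith
  have hxm : 0 ≤ x ^ (-ε₁) := by positivity
  have hY2 : 2 ≤ Y := by
    have hsplit : x ^ (s - ε₁) = x ^ s * x ^ (-ε₁) := by rw [← Real.rpow_add hx0]; ring_nf
    have h1 : x ^ s / 8 * x ^ (-ε₁) ≤ M₁ * x ^ (-ε₁) :=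
      mul_le_mul_of_nonneg_right (by linarith only [hM₁s]) hxm
    have h2 : x ^ s / 8 * x ^ (-ε₁) = x ^ (s - ε₁) / 8 := by rw [hsplit]; ring
    rw [hYdef]; linarith only [h1, h2, hx16]
  have hYN4 : 2 ≤ YN := by
    have hsplit : x ^ (η - ε₁) = x ^ η * x ^ (-ε₁) := by rw [← Real.rpow_add hx0]; ring_nf
    have h1 : x ^ η / 2 * x ^ (-ε₁) ≤ N₁ * x ^ (-ε₁) :=
      mul_le_mul_of_nonneg_right (by linarith only [hNlong]) hxm
    have h2 : x ^ η / 2 * x ^ (-ε₁) = x ^ (η - ε₁) / 2 := by rw [hsplit]; ring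
    rw [hYNdef]; linarith only [h1, h2, hx4]
  -- `a < m`, `a < n` on the transition sets
  have haM : |(a : ℝ)| < M₁ / 2 := by linarith only [hax16, hM₁s]
  have haN : |(a : ℝ)| < N₁ / 2 := by linarith only [hax4, hNlong]
  have haTM : ∀ m ∈ bumpDiffSupport M₁ Y, a < (m : ℤ) := fun m hm =>
    lt_of_mem_bumpDiffSupport_of_abs_le hY0.le hYM2 haM hm
  have haTN : ∀ n ∈ bumpDiffSupport N₁ YN, a < (n : ℤ) := fun n hn =>
    lt_of_mem_bumpDiffSupport_of_abs_le hYN0.le hYN2 haN hn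
  set Xm : ℕ := ⌊2 * M₁ + Y⌋₊ with hXm
  set Xn : ℕ := ⌊4 * (2 * N₁)⌋₊ with hXn
  have hXm3 : (Xm : ℝ) ≤ 3 * M₁ := (Nat.floor_le (by positivity)).trans (by linarith only [hYM])
  have hXn8 : (Xn : ℝ) ≤ 8 * N₁ := (Nat.floor_le (by positivity)).trans (by linarith only [hN₁])
  have hSLcard : ((dyadic L₁).card : ℝ) ≤ 4 * L₁ := by
    have := card_dyadic_le_two_mul hL0.le; linarith only [this, hL₁]
  -- feasibility of the weight in `n`
  have hfe : x ^ ε₁ ≤ (2 * N₁) ^ ε₀ := by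
    calc x ^ ε₁ ≤ x ^ (η * ε₀) := Real.rpow_le_rpow_of_exponent_le hx hε₁η
      _ = (x ^ η) ^ ε₀ := by rw [Real.rpow_mul hx0.le]
      _ ≤ (2 * N₁) ^ ε₀ := Real.rpow_le_rpow (by positivity) hNlong hε₀0
  have hfeasN : 2 * N₁ / YN ≤ 4 * (2 * N₁) ^ ε₀ := by
    have : 2 * N₁ / YN = 2 * x ^ ε₁ := by rw [hYNdef, hxε]; field_simp
    rw [this]
    have h0 : 0 ≤ (2 * N₁) ^ ε₀ := Real.rpow_nonneg (by positivity) ε₀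
    linarith only [hfe, h0]
  -- splitting off the smoothing of `m` and `n`
  have hsplit := tripleTS_indicator_le_split_mn a Xm Xn ⌊2 * Q₁⌋₊ (bumpW M₁ Y) (bumpW N₁ YN) (ind (dyadic Q₁))
    (dyadic M₁) (dyadic N₁) (dyadic L₁) (dyadic R₁)
  -- the smoothed term through Stage Q
  have hCSL : (Xn : ℝ) * (dyadic L₁).card ≤ 45 * x / M₁ := by
    have h1 : (Xn : ℝ) * (dyadic L₁).card ≤ (8 * N₁) * (4 * L₁) :=
      mul_le_mul hXn8 hSLcard (Nat.cast_nonneg _) (by positivity)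
    have h2 : (8 * N₁) * (4 * L₁) = 32 * (L₁ * N₁) := by ring
    have h3 : L₁ * N₁ ≤ x / M₁ := by
      rw [le_div_iff₀ hM0]; calc L₁ * N₁ * M₁ = L₁ * M₁ * N₁ := by ring
        _ ≤ x := hxB
    have h4 : 32 * (x / M₁) ≤ 45 * x / M₁ := by
      rw [mul_div_assoc']; exact div_le_div_of_nonneg_right (by linarith only [hx]) hM0.le
    linarith only [h1, h2, h3, h4]
  have hmain : tripleTS a Xm Xn ⌊2 * Q₁⌋₊ (bumpW M₁ Y) (bumpW N₁ YN) (ind (dyadic Q₁)) (dyadic L₁) (dyadic R₁) ≤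
      CQ * (x ^ (ε₁ / 8 - ε₁) * ((Xm : ℝ) * Xn * (dyadic L₁).card + (dyadic L₁).card * (Q₁ * R₁)) +
        x ^ η * x ^ (1 - τ)) :=
    hQ x M₁ N₁ Q₁ L₁ R₁ Y (2 * N₁) YN (dyadic L₁) hx hx2 hx4 hax hM₁ hM₁x hM₁s hN₁ (by linarith only [hN₁x, hN₁]) hQ₁
      hL₁ hL₁x hR₁ hR₁x hQR rfl subset_rfl (by linarith only [hNlong, hxη1]) hN₁x (Or.inl rfl) hYN0 hYN2 hfeasN hCSL hHT
      hNU hxB h5 h6 hQ2R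
  -- the two thin-weight errors
  have hX4 : 1 ≤ 4 * x := by linarith only [hx]
  have hXmX : (Xm : ℝ) ≤ 4 * x := hXm3.trans (by linarith only [hM₁x, hx])
  have hXnX : (Xn : ℝ) ≤ 4 * x := hXn8.trans (by linarith only [hN₁x])
  have h2Q₁x : 2 * Q₁ < x :=
    calc 2 * Q₁ = 4 * Q₁ * (1 / 2) := by ring
      _ ≤ 4 * Q₁ * R₁ := by gcongr
      _ < x := hQR
  have hXqX : ((⌊2 * Q₁⌋₊ : ℕ) : ℝ) ≤ 4 * x := (Nat.floor_le (by positivity)).trans (by linarith only [h2Q₁x, hx])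
  have hXlX : ((⌊2 * L₁⌋₊ : ℕ) : ℝ) ≤ 4 * x := (Nat.floor_le (by positivity)).trans (by linarith only [hL₁x, hx])
  have hXrX : ((⌊2 * R₁⌋₊ : ℕ) : ℝ) ≤ 4 * x := (Nat.floor_le (by positivity)).trans (by linarith only [hR₁x, hx])
  have hax4x : |(a : ℝ)| ≤ 4 * x := by linarith only [hax, hx]
  have hEM := h₁ a Xm Xn ⌊2 * Q₁⌋₊ ⌊2 * L₁⌋₊ ⌊2 * R₁⌋₊ (bumpDiffSupport M₁ Y) (dyadic L₁) (dyadic R₁)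
    (bumpW M₁ Y - ind (dyadic M₁)) (ind (dyadic N₁)) (ind (dyadic Q₁)) (4 * x) hX4 hXmX hXnX hXqX hXlX hXrX
    (dyadic_subset_Icc hL0.le) (dyadic_subset_Icc hR0.le) hax4x haTM
    (abs_bumpW_sub_ind_le_one hY0 hM0.le) (fun m hm => mem_bumpDiffSupport_of_ne hY0 hYM hm)
    (abs_ind_le_one _) (abs_ind_le_one _)
  have hEN' := h₁ a Xn Xm ⌊2 * Q₁⌋₊ ⌊2 * L₁⌋₊ ⌊2 * R₁⌋₊ (bumpDiffSupport N₁ YN) (dyadic L₁) (dyadic R₁)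
    (bumpW N₁ YN - ind (dyadic N₁)) (bumpW M₁ Y) (ind (dyadic Q₁)) (4 * x) hX4 hXnX hXmX hXqX hXlX hXrX
    (dyadic_subset_Icc hL0.le) (dyadic_subset_Icc hR0.le) hax4x haTN
    (abs_bumpW_sub_ind_le_one hYN0 hN0.le) (fun n hn => mem_bumpDiffSupport_of_ne hYN0 hYNN hn)
    (abs_bumpW_le_one hY0 hM0.le) (abs_ind_le_one _)
  rw [← tripleTS_swap] at hEN'
  -- numerics for the errors
  have hTM : ((bumpDiffSupport M₁ Y).card : ℝ) ≤ 3 * Y := card_bumpDiffSupport_le_three hY2 hYM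
  have hTN : ((bumpDiffSupport N₁ YN).card : ℝ) ≤ 3 * YN := card_bumpDiffSupport_le_three hYN4 hYNN
  have h4δ : (4 * x) ^ (ε₁ / 8) = 4 ^ (ε₁ / 8) * x ^ (ε₁ / 8) := Real.mul_rpow (by norm_num) hx0.le
  have hxx : x ^ (ε₁ / 8) * x ^ (-ε₁) = x ^ (ε₁ / 8 - ε₁) := by rw [← Real.rpow_add hx0]; ring_nf
  have hxpow0 : 0 ≤ x ^ (ε₁ / 8 - ε₁) := by positivity
  have hEMle : C₁ * (4 * x) ^ (ε₁ / 8) * (bumpDiffSupport M₁ Y).card * (dyadic L₁).card * Xn ≤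
      96 * C₁ * 4 ^ (ε₁ / 8) * (x ^ (ε₁ / 8 - ε₁) * (L₁ * M₁ * N₁)) := by
    calc C₁ * (4 * x) ^ (ε₁ / 8) * (bumpDiffSupport M₁ Y).card * (dyadic L₁).card * Xn
        ≤ C₁ * (4 * x) ^ (ε₁ / 8) * (3 * Y) * (4 * L₁) * (8 * N₁) := by gcongr
      _ = 96 * C₁ * 4 ^ (ε₁ / 8) * (x ^ (ε₁ / 8) * x ^ (-ε₁) * (L₁ * M₁ * N₁)) := by rw [h4δ, hYdef]; ring
      _ = _ := by rw [hxx]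
  have hENle : C₁ * (4 * x) ^ (ε₁ / 8) * (bumpDiffSupport N₁ YN).card * (dyadic L₁).card * Xm ≤
      36 * C₁ * 4 ^ (ε₁ / 8) * (x ^ (ε₁ / 8 - ε₁) * (L₁ * M₁ * N₁)) := by
    calc C₁ * (4 * x) ^ (ε₁ / 8) * (bumpDiffSupport N₁ YN).card * (dyadic L₁).card * Xm
        ≤ C₁ * (4 * x) ^ (ε₁ / 8) * (3 * YN) * (4 * L₁) * (3 * M₁) := by gcongr
      _ = 36 * C₁ * 4 ^ (ε₁ / 8) * (x ^ (ε₁ / 8) * x ^ (-ε₁) * (L₁ * M₁ * N₁)) := by rw [h4δ, hYNdef]; ring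
      _ = _ := by rw [hxx]
  have hmass : x ^ (ε₁ / 8 - ε₁) * ((Xm : ℝ) * Xn * (dyadic L₁).card + (dyadic L₁).card * (Q₁ * R₁)) ≤
      96 * (x ^ (ε₁ / 8 - ε₁) * (L₁ * M₁ * N₁ + L₁ * (Q₁ * R₁))) := by
    have h1 : (Xm : ℝ) * Xn * (dyadic L₁).card ≤ (3 * M₁) * (8 * N₁) * (4 * L₁) := by
      have := mul_le_mul hXm3 hXn8 (Nat.cast_nonneg _) (by positivity)
      exact mul_le_mul this hSLcard (Nat.cast_nonneg _) (by positivity)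
    have h2 : ((dyadic L₁).card : ℝ) * (Q₁ * R₁) ≤ (4 * L₁) * (Q₁ * R₁) :=
      mul_le_mul_of_nonneg_right hSLcard (by positivity)
    have h3 : (Xm : ℝ) * Xn * (dyadic L₁).card + (dyadic L₁).card * (Q₁ * R₁) ≤
        96 * (L₁ * M₁ * N₁ + L₁ * (Q₁ * R₁)) := by
      have : 0 ≤ L₁ * (Q₁ * R₁) := by positivity
      linarith only [h1, h2, this]
    calc _ ≤ x ^ (ε₁ / 8 - ε₁) * (96 * (L₁ * M₁ * N₁ + L₁ * (Q₁ * R₁))) := mul_le_mul_of_nonneg_left h3 hxpow0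
      _ = _ := by ring
  -- assembly
  have hP0 : 0 ≤ x ^ η * x ^ (1 - τ) := by positivity
  have hA0 : 0 ≤ x ^ (ε₁ / 8 - ε₁) * (L₁ * M₁ * N₁ + L₁ * (Q₁ * R₁)) := by positivity
  have hB1 : x ^ (ε₁ / 8 - ε₁) * (L₁ * M₁ * N₁) ≤ x ^ (ε₁ / 8 - ε₁) * (L₁ * M₁ * N₁ + L₁ * (Q₁ * R₁)) :=
    mul_le_mul_of_nonneg_left (by linarith only [show (0 : ℝ) ≤ L₁ * (Q₁ * R₁) by positivity]) hxpow0
  have hK1 : 0 ≤ C₁ * 4 ^ (ε₁ / 8) := by positivity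
  have p1 := mul_nonneg hK1 hP0
  have p2 := mul_nonneg hCQ.le hP0
  have p3 := mul_le_mul_of_nonneg_left hB1 hK1
  calc _ ≤ tripleTS a Xm Xn ⌊2 * Q₁⌋₊ (bumpW M₁ Y) (bumpW N₁ YN) (ind (dyadic Q₁)) (dyadic L₁) (dyadic R₁) +
        tripleTS a Xm Xn ⌊2 * Q₁⌋₊ (bumpW M₁ Y - ind (dyadic M₁)) (ind (dyadic N₁)) (ind (dyadic Q₁)) (dyadic L₁) (dyadic R₁) +
        tripleTS a Xm Xn ⌊2 * Q₁⌋₊ (bumpW M₁ Y) (bumpW N₁ YN - ind (dyadic N₁)) (ind (dyadic Q₁)) (dyadic L₁) (dyadic R₁) :=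
        hsplit
    _ ≤ CQ * (96 * (x ^ (ε₁ / 8 - ε₁) * (L₁ * M₁ * N₁ + L₁ * (Q₁ * R₁))) + x ^ η * x ^ (1 - τ)) +
        96 * C₁ * 4 ^ (ε₁ / 8) * (x ^ (ε₁ / 8 - ε₁) * (L₁ * M₁ * N₁)) +
        36 * C₁ * 4 ^ (ε₁ / 8) * (x ^ (ε₁ / 8 - ε₁) * (L₁ * M₁ * N₁)) := by
        refine add_le_add (add_le_add (hmain.trans ?_) (hEM.trans hEMle)) (hEN'.trans hENle)
        exact mul_le_mul_of_nonneg_left (add_le_add hmass le_rfl) hCQ.le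
    _ ≤ (96 * CQ + 132 * C₁ * 4 ^ (ε₁ / 8)) *
        (x ^ (ε₁ / 8 - ε₁) * (L₁ * M₁ * N₁ + L₁ * (Q₁ * R₁)) + x ^ η * x ^ (1 - τ)) := by
        linarith only [p1, p2, p3]

set_option maxHeartbeats 1000000 in
/-- **Stage N.** For a dyadic block `m ∼ M₁, n ∼ N₁, l ∼ L₁, q ∼ Q₁, r ∼ R₁` (indicator weights,
`z ≤ 2`) in the regime of §14 (big block, not in the trivial regime): if `n` is long use
`stageN_long`; if the block of `n` is `{1}` use `stageN_special`; if `n` is short merge `n` into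
`l` (`deltaStarSets_nmerge_le`: at most `2x^η` sparse pieces `(l ∼ L₁)·n ⊆ (l' ∼ nL₁)`) and use
`stageN_special` on each piece. [cite: BombieriFriedlanderIwaniecActa1986, §14 pp. 244–246] -/
theorem stageN_bound {κ ε₂ ε₀ K : ℝ} (hK0 : 0 ≤ K) (hK : UniformBoundAt κ ε₂ ε₀ K) (hκ : 0 ≤ κ)
    (hε₂ : 0 ≤ ε₂) (hε₀0 : 0 ≤ ε₀) {a : ℤ} (ha : a ≠ 0) {ε₁ s t' σT em τ η : ℝ} (hε₁ : 0 < ε₁)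
    (hε₁' : 2 * ε₁ ≤ 1) (ht' : 2 * ε₁ ≤ t') (hσT : 0 ≤ σT) (hem0 : 0 ≤ em) (hsP : τ + 2 * ε₁ ≤ s)
    (hsR : τ + 9 * ε₁ / 2 ≤ s) (hexp : 2 * τ + 2 * ε₁ + 14 * (ε₂ + κ * ε₀) + t' + σT ≤ em)
    (hε₁η : ε₁ ≤ η * ε₀) (hη0 : 0 ≤ η)
    {j : ℕ} (hj : 2 ≤ j) (hjε : 2 + 2 * ε₁ ≤ j * ε₁) :
    ∃ CN : ℝ, 0 < CN ∧ ∀ (x M₁ N₁ Q₁ L₁ R₁ : ℝ),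
      1 ≤ x → 2 ≤ x ^ ε₁ → 4 ≤ x ^ (η - ε₁) → 16 ≤ x ^ (s - ε₁) → |(a : ℝ)| ≤ x → 16 * |(a : ℝ)| < x ^ s →
      4 * |(a : ℝ)| < x ^ η →
      1 ≤ M₁ → M₁ ≤ x → x ^ s ≤ 8 * M₁ → 1 / 2 ≤ N₁ → 2 * N₁ ≤ x → L₁ * M₁ * N₁ ≤ x →
      1 / 2 ≤ Q₁ → 1 / 2 ≤ L₁ → L₁ ≤ x → 1 / 2 ≤ R₁ → R₁ ≤ x → 4 * Q₁ * R₁ < x →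
      4 * x ^ (2 * ε₁) * Q₁ * R₁ / M₁ ≤ 32 * x ^ t' * (L₁ * R₁) →
      N₁ ≤ 4 * x ^ σT * (Q₁ * R₁) → L₁ * R₁ * x ^ (2 * η) ≤ x ^ (1 / 2 - em) →
      L₁ ^ (1 / 2 : ℝ) * R₁ * x ^ (2 * η) ≤ 8 * M₁ * x ^ (-em) → Q₁ ^ 2 * R₁ ≤ x →
      deltaStarSets a 2 (dyadic M₁) (dyadic N₁) (dyadic L₁) (dyadic Q₁) (dyadic R₁) ≤
        CN * (x ^ (ε₁ / 8 - ε₁) * (L₁ * M₁ * N₁ + x ^ η * (L₁ * (Q₁ * R₁))) + x ^ (2 * η) * x ^ (1 - τ)) := by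
  classical
  obtain ⟨CS, hCS, hS⟩ := stageN_special hK0 hK hκ hε₂ hε₀0 ha hε₁ hε₁' ht' hσT hem0 hsP hsR hexp hε₁η hη0 hj hjε
  obtain ⟨CL, hCL, hLg⟩ := stageN_long hK0 hK hκ hε₂ hε₀0 ha hε₁ hε₁' ht' hσT hem0 hsP hsR hexp hε₁η hη0 hj hjε
  refine ⟨24 * CS + CL, by positivity, ?_⟩
  intro x M₁ N₁ Q₁ L₁ R₁ hx hx2 hx4 hx16 hax hax16 hax4 hM₁ hM₁x hM₁s hN₁ hN₁x hxB hQ₁ hL₁ hL₁x hR₁ hR₁x hQR hHT hNU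
    h5 h6 hQ2R
  have hx0 : 0 < x := by linarith
  have hM0 : 0 < M₁ := by linarith
  have hQ0 : 0 < Q₁ := by linarith
  have hR0 : 0 < R₁ := by linarith
  have hL0 : 0 < L₁ := by linarith
  have hN0 : 0 < N₁ := by linarith
  have hxη1 : 1 ≤ x ^ η := Real.one_le_rpow hx hη0
  have hxσ1 : 1 ≤ x ^ σT := Real.one_le_rpow hx hσT
  have hx2η : x ^ (2 * η) = x ^ η * x ^ η := by rw [← Real.rpow_add hx0]; ring_nf
  have hηle : x ^ η ≤ x ^ (2 * η) := by rw [hx2η]; exact le_mul_of_one_le_left (by positivity) hxη1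
  -- `M₁ ≥ 2`
  have hM2 : 2 ≤ M₁ := by
    have h1 : x ^ (s - ε₁) ≤ x ^ s := Real.rpow_le_rpow_of_exponent_le hx (by linarith only [hε₁])
    linarith only [hx16, h1, hM₁s]
  set Y : ℝ := M₁ * x ^ (-ε₁) with hYdef
  have hY0 : 0 ≤ Y := by positivity
  set Xm : ℕ := ⌊2 * M₁ + Y⌋₊ with hXm
  have hSM : dyadic M₁ ⊆ Icc 1 Xm :=
    (dyadic_subset_Icc hM0.le).trans (Finset.Icc_subset_Icc_right (Nat.floor_mono (by linarith only [hY0])))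
  have hSQ : dyadic Q₁ ⊆ Icc 1 ⌊2 * Q₁⌋₊ := dyadic_subset_Icc hQ0.le
  have hone : ({1} : Finset ℕ) ⊆ Icc 1 4 := by
    intro n hn; rw [Finset.mem_singleton] at hn; subst hn; simp
  have hcardL : ((dyadic L₁).card : ℝ) ≤ 4 * L₁ := by
    have := card_dyadic_le_two_mul hL0.le; linarith only [this, hL₁]
  -- the (14.x) facts at the level used by the two stages (`x^η` instead of `x^{2η}`)
  have h5η : ∀ L' : ℝ, 0 ≤ L' → L' ≤ x ^ η * L₁ → L' * R₁ * x ^ η ≤ x ^ (1 / 2 - em) := by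
    intro L' hL'0 hL'
    calc L' * R₁ * x ^ η ≤ (x ^ η * L₁) * R₁ * x ^ η := by gcongr
      _ = L₁ * R₁ * x ^ (2 * η) := by rw [hx2η]; ring
      _ ≤ x ^ (1 / 2 - em) := h5
  have h6η : ∀ L' : ℝ, 0 ≤ L' → L' ^ (1 / 2 : ℝ) ≤ x ^ η * L₁ ^ (1 / 2 : ℝ) →
      L' ^ (1 / 2 : ℝ) * R₁ * x ^ η ≤ 8 * M₁ * x ^ (-em) := by
    intro L' hL'0 hL'
    calc L' ^ (1 / 2 : ℝ) * R₁ * x ^ η ≤ (x ^ η * L₁ ^ (1 / 2 : ℝ)) * R₁ * x ^ η := by gcongr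
      _ = L₁ ^ (1 / 2 : ℝ) * R₁ * x ^ (2 * η) := by rw [hx2η]; ring
      _ ≤ 8 * M₁ * x ^ (-em) := h6
  have hL₁η : L₁ ≤ x ^ η * L₁ := le_mul_of_one_le_left hL0.le hxη1
  have hL₁η' : L₁ ^ (1 / 2 : ℝ) ≤ x ^ η * L₁ ^ (1 / 2 : ℝ) := le_mul_of_one_le_left (by positivity) hxη1
  -- the generic special piece: `SL ⊆ (l ∼ L')`, `L₁ ≤ L' ≤ x^η L₁`, `#SL ≤ 4L₁`, `L' M₁ ≤ 2 L₁ M₁ N₁`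
  have hpiece : ∀ (L' : ℝ) (SL : Finset ℕ), L₁ ≤ L' → L' ≤ x ^ η * L₁ → L' ^ (1 / 2 : ℝ) ≤ x ^ η * L₁ ^ (1 / 2 : ℝ) →
      L' * M₁ * (1 / 2) ≤ x → SL ⊆ dyadic L' → (SL.card : ℝ) ≤ 4 * L₁ →
      tripleTS a Xm 4 ⌊2 * Q₁⌋₊ (ind (dyadic M₁)) (ind ({1} : Finset ℕ)) (ind (dyadic Q₁)) SL (dyadic R₁) ≤
        CS * (x ^ (ε₁ / 8 - ε₁) * (M₁ * SL.card + SL.card * (Q₁ * R₁)) + x ^ η * x ^ (1 - τ)) := by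
    intro L' SL hL'1 hL'2 hL'3 hxB' hSL hSLc
    have hL'0 : 0 < L' := by linarith
    have hL'x : L' ≤ x :=
      calc L' = L' * 2 * (1 / 2) := by ring
        _ ≤ L' * M₁ * (1 / 2) := by gcongr
        _ ≤ x := hxB'
    refine hS x M₁ (1 / 2) Q₁ L' R₁ SL hx hx2 hx4 hx16 hax hax16 hM₁ hM₁x hM₁s le_rfl hxB' hQ₁ (by linarith) hL'x
      hR₁ hR₁x hQR hSL ?_ ?_ ?_ (h5η L' hL'0.le hL'2) (h6η L' hL'0.le hL'3) hQ2R
    · -- `4 #SL ≤ 45 x / M₁`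
      have h1 : L₁ * M₁ ≤ 2 * x :=
        calc L₁ * M₁ ≤ L' * M₁ := by gcongr
          _ = 2 * (L' * M₁ * (1 / 2)) := by ring
          _ ≤ 2 * x := by linarith only [hxB']
      have h2 : L₁ ≤ 2 * x / M₁ := by rw [le_div_iff₀ hM0]; linarith only [h1]
      have h3 : 16 * (2 * x / M₁) ≤ 45 * x / M₁ := by
        rw [mul_div_assoc']; exact div_le_div_of_nonneg_right (by linarith only [hx]) hM0.le
      linarith only [hSLc, h2, h3]
    · calc 4 * x ^ (2 * ε₁) * Q₁ * R₁ / M₁ ≤ 32 * x ^ t' * (L₁ * R₁) := hHT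
        _ ≤ 32 * x ^ t' * (L' * R₁) := by gcongr
    · have hQR4 : (1 / 2 : ℝ) * (1 / 2) ≤ Q₁ * R₁ := mul_le_mul hQ₁ hR₁ (by norm_num) hQ0.le
      have h2 : (1 : ℝ) * ((1 / 2 : ℝ) * (1 / 2)) ≤ x ^ σT * (Q₁ * R₁) :=
        mul_le_mul hxσ1 hQR4 (by norm_num) (by positivity)
      linarith only [h2]
  -- case analysis on the range of `n`
  by_cases hNlt1 : N₁ < 1
  · -- the block of `n` is `{1}`
    have hdyN : dyadic N₁ = {1} := dyadic_eq_singleton_one hN₁ hNlt1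
    rw [hdyN, deltaStarSets_eq_tripleTS (le_refl (2 : ℝ)) a hSM hone hSQ (dyadic L₁) (dyadic R₁)]
    have hxB2 : L₁ * M₁ * (1 / 2) ≤ x :=
      calc L₁ * M₁ * (1 / 2) ≤ L₁ * M₁ * N₁ := by gcongr
        _ ≤ x := hxB
    have h := hpiece L₁ (dyadic L₁) le_rfl hL₁η hL₁η' hxB2 subset_rfl hcardL
    refine h.trans ?_
    have hA0 : 0 ≤ x ^ (ε₁ / 8 - ε₁) := by positivity
    have hB : x ^ (ε₁ / 8 - ε₁) * (M₁ * (dyadic L₁).card + (dyadic L₁).card * (Q₁ * R₁)) ≤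
        8 * (x ^ (ε₁ / 8 - ε₁) * (L₁ * M₁ * N₁ + x ^ η * (L₁ * (Q₁ * R₁)))) := by
      have h1 : M₁ * ((dyadic L₁).card : ℝ) ≤ M₁ * (4 * L₁) := mul_le_mul_of_nonneg_left hcardL hM0.le
      have h2 : ((dyadic L₁).card : ℝ) * (Q₁ * R₁) ≤ (4 * L₁) * (Q₁ * R₁) :=
        mul_le_mul_of_nonneg_right hcardL (by positivity)
      have h3 : M₁ * (4 * L₁) ≤ 8 * (L₁ * M₁ * N₁) :=
        calc M₁ * (4 * L₁) = 8 * (L₁ * M₁ * (1 / 2)) := by ring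
          _ ≤ 8 * (L₁ * M₁ * N₁) := by gcongr
      have h4 : (4 * L₁) * (Q₁ * R₁) ≤ 8 * (x ^ η * (L₁ * (Q₁ * R₁))) := by
        have : L₁ * (Q₁ * R₁) ≤ x ^ η * (L₁ * (Q₁ * R₁)) := le_mul_of_one_le_left (by positivity) hxη1
        have h0 : 0 ≤ L₁ * (Q₁ * R₁) := by positivity
        linarith only [this, h0]
      calc _ ≤ x ^ (ε₁ / 8 - ε₁) * (8 * (L₁ * M₁ * N₁ + x ^ η * (L₁ * (Q₁ * R₁)))) :=
            mul_le_mul_of_nonneg_left (by linarith only [h1, h2, h3, h4]) hA0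
        _ = _ := by ring
    have hP : x ^ η * x ^ (1 - τ) ≤ x ^ (2 * η) * x ^ (1 - τ) := mul_le_mul_of_nonneg_right hηle (by positivity)
    have hP0 : 0 ≤ x ^ (2 * η) * x ^ (1 - τ) := by positivity
    have hE0 : 0 ≤ x ^ (ε₁ / 8 - ε₁) * (L₁ * M₁ * N₁ + x ^ η * (L₁ * (Q₁ * R₁))) := by positivity
    have p1 := mul_le_mul_of_nonneg_left (add_le_add hB hP) hCS.le
    have p2 := mul_nonneg hCL.le (add_nonneg hE0 hP0)
    have p3 := mul_nonneg hCS.le hP0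
    have p4 := mul_nonneg hCS.le hE0
    linarith only [h, p1, p2, p3, p4]
  push Not at hNlt1
  by_cases hNlong : x ^ η ≤ 2 * N₁
  · -- long `n`
    have hSN : dyadic N₁ ⊆ Icc 1 ⌊4 * (2 * N₁)⌋₊ :=
      (dyadic_subset_Icc hN0.le).trans (Finset.Icc_subset_Icc_right (Nat.floor_mono (by linarith only [hN₁])))
    rw [deltaStarSets_eq_tripleTS (le_refl (2 : ℝ)) a hSM hSN hSQ (dyadic L₁) (dyadic R₁)]
    have h := hLg x M₁ N₁ Q₁ L₁ R₁ hx hx2 hx4 hx16 hax hax16 hax4 hM₁ hM₁x hM₁s hNlong hN₁x hxB hQ₁ hL₁ hL₁x hR₁ hR₁x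
      hQR hHT hNU (h5η L₁ hL0.le hL₁η) (h6η L₁ hL0.le hL₁η') hQ2R
    refine h.trans ?_
    have hA0 : 0 ≤ x ^ (ε₁ / 8 - ε₁) := by positivity
    have hB : x ^ (ε₁ / 8 - ε₁) * (L₁ * M₁ * N₁ + L₁ * (Q₁ * R₁)) ≤
        x ^ (ε₁ / 8 - ε₁) * (L₁ * M₁ * N₁ + x ^ η * (L₁ * (Q₁ * R₁))) :=
      mul_le_mul_of_nonneg_left (by
        have : L₁ * (Q₁ * R₁) ≤ x ^ η * (L₁ * (Q₁ * R₁)) := le_mul_of_one_le_left (by positivity) hxη1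
        linarith only [this]) hA0
    have hP : x ^ η * x ^ (1 - τ) ≤ x ^ (2 * η) * x ^ (1 - τ) := mul_le_mul_of_nonneg_right hηle (by positivity)
    have hP0 : 0 ≤ x ^ (2 * η) * x ^ (1 - τ) := by positivity
    have hE0 : 0 ≤ x ^ (ε₁ / 8 - ε₁) * (L₁ * M₁ * N₁ + x ^ η * (L₁ * (Q₁ * R₁))) := by positivity
    have p1 := mul_le_mul_of_nonneg_left (add_le_add hB hP) hCL.le
    have p2 := mul_nonneg hCS.le (add_nonneg hE0 hP0)
    linarith only [p1, p2]
  · -- short `n`: merge into `l`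
    push Not at hNlong
    have hn0 : ∀ n ∈ dyadic N₁, 0 < n := fun n hn => pos_of_mem_dyadic hN0.le hn
    refine (deltaStarSets_nmerge_le (le_refl (2 : ℝ)) a (dyadic M₁) (dyadic N₁) (dyadic L₁) (dyadic Q₁)
      (dyadic R₁) hn0).trans ?_
    have hterm : ∀ n ∈ dyadic N₁,
        deltaStarSets a 2 (dyadic M₁) {1} ((dyadic L₁).image (fun l => l * n)) (dyadic Q₁) (dyadic R₁) ≤
          CS * (x ^ (ε₁ / 8 - ε₁) * (M₁ * (4 * L₁) + (4 * L₁) * (Q₁ * R₁)) + x ^ η * x ^ (1 - τ)) := by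
      intro n hn
      have hn' := (mem_dyadic hN0.le).1 hn
      have hnpos : 0 < n := hn0 n hn
      have hn1 : (1 : ℝ) ≤ n := by exact_mod_cast hnpos
      have hnη : (n : ℝ) ≤ x ^ η := by linarith only [hn'.2, hNlong]
      set SL : Finset ℕ := (dyadic L₁).image (fun l => l * n) with hSLdef
      have hSLsub : SL ⊆ dyadic ((n : ℝ) * L₁) := image_mul_right_dyadic_subset hL0.le hnpos
      have hSLc : (SL.card : ℝ) ≤ 4 * L₁ :=
        le_trans (by exact_mod_cast Finset.card_image_le) hcardL
      rw [deltaStarSets_eq_tripleTS (le_refl (2 : ℝ)) a hSM hone hSQ SL (dyadic R₁)]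
      have h := hpiece ((n : ℝ) * L₁) SL (le_mul_of_one_le_left hL0.le hn1)
        (mul_le_mul_of_nonneg_right hnη hL0.le) ?_ ?_ hSLsub hSLc
      · refine h.trans (mul_le_mul_of_nonneg_left (add_le_add (mul_le_mul_of_nonneg_left ?_ (by positivity)) le_rfl)
          hCS.le)
        have h1 : M₁ * (SL.card : ℝ) ≤ M₁ * (4 * L₁) := mul_le_mul_of_nonneg_left hSLc hM0.le
        have h2 : (SL.card : ℝ) * (Q₁ * R₁) ≤ (4 * L₁) * (Q₁ * R₁) := mul_le_mul_of_nonneg_right hSLc (by positivity)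
        linarith only [h1, h2]
      · -- `(nL₁)^{1/2} ≤ x^η L₁^{1/2}`
        rw [Real.mul_rpow (by positivity) hL0.le]
        refine mul_le_mul_of_nonneg_right ?_ (by positivity)
        calc (n : ℝ) ^ (1 / 2 : ℝ) ≤ (n : ℝ) ^ (1 : ℝ) := Real.rpow_le_rpow_of_exponent_le hn1 (by norm_num)
          _ = n := Real.rpow_one _
          _ ≤ x ^ η := hnη
      · -- `nL₁ M₁ / 2 ≤ x`
        calc (n : ℝ) * L₁ * M₁ * (1 / 2) ≤ (2 * N₁) * L₁ * M₁ * (1 / 2) := by gcongr; exact hn'.2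
          _ = L₁ * M₁ * N₁ := by ring
          _ ≤ x := hxB
    have hcardN : ((dyadic N₁).card : ℝ) ≤ 4 * N₁ := by
      have := card_dyadic_le_two_mul hN0.le; linarith only [this, hNlt1]
    have hcardN' : ((dyadic N₁).card : ℝ) ≤ 2 * x ^ η := by
      have := card_dyadic_le_two_mul hN0.le; linarith only [this, hNlong, hxη1]
    calc ∑ n ∈ dyadic N₁, deltaStarSets a 2 (dyadic M₁) {1} ((dyadic L₁).image (fun l => l * n)) (dyadic Q₁) (dyadic R₁)
        ≤ ∑ _n ∈ dyadic N₁, CS * (x ^ (ε₁ / 8 - ε₁) * (M₁ * (4 * L₁) + (4 * L₁) * (Q₁ * R₁)) + x ^ η * x ^ (1 - τ)) :=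
          Finset.sum_le_sum hterm
      _ = ((dyadic N₁).card : ℝ) * (CS * (x ^ (ε₁ / 8 - ε₁) * (M₁ * (4 * L₁) + (4 * L₁) * (Q₁ * R₁)))) +
            ((dyadic N₁).card : ℝ) * (CS * (x ^ η * x ^ (1 - τ))) := by
          rw [Finset.sum_const, nsmul_eq_mul]; ring
      _ ≤ (4 * N₁) * (CS * (x ^ (ε₁ / 8 - ε₁) * (M₁ * (4 * L₁) + (4 * L₁) * (Q₁ * R₁)))) +
            (2 * x ^ η) * (CS * (x ^ η * x ^ (1 - τ))) := by
          gcongr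
      _ = CS * (16 * (x ^ (ε₁ / 8 - ε₁) * (L₁ * M₁ * N₁ + N₁ * (L₁ * (Q₁ * R₁)))) +
            2 * ((x ^ η * x ^ η) * x ^ (1 - τ))) := by ring
      _ ≤ CS * (16 * (x ^ (ε₁ / 8 - ε₁) * (L₁ * M₁ * N₁ + x ^ η * (L₁ * (Q₁ * R₁)))) +
            2 * (x ^ (2 * η) * x ^ (1 - τ))) := by
          rw [← hx2η]
          refine mul_le_mul_of_nonneg_left (add_le_add ?_ le_rfl) hCS.le
          refine mul_le_mul_of_nonneg_left (mul_le_mul_of_nonneg_left ?_ (by positivity)) (by norm_num)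
          have : N₁ * (L₁ * (Q₁ * R₁)) ≤ x ^ η * (L₁ * (Q₁ * R₁)) :=
            mul_le_mul_of_nonneg_right (by linarith only [hNlong, hNlt1]) (by positivity)
          linarith only [this]
      _ ≤ (24 * CS + CL) * (x ^ (ε₁ / 8 - ε₁) * (L₁ * M₁ * N₁ + x ^ η * (L₁ * (Q₁ * R₁))) +
            x ^ (2 * η) * x ^ (1 - τ)) := by
          have hP0 : 0 ≤ x ^ (2 * η) * x ^ (1 - τ) := by positivity
          have hE0 : 0 ≤ x ^ (ε₁ / 8 - ε₁) * (L₁ * M₁ * N₁ + x ^ η * (L₁ * (Q₁ * R₁))) := by positivity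
          have p1 := mul_nonneg hCS.le hE0
          have p2 := mul_nonneg hCS.le hP0
          have p3 := mul_nonneg hCL.le (add_nonneg hE0 hP0)
          linarith only [p1, p2, p3]

/-! ### Stage B: a dyadic block (small / trivial regime / Stage N) -/

/-- **A dyadic block is bounded by eight initial-range sums** (`deltaStarSets_Ioc_le` for dyadic
sets). [cite: BombieriFriedlanderIwaniecActa1986, §14 p. 244] -/
theorem deltaStarSets_dyadic_le_eight (a : ℤ) (z : ℝ) {M₁ N₁ L₁ Q₁ R₁ : ℝ} (hM : 0 ≤ M₁) (hN : 0 ≤ N₁)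
    (hL : 0 ≤ L₁) (hQ : 0 ≤ Q₁) (hR : 0 ≤ R₁) :
    deltaStarSets a z (dyadic M₁) (dyadic N₁) (dyadic L₁) (dyadic Q₁) (dyadic R₁) ≤
      deltaStar a z (2 * M₁) (2 * N₁) (2 * L₁) (2 * Q₁) (2 * R₁) + deltaStar a z (2 * M₁) (2 * N₁) (2 * L₁) Q₁ (2 * R₁) +
      (deltaStar a z (2 * M₁) N₁ (2 * L₁) (2 * Q₁) (2 * R₁) + deltaStar a z (2 * M₁) N₁ (2 * L₁) Q₁ (2 * R₁)) +
      (deltaStar a z M₁ (2 * N₁) (2 * L₁) (2 * Q₁) (2 * R₁) + deltaStar a z M₁ (2 * N₁) (2 * L₁) Q₁ (2 * R₁) +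
      (deltaStar a z M₁ N₁ (2 * L₁) (2 * Q₁) (2 * R₁) + deltaStar a z M₁ N₁ (2 * L₁) Q₁ (2 * R₁))) := by
  rw [dyadic_eq_Ioc hM, dyadic_eq_Ioc hN, dyadic_eq_Ioc hL, dyadic_eq_Ioc hQ, dyadic_eq_Ioc hR]
  exact deltaStarSets_Ioc_le a z (by linarith) (by linarith) (by linarith) L₁ (2 * L₁) R₁ (2 * R₁)

/-- `Δ* = 0` when the range of `q` is empty (`Q < 1`). [folklore] -/
theorem deltaStar_eq_zero_of_Q_lt_one (a : ℤ) (z M N L : ℝ) {Q : ℝ} (hQ : Q < 1) (R : ℝ) :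
    deltaStar a z M N L Q R = 0 := by
  rw [deltaStar_eq_deltaStarSets]
  have hQ0 : ⌊Q⌋₊ = 0 := Nat.floor_eq_zero.2 hQ
  unfold deltaStarSets
  refine Finset.sum_eq_zero fun r _ => Finset.sum_eq_zero fun l _ => ?_
  unfold setQSum
  rw [hQ0]
  simp

/-- `(1 + log t)^k ≤ C x^δ` for naturals `t ≤ x` (including `t = 0`). [folklore] -/
theorem one_add_log_natCast_pow_le {δ : ℝ} (hδ : 0 < δ) (k : ℕ) :
    ∃ C : ℝ, 0 < C ∧ ∀ (x : ℝ) (t : ℕ), 1 ≤ x → (t : ℝ) ≤ x → (1 + Real.log (t : ℝ)) ^ k ≤ C * x ^ δ := by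
  obtain ⟨C, hC, h⟩ := one_add_log_pow_le_of_le hδ k
  refine ⟨C, hC, fun x t hx htx => ?_⟩
  rcases Nat.eq_zero_or_pos t with h0 | hpos
  · have h1 := h x 1 hx le_rfl (by linarith)
    rw [Real.log_one] at h1
    rw [h0]; simpa using h1
  · exact h x t hx (by exact_mod_cast hpos) (by linarith)

/-- **The uniform trivial bound for one initial-range term in the small-block regime**:
if `⌊L⌋⌊M⌋⌊N⌋ ≤ x^{1−σ}`, `|a| + 2 ≤ x^{1/2}`, `⌊Q⌋⌊R⌋ ≤ x^{3/4}`, `⌊Q⌋, ⌊R⌋ ≤ x`, `σ ≤ 1/4`, then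
`Δ*(M,N,L,Q,R) ≤ C_{a,σ} x^{1−σ/2}`. [cite: BombieriFriedlanderIwaniecActa1986, §14 p. 244] -/
theorem deltaStar_small_le (a : ℤ) {σ₁ : ℝ} (hσ : 0 < σ₁) (hσ4 : σ₁ ≤ 1 / 4) :
    ∃ C : ℝ, 0 < C ∧ ∀ (z M N L Q R x : ℝ), 1 ≤ x → |(a : ℝ)| + 2 ≤ x ^ (1 / 2 : ℝ) →
      ((⌊L⌋₊ * ⌊M⌋₊ * ⌊N⌋₊ : ℕ) : ℝ) ≤ x ^ (1 - σ₁) → ((⌊Q⌋₊ : ℕ) : ℝ) * ⌊R⌋₊ ≤ x ^ (3 / 4 : ℝ) →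
      ((⌊Q⌋₊ : ℕ) : ℝ) ≤ x → ((⌊R⌋₊ : ℕ) : ℝ) ≤ x →
      deltaStar a z M N L Q R ≤ C * x ^ (1 - σ₁ / 2) := by
  obtain ⟨C₀, hC₀, h₀⟩ := deltaStar_uniform_trivial
  obtain ⟨Cℓ, hCℓ, hℓ⟩ := one_add_log_pow_le_of_le (δ := σ₁ / 4) (by positivity) 32
  obtain ⟨Cℓ', hCℓ', hℓ'⟩ := one_add_log_natCast_pow_le (δ := σ₁ / 4) (by positivity) 2
  set A : ℝ := (σ 0 a.natAbs : ℝ) ^ 2 with hA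
  have hA0 : 0 ≤ A := by positivity
  refine ⟨2 * C₀ * Cℓ + A + Cℓ' ^ 2, by positivity, ?_⟩
  intro z M N L Q R x hx hax hP hQR hQx hRx
  have hx0 : 0 < x := by linarith
  set P : ℝ := ((⌊L⌋₊ * ⌊M⌋₊ * ⌊N⌋₊ : ℕ) : ℝ) with hPdef
  have hP0 : 0 ≤ P := Nat.cast_nonneg _
  have hx1σ : x ^ (1 - σ₁) ≤ x := by
    calc x ^ (1 - σ₁) ≤ x ^ (1 : ℝ) := Real.rpow_le_rpow_of_exponent_le hx (by linarith)
      _ = x := Real.rpow_one x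
  have hxhalf : x ^ (1 / 2 : ℝ) ≤ x ^ (1 - σ₁) := Real.rpow_le_rpow_of_exponent_le hx (by linarith)
  -- the logarithm of `P + |a| + 2`
  have hPa : P + |(a : ℝ)| + 2 ≤ 2 * x ^ (1 - σ₁) := by linarith only [hP, hax, hxhalf]
  have hPa1 : 1 ≤ P + |(a : ℝ)| + 2 := by linarith only [hP0, abs_nonneg (a : ℝ)]
  have hPa4 : P + |(a : ℝ)| + 2 ≤ 4 * x := by linarith only [hPa, hx1σ, hx]
  have hlog1 : Real.log (P + |(a : ℝ)| + 2) ^ 32 ≤ Cℓ * x ^ (σ₁ / 4) := by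
    have h0 : 0 ≤ Real.log (P + |(a : ℝ)| + 2) := Real.log_nonneg hPa1
    calc Real.log (P + |(a : ℝ)| + 2) ^ 32 ≤ (1 + Real.log (P + |(a : ℝ)| + 2)) ^ 32 :=
          pow_le_pow_left₀ h0 (by linarith) 32
      _ ≤ Cℓ * x ^ (σ₁ / 4) := hℓ x _ hx hPa1 hPa4
  have hq := hℓ' x ⌊Q⌋₊ hx hQx
  have hr := hℓ' x ⌊R⌋₊ hx hRx
  have hmain := h₀ a z M N L Q R
  rw [← hPdef] at hmain
  -- term 1
  have h1 : C₀ * (P + |(a : ℝ)| + 2) * Real.log (P + |(a : ℝ)| + 2) ^ 32 ≤ 2 * C₀ * Cℓ * x ^ (1 - σ₁ / 2) := by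
    have hx3 : x ^ (1 - σ₁) * x ^ (σ₁ / 4) ≤ x ^ (1 - σ₁ / 2) := by
      rw [← Real.rpow_add hx0]; exact Real.rpow_le_rpow_of_exponent_le hx (by linarith)
    calc C₀ * (P + |(a : ℝ)| + 2) * Real.log (P + |(a : ℝ)| + 2) ^ 32
        ≤ C₀ * (2 * x ^ (1 - σ₁)) * (Cℓ * x ^ (σ₁ / 4)) := by
          refine mul_le_mul (mul_le_mul_of_nonneg_left hPa hC₀.le) hlog1 (pow_nonneg (Real.log_nonneg hPa1) 32)
            (by positivity)
      _ = 2 * C₀ * Cℓ * (x ^ (1 - σ₁) * x ^ (σ₁ / 4)) := by ring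
      _ ≤ 2 * C₀ * Cℓ * x ^ (1 - σ₁ / 2) := mul_le_mul_of_nonneg_left hx3 (by positivity)
  -- term 2
  have h2 : A * ⌊Q⌋₊ * ⌊R⌋₊ ≤ A * x ^ (1 - σ₁ / 2) := by
    rw [mul_assoc]
    refine mul_le_mul_of_nonneg_left (hQR.trans ?_) hA0
    exact Real.rpow_le_rpow_of_exponent_le hx (by linarith)
  -- term 3
  have h3 : P * (1 + Real.log ⌊Q⌋₊) ^ 2 * (1 + Real.log ⌊R⌋₊) ^ 2 ≤ Cℓ' ^ 2 * x ^ (1 - σ₁ / 2) := by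
    have hx3 : x ^ (1 - σ₁) * x ^ (σ₁ / 4) * x ^ (σ₁ / 4) ≤ x ^ (1 - σ₁ / 2) := by
      rw [← Real.rpow_add hx0, ← Real.rpow_add hx0]; exact Real.rpow_le_rpow_of_exponent_le hx (by linarith)
    have hl0 : 0 ≤ (1 + Real.log ((⌊Q⌋₊ : ℕ) : ℝ)) ^ 2 := sq_nonneg _
    calc P * (1 + Real.log ⌊Q⌋₊) ^ 2 * (1 + Real.log ⌊R⌋₊) ^ 2
        ≤ x ^ (1 - σ₁) * (Cℓ' * x ^ (σ₁ / 4)) * (Cℓ' * x ^ (σ₁ / 4)) := by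
          refine mul_le_mul (mul_le_mul hP hq hl0 (by positivity)) hr (sq_nonneg _) (by positivity)
      _ = Cℓ' ^ 2 * (x ^ (1 - σ₁) * x ^ (σ₁ / 4) * x ^ (σ₁ / 4)) := by ring
      _ ≤ Cℓ' ^ 2 * x ^ (1 - σ₁ / 2) := mul_le_mul_of_nonneg_left hx3 (by positivity)
  calc deltaStar a z M N L Q R ≤ _ := hmain
    _ ≤ 2 * C₀ * Cℓ * x ^ (1 - σ₁ / 2) + A * x ^ (1 - σ₁ / 2) + Cℓ' ^ 2 * x ^ (1 - σ₁ / 2) :=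
        add_le_add (add_le_add h1 h2) h3
    _ = (2 * C₀ * Cℓ + A + Cℓ' ^ 2) * x ^ (1 - σ₁ / 2) := by ring

/-- **The trivial regime for one initial-range term**: if `L'M'N' = x_T ∈ [x^{1/2}, 8x]`, `x ≥ 8`,
`1 ≤ Q' ≤ x_T`, `1 ≤ R' ≤ x_T`, `x^{σ} Q'R' ≤ N'`, then `Δ* ≤ C x^{1−σ/4}`.
[cite: BombieriFriedlanderIwaniecActa1986, §14 p. 246] -/
theorem deltaStar_trivreg_le {σ₁ : ℝ} (hσ : 0 < σ₁) (hσ1 : σ₁ ≤ 1) :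
    ∃ C : ℝ, 0 < C ∧ ∀ (a : ℤ) (M N L Q R x : ℝ), 8 ≤ x → 0 ≤ M → 0 ≤ L → 1 ≤ Q → Q ≤ L * M * N →
      1 ≤ R → R ≤ L * M * N → 0 < N → x ^ (1 / 2 : ℝ) ≤ L * M * N → L * M * N ≤ 8 * x →
      x ^ σ₁ * (Q * R) ≤ N →
      deltaStar a 2 M N L Q R ≤ C * x ^ (1 - σ₁ / 4) := by
  obtain ⟨C₀, hC₀, h₀⟩ := deltaStar_trivial_regime
  obtain ⟨Cℓ, hCℓ, hℓ⟩ := one_add_log_pow_le_of_le (δ := σ₁ / 4) (by positivity) 16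
  refine ⟨C₀ * 8 * (Cℓ * 2 ^ (σ₁ / 4)), by positivity, ?_⟩
  intro a M N L Q R x hx8 hM hL hQ hQx hR hRx hN hlo hhi hreg
  have hx : 1 ≤ x := by linarith
  have hx0 : 0 < x := by linarith
  set xT : ℝ := L * M * N with hxT
  have hxT1 : 1 ≤ xT := le_trans (Real.one_le_rpow hx (by norm_num)) hlo
  have hxT0 : 0 < xT := by linarith
  -- `x_T^{σ/2} QR ≤ N`
  have hreg' : xT ^ (σ₁ / 2) * (Q * R) ≤ N := by
    have h1 : xT ^ (σ₁ / 2) ≤ (8 * x) ^ (σ₁ / 2) := Real.rpow_le_rpow hxT0.le hhi (by positivity)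
    have h2 : (8 * x) ^ (σ₁ / 2) ≤ x ^ σ₁ := by
      rw [Real.mul_rpow (by norm_num) hx0.le]
      have h8 : (8 : ℝ) ^ (σ₁ / 2) ≤ x ^ (σ₁ / 2) := Real.rpow_le_rpow (by norm_num) hx8 (by positivity)
      calc (8 : ℝ) ^ (σ₁ / 2) * x ^ (σ₁ / 2) ≤ x ^ (σ₁ / 2) * x ^ (σ₁ / 2) :=
            mul_le_mul_of_nonneg_right h8 (by positivity)
        _ = x ^ σ₁ := by rw [← Real.rpow_add hx0]; ring_nf
    calc xT ^ (σ₁ / 2) * (Q * R) ≤ x ^ σ₁ * (Q * R) := mul_le_mul_of_nonneg_right (h1.trans h2) (by positivity)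
      _ ≤ N := hreg
  have h := h₀ 2 le_rfl a (σ₁ / 2) xT M N L Q R hxT1 hM hL hQ hQx hR hRx hN rfl hreg'
  refine h.trans ?_
  -- `x_T^{1-σ/2} ≤ 8 x^{1-σ/2}` and the logarithm
  have hpow : xT ^ (1 - σ₁ / 2) ≤ 8 * x ^ (1 - σ₁ / 2) := by
    calc xT ^ (1 - σ₁ / 2) ≤ (8 * x) ^ (1 - σ₁ / 2) := Real.rpow_le_rpow hxT0.le hhi (by linarith)
      _ = 8 ^ (1 - σ₁ / 2) * x ^ (1 - σ₁ / 2) := Real.mul_rpow (by norm_num) hx0.le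
      _ ≤ 8 * x ^ (1 - σ₁ / 2) := by
          refine mul_le_mul_of_nonneg_right ?_ (by positivity)
          calc (8 : ℝ) ^ (1 - σ₁ / 2) ≤ 8 ^ (1 : ℝ) := Real.rpow_le_rpow_of_exponent_le (by norm_num) (by linarith)
            _ = 8 := Real.rpow_one 8
  have hlog : (1 + Real.log xT) ^ 16 ≤ Cℓ * 2 ^ (σ₁ / 4) * x ^ (σ₁ / 4) := by
    have h1 := hℓ (2 * x) xT (by linarith) hxT1 (by linarith)
    rw [Real.mul_rpow (by norm_num) hx0.le] at h1
    linarith only [h1]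
  have hlog0 : 0 ≤ (1 + Real.log xT) ^ 16 := pow_nonneg (by linarith [Real.log_nonneg hxT1]) 16
  calc C₀ * xT ^ (1 - σ₁ / 2) * (1 + Real.log xT) ^ 16
      ≤ C₀ * (8 * x ^ (1 - σ₁ / 2)) * (Cℓ * 2 ^ (σ₁ / 4) * x ^ (σ₁ / 4)) :=
        mul_le_mul (mul_le_mul_of_nonneg_left hpow hC₀.le) hlog hlog0 (by positivity)
    _ = C₀ * 8 * (Cℓ * 2 ^ (σ₁ / 4)) * (x ^ (1 - σ₁ / 2) * x ^ (σ₁ / 4)) := by ring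
    _ = C₀ * 8 * (Cℓ * 2 ^ (σ₁ / 4)) * x ^ (1 - σ₁ / 4) := by rw [← Real.rpow_add hx0]; ring_nf

/-- `dyadic t = ∅` for `0 ≤ t < 1/2`. [folklore] -/
theorem dyadic_eq_empty {t : ℝ} (h0 : 0 ≤ t) (h : t < 1 / 2) : dyadic t = ∅ := by
  ext m
  simp only [Finset.notMem_empty, iff_false]
  intro hm
  have hm' := (mem_dyadic h0).1 hm
  have h1 : (m : ℝ) < 1 := by linarith
  have h2 : (0 : ℝ) < m := by linarith
  have : m < 1 := by exact_mod_cast h1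
  have : 0 < m := by exact_mod_cast h2
  omega

/-- `Δ_sets = 0` when one of the five sets is empty. [folklore] -/
theorem deltaStarSets_eq_zero_of_empty (a : ℤ) (z : ℝ) (SM SN SL SQ SR : Finset ℕ)
    (h : SM = ∅ ∨ SN = ∅ ∨ SL = ∅ ∨ SQ = ∅ ∨ SR = ∅) : deltaStarSets a z SM SN SL SQ SR = 0 := by
  unfold deltaStarSets
  rcases h with h | h | h | h | h
  · refine Finset.sum_eq_zero fun r _ => Finset.sum_eq_zero fun l _ => ?_
    unfold setQSum setCongrCount setCoprimeCount; rw [h]; simp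
  · refine Finset.sum_eq_zero fun r _ => Finset.sum_eq_zero fun l _ => ?_
    unfold setQSum setCongrCount setCoprimeCount; rw [h]; simp
  · refine Finset.sum_eq_zero fun r _ => ?_
    rw [h]; simp
  · refine Finset.sum_eq_zero fun r _ => Finset.sum_eq_zero fun l _ => ?_
    unfold setQSum; rw [h]; simp
  · rw [h]; simp

/-- `QR ≤ x^{3/4}` from `Q²R ≤ x`, `R ≤ x^{1/2}`. [folklore] -/
theorem mul_le_rpow_three_quarters {Q R x : ℝ} (hQ : 0 ≤ Q) (hR : 0 ≤ R) (hx : 0 ≤ x) (hQ2R : Q ^ 2 * R ≤ x)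
    (hRx : R ≤ x ^ (1 / 2 : ℝ)) : Q * R ≤ x ^ (3 / 4 : ℝ) := by
  have hsq : (Q * R) ^ 2 ≤ (x ^ (3 / 4 : ℝ)) ^ 2 := by
    calc (Q * R) ^ 2 = Q ^ 2 * R * R := by ring
      _ ≤ x * x ^ (1 / 2 : ℝ) := mul_le_mul hQ2R hRx hR hx
      _ = (x ^ (3 / 4 : ℝ)) ^ 2 := by
          rw [← Real.rpow_natCast (x ^ (3 / 4 : ℝ)) 2, ← Real.rpow_mul hx]
          nth_rewrite 1 [← Real.rpow_one x]
          rw [← Real.rpow_add' hx (by norm_num)]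
          norm_num
  exact (pow_le_pow_iff_left₀ (mul_nonneg hQ hR) (by positivity) two_ne_zero).1 hsq

set_option maxHeartbeats 1600000 in
/-- **Stage B: one dyadic block of the decomposition of `Δ*(M,N,L,Q,R)`** (initial ranges with
`LMN = x` in the regime `Q²R ≤ x`, (14.5)–(14.6) at level `e`, `N < x^σ QR`): a block
`m ∼ M₁ ≤ M/2, …` is either empty, or small (`8L₁M₁N₁ < x^{1−σ}`: uniform trivial bound), or in the
trivial regime (`N₁ ≥ 4x^σ Q₁R₁`), or is handled by Stage N; in all cases `Δ_block ≤ C_B x^{1−ε₁/2}`.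
[cite: BombieriFriedlanderIwaniecActa1986, §14 pp. 244–246] -/
theorem block_bound {κ ε₂ ε₀ K : ℝ} (hK0 : 0 ≤ K) (hK : UniformBoundAt κ ε₂ ε₀ K) (hκ : 0 ≤ κ)
    (hε₂ : 0 ≤ ε₂) (hε₀0 : 0 ≤ ε₀) {a : ℤ} (ha : a ≠ 0) {ε₁ s t' σT em τ η e σ₁ : ℝ} (hε₁ : 0 < ε₁)
    (hε₁' : 2 * ε₁ ≤ 1) (hσ0 : 0 < σ₁) (hσ4 : σ₁ ≤ 1 / 4) (he2 : e ≤ 1 / 2)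
    (hs : s = e - σ₁) (ht'2 : t' = 2 * ε₁ + 2 * σ₁) (hσT : σT = σ₁) (hem0 : 0 ≤ em) (hem1 : em ≤ e - σ₁ - 2 * η)
    (hsP : τ + 2 * ε₁ ≤ s) (hsR : τ + 9 * ε₁ / 2 ≤ s) (hexp : 2 * τ + 2 * ε₁ + 14 * (ε₂ + κ * ε₀) + t' + σT ≤ em)
    (hε₁η : ε₁ ≤ η * ε₀) (hη0 : 0 ≤ η) (hτη : 2 * η + ε₁ / 2 ≤ τ) (hε₁σ : ε₁ ≤ σ₁ / 2)
    {j : ℕ} (hj : 2 ≤ j) (hjε : 2 + 2 * ε₁ ≤ j * ε₁) :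
    ∃ CB : ℝ, 0 < CB ∧ ∀ (x M N L Q R M₁ N₁ L₁ Q₁ R₁ : ℝ),
      8 ≤ x → 2 ≤ x ^ ε₁ → 4 ≤ x ^ (η - ε₁) → 16 ≤ x ^ (s - ε₁) → |(a : ℝ)| + 2 ≤ x ^ (1 / 2 : ℝ) →
      16 * |(a : ℝ)| < x ^ s → 4 * |(a : ℝ)| < x ^ η → 8 * x ^ (1 / 2 : ℝ) ≤ x ^ (1 - σ₁) →
      1 ≤ M → 1 ≤ N → 1 ≤ L → 1 ≤ Q → 1 ≤ R → L * M * N = x → Q ^ 2 * R ≤ x →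
      L * R ≤ x ^ (1 / 2 - e) → L ^ (1 / 2 : ℝ) * R ≤ M * x ^ (-e) → N < x ^ σ₁ * (Q * R) →
      0 < M₁ → 2 * M₁ ≤ M → 0 < N₁ → 2 * N₁ ≤ N → 0 < L₁ → 2 * L₁ ≤ L → 0 < Q₁ → 2 * Q₁ ≤ Q →
      0 < R₁ → 2 * R₁ ≤ R →
      deltaStarSets a 2 (dyadic M₁) (dyadic N₁) (dyadic L₁) (dyadic Q₁) (dyadic R₁) ≤ CB * x ^ (1 - ε₁ / 2) := by
  have ht' : 2 * ε₁ ≤ t' := by rw [ht'2]; linarith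
  have hσT0 : 0 ≤ σT := by rw [hσT]; exact hσ0.le
  obtain ⟨CN, hCN, hNst⟩ := stageN_bound hK0 hK hκ hε₂ hε₀0 ha hε₁ hε₁' ht' hσT0 hem0 hsP hsR hexp hε₁η hη0 hj hjε
  obtain ⟨Csm, hCsm, hsmall⟩ := deltaStar_small_le a hσ0 hσ4
  obtain ⟨Ctr, hCtr, htriv⟩ := deltaStar_trivreg_le hσ0 (by linarith)
  refine ⟨8 * Csm + 8 * Ctr + 3 * CN, by positivity, ?_⟩
  intro x M N L Q R M₁ N₁ L₁ Q₁ R₁ hx8 hx2 hx4 hx16 hax2 hax16 hax4 hx8half hM hN hL hQ hR hLMN hQ2R hLR hL6 hNQR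
    hM₁0 hM₁M hN₁0 hN₁N hL₁0 hL₁L hQ₁0 hQ₁Q hR₁0 hR₁R
  have hx : 1 ≤ x := by linarith
  have hx0 : 0 < x := by linarith
  have hCB0 : 0 ≤ (8 * Csm + 8 * Ctr + 3 * CN) * x ^ (1 - ε₁ / 2) := by positivity
  have hxe1 : 0 ≤ x ^ (1 - ε₁ / 2) := by positivity
  -- global consequences
  have hax : |(a : ℝ)| ≤ x := by
    have : x ^ (1 / 2 : ℝ) ≤ x := by
      calc x ^ (1 / 2 : ℝ) ≤ x ^ (1 : ℝ) := Real.rpow_le_rpow_of_exponent_le hx (by norm_num)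
        _ = x := Real.rpow_one x
    linarith only [hax2, this, abs_nonneg (a : ℝ)]
  have hMx : M ≤ x := by
    calc M = 1 * M * 1 := by ring
      _ ≤ L * M * N := by gcongr
      _ = x := hLMN
  have hNx : N ≤ x := by
    calc N = 1 * 1 * N := by ring
      _ ≤ L * M * N := by gcongr
      _ = x := hLMN
  have hLx : L ≤ x := by
    calc L = L * 1 * 1 := by ring
      _ ≤ L * M * N := by gcongr
      _ = x := hLMN
  have hRhalf : R ≤ x ^ (1 / 2 : ℝ) := by
    calc R = 1 * R := (one_mul R).symm
      _ ≤ L * R := by gcongr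
      _ ≤ x ^ (1 / 2 - e) := hLR
      _ ≤ x ^ (1 / 2 : ℝ) := Real.rpow_le_rpow_of_exponent_le hx (by linarith)
  have hQhalf : Q ≤ x ^ (1 / 2 : ℝ) := by
    have hsq : Q ^ 2 ≤ (x ^ (1 / 2 : ℝ)) ^ 2 := by
      calc Q ^ 2 = Q ^ 2 * 1 := (mul_one _).symm
        _ ≤ Q ^ 2 * R := by gcongr
        _ ≤ x := hQ2R
        _ = (x ^ (1 / 2 : ℝ)) ^ 2 := by
            rw [← Real.rpow_natCast (x ^ (1 / 2 : ℝ)) 2, ← Real.rpow_mul hx0.le]; norm_num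
    exact (pow_le_pow_iff_left₀ (by linarith) (by positivity) two_ne_zero).1 hsq
  have hxhalfx : x ^ (1 / 2 : ℝ) ≤ x := by
    calc x ^ (1 / 2 : ℝ) ≤ x ^ (1 : ℝ) := Real.rpow_le_rpow_of_exponent_le hx (by norm_num)
      _ = x := Real.rpow_one x
  have hQx : Q ≤ x := hQhalf.trans hxhalfx
  have hRx : R ≤ x := hRhalf.trans hxhalfx
  have hQR34 : Q * R ≤ x ^ (3 / 4 : ℝ) := mul_le_rpow_three_quarters (by linarith) (by linarith) hx0.le hQ2R hRhalf
  have hx34 : x ^ (3 / 4 : ℝ) < x := by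
    calc x ^ (3 / 4 : ℝ) < x ^ (1 : ℝ) := Real.rpow_lt_rpow_of_exponent_lt (by linarith) (by norm_num)
      _ = x := Real.rpow_one x
  have hLQR : L * (Q * R) ≤ x ^ (1 - e) := by
    calc L * (Q * R) = (L * R) * Q := by ring
      _ ≤ x ^ (1 / 2 - e) * x ^ (1 / 2 : ℝ) := mul_le_mul hLR hQhalf (by linarith) (by positivity)
      _ = x ^ (1 - e) := by rw [← Real.rpow_add hx0]; ring_nf
  have hQσ : Q ≤ x ^ σ₁ * (L * M) := by
    -- `Q²R ≤ LMN < LM x^σ QR`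
    have h1 : Q ^ 2 * R < x ^ σ₁ * (L * M) * (Q * R) := by
      calc Q ^ 2 * R ≤ x := hQ2R
        _ = L * M * N := hLMN.symm
        _ < L * M * (x ^ σ₁ * (Q * R)) := by gcongr
        _ = x ^ σ₁ * (L * M) * (Q * R) := by ring
    have h2 : Q ^ 2 * R = Q * (Q * R) := by ring
    rw [h2] at h1
    exact (lt_of_mul_lt_mul_right h1 (by positivity)).le
  have hMe : x ^ e ≤ M := by
    have h1 : (1 : ℝ) ≤ L ^ (1 / 2 : ℝ) * R := one_le_mul_of_one_le_of_one_le (Real.one_le_rpow hL (by norm_num)) hR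
    have h2 : (1 : ℝ) ≤ M * x ^ (-e) := h1.trans hL6
    rw [Real.rpow_neg hx0.le, ← div_eq_mul_inv, le_div_iff₀ (by positivity)] at h2
    linarith only [h2]
  -- empty blocks
  by_cases hemp : M₁ < 1 / 2 ∨ N₁ < 1 / 2 ∨ L₁ < 1 / 2 ∨ Q₁ < 1 / 2 ∨ R₁ < 1 / 2
  · rw [deltaStarSets_eq_zero_of_empty]
    · exact hCB0
    · rcases hemp with h | h | h | h | h
      · exact Or.inl (dyadic_eq_empty hM₁0.le h)
      · exact Or.inr (Or.inl (dyadic_eq_empty hN₁0.le h))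
      · exact Or.inr (Or.inr (Or.inl (dyadic_eq_empty hL₁0.le h)))
      · exact Or.inr (Or.inr (Or.inr (Or.inl (dyadic_eq_empty hQ₁0.le h))))
      · exact Or.inr (Or.inr (Or.inr (Or.inr (dyadic_eq_empty hR₁0.le h))))
  push Not at hemp
  obtain ⟨hM₁, hN₁, hL₁, hQ₁, hR₁⟩ := hemp
  -- block facts
  have hxB8 : 8 * (L₁ * M₁ * N₁) ≤ x := by
    calc 8 * (L₁ * M₁ * N₁) = (2 * L₁) * (2 * M₁) * (2 * N₁) := by ring
      _ ≤ L * M * N := by gcongr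
      _ = x := hLMN
  have hxB : L₁ * M₁ * N₁ ≤ x := by nlinarith only [hxB8, hL₁0, hM₁0, hN₁0, mul_pos (mul_pos hL₁0 hM₁0) hN₁0]
  have hQ₁R₁ : 4 * (Q₁ * R₁) ≤ Q * R := by
    calc 4 * (Q₁ * R₁) = (2 * Q₁) * (2 * R₁) := by ring
      _ ≤ Q * R := by gcongr
  have hQR4 : 4 * Q₁ * R₁ < x := by linarith only [hQ₁R₁, hQR34, hx34]
  have hL₁x : L₁ ≤ x := by linarith only [hL₁L, hLx, hL₁0]
  have hR₁x : R₁ ≤ x := by linarith only [hR₁R, hRx, hR₁0]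
  have hM₁x : M₁ ≤ x := by linarith only [hM₁M, hMx, hM₁0]
  have hN₁x : 2 * N₁ ≤ x := hN₁N.trans hNx
  -- the eight enlarged terms: common facts
  have hfl : ∀ {t : ℝ}, 0 ≤ t → ((⌊t⌋₊ : ℕ) : ℝ) ≤ t := fun ht => Nat.floor_le ht
  -- Case (a): small blocks
  by_cases hsmallb : 8 * (L₁ * M₁ * N₁) < x ^ (1 - σ₁)
  · have hterm : ∀ M' N' Q' : ℝ, 0 ≤ M' → M' ≤ 2 * M₁ → 0 ≤ N' → N' ≤ 2 * N₁ → 0 ≤ Q' → Q' ≤ 2 * Q₁ →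
        deltaStar a 2 M' N' (2 * L₁) Q' (2 * R₁) ≤ Csm * x ^ (1 - σ₁ / 2) := by
      intro M' N' Q' hM'0 hM' hN'0 hN' hQ'0 hQ'
      refine hsmall 2 M' N' (2 * L₁) Q' (2 * R₁) x hx hax2 ?_ ?_ ?_ ?_
      · push_cast
        calc (⌊2 * L₁⌋₊ : ℝ) * ⌊M'⌋₊ * ⌊N'⌋₊ ≤ (2 * L₁) * M' * N' := by
              have h1 := hfl (by positivity : (0 : ℝ) ≤ 2 * L₁)
              have h2 := hfl hM'0
              have h3 := hfl hN'0
              exact mul_le_mul (mul_le_mul h1 h2 (Nat.cast_nonneg _) (by positivity)) h3 (Nat.cast_nonneg _)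
                (by positivity)
          _ ≤ (2 * L₁) * (2 * M₁) * (2 * N₁) := by gcongr
          _ = 8 * (L₁ * M₁ * N₁) := by ring
          _ ≤ x ^ (1 - σ₁) := hsmallb.le
      · calc ((⌊Q'⌋₊ : ℕ) : ℝ) * ⌊2 * R₁⌋₊ ≤ Q' * (2 * R₁) :=
            mul_le_mul (hfl hQ'0) (hfl (by positivity)) (Nat.cast_nonneg _) hQ'0
          _ ≤ (2 * Q₁) * (2 * R₁) := by gcongr
          _ = 4 * (Q₁ * R₁) := by ring
          _ ≤ Q * R := hQ₁R₁
          _ ≤ x ^ (3 / 4 : ℝ) := hQR34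
      · exact (hfl hQ'0).trans (by linarith only [hQ', hQ₁Q, hQx])
      · exact (hfl (by positivity)).trans (by linarith only [hR₁R, hRx])
    have h8 := deltaStarSets_dyadic_le_eight a 2 hM₁0.le hN₁0.le hL₁0.le hQ₁0.le hR₁0.le
    have t1 := hterm (2 * M₁) (2 * N₁) (2 * Q₁) (by positivity) le_rfl (by positivity) le_rfl (by positivity) le_rfl
    have t2 := hterm (2 * M₁) (2 * N₁) Q₁ (by positivity) le_rfl (by positivity) le_rfl hQ₁0.le (by linarith)
    have t3 := hterm (2 * M₁) N₁ (2 * Q₁) (by positivity) le_rfl hN₁0.le (by linarith) (by positivity) le_rfl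
    have t4 := hterm (2 * M₁) N₁ Q₁ (by positivity) le_rfl hN₁0.le (by linarith) hQ₁0.le (by linarith)
    have t5 := hterm M₁ (2 * N₁) (2 * Q₁) hM₁0.le (by linarith) (by positivity) le_rfl (by positivity) le_rfl
    have t6 := hterm M₁ (2 * N₁) Q₁ hM₁0.le (by linarith) (by positivity) le_rfl hQ₁0.le (by linarith)
    have t7 := hterm M₁ N₁ (2 * Q₁) hM₁0.le (by linarith) hN₁0.le (by linarith) (by positivity) le_rfl
    have t8 := hterm M₁ N₁ Q₁ hM₁0.le (by linarith) hN₁0.le (by linarith) hQ₁0.le (by linarith)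
    have hexp1 : x ^ (1 - σ₁ / 2) ≤ x ^ (1 - ε₁ / 2) := Real.rpow_le_rpow_of_exponent_le hx (by linarith)
    have p1 := mul_le_mul_of_nonneg_left hexp1 hCsm.le
    have p2 : 0 ≤ (8 * Ctr + 3 * CN) * x ^ (1 - ε₁ / 2) := by positivity
    linarith only [h8, t1, t2, t3, t4, t5, t6, t7, t8, p1, p2]
  push Not at hsmallb
  -- big blocks: `x^{1/2} ≤ 2 L₁M₁N₁` and `M₁ ≥ x^s/2`
  have hxT : 2 * x ^ (1 / 2 : ℝ) ≤ 2 * (L₁ * M₁ * N₁) := by linarith only [hx8half, hsmallb]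
  have hM₁s2 : x ^ s ≤ 2 * M₁ := by
    -- `x^{1-σ} ≤ 8L₁M₁N₁ ≤ 2 M₁ L N = 2 M₁ x / M`
    have h1 : x ^ (1 - σ₁) * M ≤ 2 * M₁ * x := by
      calc x ^ (1 - σ₁) * M ≤ 8 * (L₁ * M₁ * N₁) * M := mul_le_mul_of_nonneg_right hsmallb (by linarith)
        _ = 2 * M₁ * ((2 * L₁) * M * (2 * N₁)) := by ring
        _ ≤ 2 * M₁ * (L * M * N) := by gcongr
        _ = 2 * M₁ * x := by rw [hLMN]
    have h2 : x ^ s * x = x ^ e * x ^ (1 - σ₁) := by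
      rw [hs, ← Real.rpow_add_one hx0.ne', ← Real.rpow_add hx0]; ring_nf
    have h3 : x ^ s * x ≤ 2 * M₁ * x := by
      rw [h2]
      calc x ^ e * x ^ (1 - σ₁) ≤ M * x ^ (1 - σ₁) := mul_le_mul_of_nonneg_right hMe (by positivity)
        _ = x ^ (1 - σ₁) * M := mul_comm _ _
        _ ≤ 2 * M₁ * x := h1
    exact le_of_mul_le_mul_right h3 hx0
  have hM₁s : x ^ s ≤ 8 * M₁ := by linarith only [hM₁s2, hM₁0]
  have hM₁1 : 1 ≤ M₁ := by
    have h1 : x ^ (s - ε₁) ≤ x ^ s := Real.rpow_le_rpow_of_exponent_le hx (by linarith)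
    linarith only [hx16, h1, hM₁s2]
  -- Case (b): the trivial regime of the block
  by_cases htrivb : 4 * x ^ σ₁ * (Q₁ * R₁) ≤ N₁
  · have hterm : ∀ M' N' Q' : ℝ, M₁ ≤ M' → M' ≤ 2 * M₁ → N₁ ≤ N' → N' ≤ 2 * N₁ → (Q' = Q₁ ∨ Q' = 2 * Q₁) →
        deltaStar a 2 M' N' (2 * L₁) Q' (2 * R₁) ≤ Ctr * x ^ (1 - σ₁ / 4) := by
      intro M' N' Q' hM'1 hM'2 hN'1 hN'2 hQ'
      have hQ'0 : 0 < Q' := by rcases hQ' with rfl | rfl <;> positivity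
      have hQ'2 : Q' ≤ 2 * Q₁ := by rcases hQ' with rfl | rfl <;> linarith
      by_cases hQ'1 : Q' < 1
      · rw [deltaStar_eq_zero_of_Q_lt_one a 2 M' N' (2 * L₁) hQ'1 (2 * R₁)]; positivity
      push Not at hQ'1
      have hM'0 : 0 < M' := by linarith
      have hN'0 : 0 < N' := by linarith
      -- `x_T = 2 L₁ M' N'`
      have hxTlo : x ^ (1 / 2 : ℝ) ≤ (2 * L₁) * M' * N' := by
        calc x ^ (1 / 2 : ℝ) ≤ L₁ * M₁ * N₁ := by linarith only [hxT]
          _ ≤ (2 * L₁) * M' * N' := by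
              calc L₁ * M₁ * N₁ ≤ (2 * L₁) * M₁ * N₁ := by nlinarith only [hL₁0, hM₁0, hN₁0, mul_pos hM₁0 hN₁0]
                _ ≤ (2 * L₁) * M' * N' := by gcongr
      have hxThi : (2 * L₁) * M' * N' ≤ 8 * x := by
        calc (2 * L₁) * M' * N' ≤ (2 * L₁) * (2 * M₁) * (2 * N₁) := by gcongr
          _ = 8 * (L₁ * M₁ * N₁) := by ring
          _ ≤ 8 * x := by linarith only [hxB]
      have hQ'T : Q' ≤ (2 * L₁) * M' * N' := by
        calc Q' ≤ 2 * Q₁ := hQ'2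
          _ ≤ Q := hQ₁Q
          _ ≤ x ^ (1 / 2 : ℝ) := hQhalf
          _ ≤ _ := hxTlo
      have hR'T : 2 * R₁ ≤ (2 * L₁) * M' * N' := by
        calc 2 * R₁ ≤ R := hR₁R
          _ ≤ x ^ (1 / 2 : ℝ) := hRhalf
          _ ≤ _ := hxTlo
      have hreg : x ^ σ₁ * (Q' * (2 * R₁)) ≤ N' := by
        calc x ^ σ₁ * (Q' * (2 * R₁)) ≤ x ^ σ₁ * ((2 * Q₁) * (2 * R₁)) := by gcongr
          _ = 4 * x ^ σ₁ * (Q₁ * R₁) := by ring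
          _ ≤ N₁ := htrivb
          _ ≤ N' := hN'1
      exact htriv a M' N' (2 * L₁) Q' (2 * R₁) x hx8 hM'0.le (by positivity) hQ'1 hQ'T (by linarith) hR'T hN'0 hxTlo
        hxThi hreg
    have h8 := deltaStarSets_dyadic_le_eight a 2 hM₁0.le hN₁0.le hL₁0.le hQ₁0.le hR₁0.le
    have t1 := hterm (2 * M₁) (2 * N₁) (2 * Q₁) (by linarith) le_rfl (by linarith) le_rfl (Or.inr rfl)
    have t2 := hterm (2 * M₁) (2 * N₁) Q₁ (by linarith) le_rfl (by linarith) le_rfl (Or.inl rfl)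
    have t3 := hterm (2 * M₁) N₁ (2 * Q₁) (by linarith) le_rfl le_rfl (by linarith) (Or.inr rfl)
    have t4 := hterm (2 * M₁) N₁ Q₁ (by linarith) le_rfl le_rfl (by linarith) (Or.inl rfl)
    have t5 := hterm M₁ (2 * N₁) (2 * Q₁) le_rfl (by linarith) (by linarith) le_rfl (Or.inr rfl)
    have t6 := hterm M₁ (2 * N₁) Q₁ le_rfl (by linarith) (by linarith) le_rfl (Or.inl rfl)
    have t7 := hterm M₁ N₁ (2 * Q₁) le_rfl (by linarith) le_rfl (by linarith) (Or.inr rfl)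
    have t8 := hterm M₁ N₁ Q₁ le_rfl (by linarith) le_rfl (by linarith) (Or.inl rfl)
    have hexp1 : x ^ (1 - σ₁ / 4) ≤ x ^ (1 - ε₁ / 2) := Real.rpow_le_rpow_of_exponent_le hx (by linarith)
    have p1 := mul_le_mul_of_nonneg_left hexp1 hCtr.le
    have p2 : 0 ≤ (8 * Csm + 3 * CN) * x ^ (1 - ε₁ / 2) := by positivity
    linarith only [h8, t1, t2, t3, t4, t5, t6, t7, t8, p1, p2]
  push Not at htrivb
  -- Case (c): Stage N
  have hHT : 4 * x ^ (2 * ε₁) * Q₁ * R₁ / M₁ ≤ 32 * x ^ t' * (L₁ * R₁) := by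
    -- `Q₁ ≤ 2 x^{2σ} L₁ M₁`
    have h1 : x ≤ 8 * x ^ σ₁ * (L₁ * M₁ * N₁) := by
      have : x = x ^ σ₁ * x ^ (1 - σ₁) := by rw [← Real.rpow_add hx0]; ring_nf; exact (Real.rpow_one x).symm
      calc x = x ^ σ₁ * x ^ (1 - σ₁) := this
        _ ≤ x ^ σ₁ * (8 * (L₁ * M₁ * N₁)) := mul_le_mul_of_nonneg_left hsmallb (by positivity)
        _ = 8 * x ^ σ₁ * (L₁ * M₁ * N₁) := by ring
    have h2 : Q₁ * N₁ ≤ x ^ σ₁ * (L * M) * N₁ / 2 := by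
      have : 2 * Q₁ ≤ x ^ σ₁ * (L * M) := hQ₁Q.trans hQσ
      nlinarith only [this, hN₁0]
    have h3 : x ^ σ₁ * (L * M) * N₁ / 2 ≤ x ^ σ₁ * x / 4 := by
      have : L * M * (2 * N₁) ≤ L * M * N := by gcongr
      rw [hLMN] at this
      have h0 : 0 ≤ x ^ σ₁ := by positivity
      nlinarith only [this, h0]
    have h4 : Q₁ * N₁ ≤ 2 * x ^ σ₁ * x ^ σ₁ * (L₁ * M₁ * N₁) := by
      have h0 : 0 ≤ x ^ σ₁ := by positivity
      have := mul_le_mul_of_nonneg_left h1 h0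
      nlinarith only [h2, h3, this]
    have h5 : Q₁ ≤ 2 * x ^ (2 * σ₁) * (L₁ * M₁) := by
      have hx2σ : x ^ (2 * σ₁) = x ^ σ₁ * x ^ σ₁ := by rw [← Real.rpow_add hx0]; ring_nf
      rw [hx2σ]
      have : Q₁ * N₁ ≤ (2 * (x ^ σ₁ * x ^ σ₁) * (L₁ * M₁)) * N₁ := by nlinarith only [h4]
      exact le_of_mul_le_mul_right this hN₁0
    rw [div_le_iff₀ hM₁0, ht'2, Real.rpow_add hx0]
    calc 4 * x ^ (2 * ε₁) * Q₁ * R₁ ≤ 4 * x ^ (2 * ε₁) * (2 * x ^ (2 * σ₁) * (L₁ * M₁)) * R₁ := by gcongr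
      _ = 8 * (x ^ (2 * ε₁) * x ^ (2 * σ₁)) * (L₁ * R₁) * M₁ := by ring
      _ ≤ 32 * (x ^ (2 * ε₁) * x ^ (2 * σ₁)) * (L₁ * R₁) * M₁ := by
          have : 0 ≤ (x ^ (2 * ε₁) * x ^ (2 * σ₁)) * (L₁ * R₁) * M₁ := by positivity
          nlinarith only [this]
  have h5 : L₁ * R₁ * x ^ (2 * η) ≤ x ^ (1 / 2 - em) := by
    have h1 : 4 * (L₁ * R₁) ≤ L * R := by
      calc 4 * (L₁ * R₁) = (2 * L₁) * (2 * R₁) := by ring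
        _ ≤ L * R := by gcongr
    have h2 : x ^ (1 / 2 - e) * x ^ (2 * η) ≤ x ^ (1 / 2 - em) := by
      rw [← Real.rpow_add hx0]; exact Real.rpow_le_rpow_of_exponent_le hx (by linarith)
    calc L₁ * R₁ * x ^ (2 * η) ≤ (L * R) * x ^ (2 * η) := by
          refine mul_le_mul_of_nonneg_right ?_ (by positivity); nlinarith only [h1, hL₁0, hR₁0]
      _ ≤ x ^ (1 / 2 - e) * x ^ (2 * η) := mul_le_mul_of_nonneg_right hLR (by positivity)
      _ ≤ x ^ (1 / 2 - em) := h2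
  have h6 : L₁ ^ (1 / 2 : ℝ) * R₁ * x ^ (2 * η) ≤ 8 * M₁ * x ^ (-em) := by
    have h1 : L₁ ^ (1 / 2 : ℝ) ≤ L ^ (1 / 2 : ℝ) := Real.rpow_le_rpow hL₁0.le (by linarith) (by norm_num)
    have h2 : L₁ ^ (1 / 2 : ℝ) * R₁ ≤ M * x ^ (-e) / 2 := by
      calc L₁ ^ (1 / 2 : ℝ) * R₁ ≤ L ^ (1 / 2 : ℝ) * (R / 2) := mul_le_mul h1 (by linarith) hR₁0.le (by positivity)
        _ = L ^ (1 / 2 : ℝ) * R / 2 := by ring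
        _ ≤ M * x ^ (-e) / 2 := by linarith only [hL6]
    -- `M ≤ 2 x^σ M₁` from `x^s ≤ 2M₁` is not enough; use `x^{1-σ} M ≤ 2 M₁ x` directly
    have h3 : M * x ^ (-e) ≤ 2 * M₁ * x ^ (σ₁ - e) := by
      have hMb : x ^ (1 - σ₁) * M ≤ 2 * M₁ * x := by
        calc x ^ (1 - σ₁) * M ≤ 8 * (L₁ * M₁ * N₁) * M := mul_le_mul_of_nonneg_right hsmallb (by linarith)
          _ = 2 * M₁ * ((2 * L₁) * M * (2 * N₁)) := by ring
          _ ≤ 2 * M₁ * (L * M * N) := by gcongr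
          _ = 2 * M₁ * x := by rw [hLMN]
      -- multiply by `x^{σ-1-e} > 0`
      have hpos : 0 < x ^ (σ₁ - 1 - e) := by positivity
      have := mul_le_mul_of_nonneg_right hMb hpos.le
      have e1 : x ^ (1 - σ₁) * M * x ^ (σ₁ - 1 - e) = M * x ^ (-e) := by
        rw [mul_comm (x ^ (1 - σ₁)) M, mul_assoc, ← Real.rpow_add hx0]; ring_nf
      have e2 : 2 * M₁ * x * x ^ (σ₁ - 1 - e) = 2 * M₁ * x ^ (σ₁ - e) := by
        rw [mul_assoc, ← Real.rpow_one_add' hx0.le (by linarith)]; ring_nf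
      rw [e1, e2] at this
      exact this
    have h4 : x ^ (σ₁ - e) * x ^ (2 * η) ≤ x ^ (-em) := by
      rw [← Real.rpow_add hx0]; exact Real.rpow_le_rpow_of_exponent_le hx (by linarith)
    calc L₁ ^ (1 / 2 : ℝ) * R₁ * x ^ (2 * η) ≤ (M * x ^ (-e) / 2) * x ^ (2 * η) :=
          mul_le_mul_of_nonneg_right h2 (by positivity)
      _ ≤ (2 * M₁ * x ^ (σ₁ - e) / 2) * x ^ (2 * η) := by gcongr
      _ = M₁ * (x ^ (σ₁ - e) * x ^ (2 * η)) := by ring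
      _ ≤ M₁ * x ^ (-em) := mul_le_mul_of_nonneg_left h4 hM₁0.le
      _ ≤ 8 * M₁ * x ^ (-em) := by
          have : 0 ≤ M₁ * x ^ (-em) := by positivity
          nlinarith only [this]
  have hQ2R₁ : Q₁ ^ 2 * R₁ ≤ x := by
    calc Q₁ ^ 2 * R₁ ≤ (Q / 2) ^ 2 * (R / 2) := by
          refine mul_le_mul (pow_le_pow_left₀ hQ₁0.le (by linarith) 2) (by linarith) hR₁0.le (by positivity)
      _ = Q ^ 2 * R / 8 := by ring
      _ ≤ x := by linarith only [hQ2R, show (0 : ℝ) ≤ Q ^ 2 * R by positivity]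
  have hNU : N₁ ≤ 4 * x ^ σT * (Q₁ * R₁) := by rw [hσT]; exact htrivb.le
  have hmain := hNst x M₁ N₁ Q₁ L₁ R₁ hx hx2 hx4 hx16 hax hax16 hax4 hM₁1 hM₁x hM₁s hN₁ hN₁x hxB hQ₁ hL₁ hL₁x hR₁ hR₁x
    hQR4 hHT hNU h5 h6 hQ2R₁
  refine hmain.trans ?_
  -- the final numerics
  have hA : x ^ (ε₁ / 8 - ε₁) * (L₁ * M₁ * N₁ + x ^ η * (L₁ * (Q₁ * R₁))) ≤ 2 * x ^ (1 - ε₁ / 2) := by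
    have h1 : x ^ η * (L₁ * (Q₁ * R₁)) ≤ x := by
      have hLQR₁ : L₁ * (Q₁ * R₁) ≤ L * (Q * R) := by
        have : L₁ ≤ L := by linarith
        have : Q₁ * R₁ ≤ Q * R := by nlinarith only [hQ₁R₁, hQ₁0, hR₁0]
        exact mul_le_mul (by linarith) this (by positivity) (by linarith)
      calc x ^ η * (L₁ * (Q₁ * R₁)) ≤ x ^ η * x ^ (1 - e) :=
            mul_le_mul_of_nonneg_left (hLQR₁.trans hLQR) (by positivity)
        _ = x ^ (η + (1 - e)) := by rw [← Real.rpow_add hx0]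
        _ ≤ x ^ (1 : ℝ) := Real.rpow_le_rpow_of_exponent_le hx (by linarith)
        _ = x := Real.rpow_one x
    have h2 : x ^ (ε₁ / 8 - ε₁) * x ≤ x ^ (1 - ε₁ / 2) := by
      rw [← Real.rpow_add_one hx0.ne']
      exact Real.rpow_le_rpow_of_exponent_le hx (by linarith)
    calc x ^ (ε₁ / 8 - ε₁) * (L₁ * M₁ * N₁ + x ^ η * (L₁ * (Q₁ * R₁))) ≤ x ^ (ε₁ / 8 - ε₁) * (x + x) :=
          mul_le_mul_of_nonneg_left (add_le_add hxB h1) (by positivity)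
      _ = 2 * (x ^ (ε₁ / 8 - ε₁) * x) := by ring
      _ ≤ 2 * x ^ (1 - ε₁ / 2) := by linarith only [h2]
  have hB : x ^ (2 * η) * x ^ (1 - τ) ≤ x ^ (1 - ε₁ / 2) := by
    rw [← Real.rpow_add hx0]; exact Real.rpow_le_rpow_of_exponent_le hx (by linarith)
  have p1 := mul_le_mul_of_nonneg_left (add_le_add hA hB) hCN.le
  have p2 : 0 ≤ (8 * Csm + 8 * Ctr) * x ^ (1 - ε₁ / 2) := by positivity
  linarith only [p1, p2]

/-! ### The dyadic decomposition of the initial ranges -/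

/-- `(⌊X/2⌋, ⌊X⌋] = dyadic (X/2)`. [folklore] -/
theorem Ioc_half_eq_dyadic {X : ℝ} (hX : 0 ≤ X) : Ioc ⌊X / 2⌋₊ ⌊X⌋₊ = dyadic (X / 2) := by
  rw [dyadic_eq_Ioc (by positivity : 0 ≤ X / 2)]
  congr 2; ring

/-- `X / 2 / 2^(i+1) = X / 2^(i+2)`. [folklore] -/
theorem half_div_pow (X : ℝ) (i : ℕ) : X / 2 / 2 ^ (i + 1) = X / 2 ^ (i + 1 + 1) := by
  rw [pow_succ, div_div]; ring

/-- Dyadic decomposition in `m`: `Δ_sets([1,⌊X⌋], …) ≤ ∑_{i<k} Δ_sets(m ∼ X/2^{i+1}, …)` for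
`X < 2^k`. [folklore] -/
theorem deltaStarSets_decomp_M (a : ℤ) (z : ℝ) (SN SL SQ SR : Finset ℕ) (k : ℕ) :
    ∀ X : ℝ, 0 ≤ X → X < 2 ^ k →
      deltaStarSets a z (Icc 1 ⌊X⌋₊) SN SL SQ SR ≤
        ∑ i ∈ Finset.range k, deltaStarSets a z (dyadic (X / 2 ^ (i + 1))) SN SL SQ SR := by
  induction k with
  | zero =>
    intro X hX0 hX
    rw [pow_zero] at hX
    rw [Nat.floor_eq_zero.2 hX, Finset.range_zero, Finset.sum_empty,
      deltaStarSets_eq_zero_of_empty a z _ _ _ _ _ (Or.inl (Finset.Icc_eq_empty (by norm_num)))]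
  | succ k ih =>
    intro X hX0 hX
    have hhalf : X / 2 < 2 ^ k := by rw [pow_succ] at hX; linarith
    have h1 := deltaStarSets_Icc_split_M_le a z (by linarith : X / 2 ≤ X) SN SL SQ SR
    rw [Ioc_half_eq_dyadic hX0] at h1
    have h2 := ih (X / 2) (by positivity) hhalf
    rw [Finset.sum_range_succ']
    simp only [half_div_pow] at h2
    have : X / 2 ^ (0 + 1) = X / 2 := by norm_num
    rw [this]
    linarith

/-- Dyadic decomposition in `n`. [folklore] -/
theorem deltaStarSets_decomp_N (a : ℤ) (z : ℝ) (SM SL SQ SR : Finset ℕ) (k : ℕ) :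
    ∀ X : ℝ, 0 ≤ X → X < 2 ^ k →
      deltaStarSets a z SM (Icc 1 ⌊X⌋₊) SL SQ SR ≤
        ∑ i ∈ Finset.range k, deltaStarSets a z SM (dyadic (X / 2 ^ (i + 1))) SL SQ SR := by
  induction k with
  | zero =>
    intro X hX0 hX
    rw [pow_zero] at hX
    rw [Nat.floor_eq_zero.2 hX, Finset.range_zero, Finset.sum_empty,
      deltaStarSets_eq_zero_of_empty a z _ _ _ _ _ (Or.inr (Or.inl (Finset.Icc_eq_empty (by norm_num))))]
  | succ k ih =>
    intro X hX0 hX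
    have hhalf : X / 2 < 2 ^ k := by rw [pow_succ] at hX; linarith
    have h1 := deltaStarSets_Icc_split_N_le a z SM (by linarith : X / 2 ≤ X) SL SQ SR
    rw [Ioc_half_eq_dyadic hX0] at h1
    have h2 := ih (X / 2) (by positivity) hhalf
    rw [Finset.sum_range_succ']
    simp only [half_div_pow] at h2
    have : X / 2 ^ (0 + 1) = X / 2 := by norm_num
    rw [this]
    linarith

/-- Dyadic decomposition in `q`. [folklore] -/
theorem deltaStarSets_decomp_Q (a : ℤ) (z : ℝ) (SM SN SL SR : Finset ℕ) (k : ℕ) :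
    ∀ X : ℝ, 0 ≤ X → X < 2 ^ k →
      deltaStarSets a z SM SN SL (Icc 1 ⌊X⌋₊) SR ≤
        ∑ i ∈ Finset.range k, deltaStarSets a z SM SN SL (dyadic (X / 2 ^ (i + 1))) SR := by
  induction k with
  | zero =>
    intro X hX0 hX
    rw [pow_zero] at hX
    rw [Nat.floor_eq_zero.2 hX, Finset.range_zero, Finset.sum_empty,
      deltaStarSets_eq_zero_of_empty a z _ _ _ _ _ (Or.inr (Or.inr (Or.inr (Or.inl (Finset.Icc_eq_empty (by norm_num))))))]
  | succ k ih =>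
    intro X hX0 hX
    have hhalf : X / 2 < 2 ^ k := by rw [pow_succ] at hX; linarith
    have h1 := deltaStarSets_Icc_split_Q_le a z SM SN SL SR (by linarith : X / 2 ≤ X)
    rw [Ioc_half_eq_dyadic hX0] at h1
    have h2 := ih (X / 2) (by positivity) hhalf
    rw [Finset.sum_range_succ']
    simp only [half_div_pow] at h2
    have : X / 2 ^ (0 + 1) = X / 2 := by norm_num
    rw [this]
    linarith

/-- Dyadic decomposition in `l`. [folklore] -/
theorem deltaStarSets_decomp_L (a : ℤ) (z : ℝ) (SM SN SQ SR : Finset ℕ) (k : ℕ) :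
    ∀ X : ℝ, 0 ≤ X → X < 2 ^ k →
      deltaStarSets a z SM SN (Icc 1 ⌊X⌋₊) SQ SR ≤
        ∑ i ∈ Finset.range k, deltaStarSets a z SM SN (dyadic (X / 2 ^ (i + 1))) SQ SR := by
  induction k with
  | zero =>
    intro X hX0 hX
    rw [pow_zero] at hX
    rw [Nat.floor_eq_zero.2 hX, Finset.range_zero, Finset.sum_empty,
      deltaStarSets_eq_zero_of_empty a z _ _ _ _ _ (Or.inr (Or.inr (Or.inl (Finset.Icc_eq_empty (by norm_num)))))]
  | succ k ih =>
    intro X hX0 hX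
    have hhalf : X / 2 < 2 ^ k := by rw [pow_succ] at hX; linarith
    have h1 := (deltaStarSets_Icc_split_L a z SM SN (by linarith : X / 2 ≤ X) SQ SR).le
    rw [Ioc_half_eq_dyadic hX0] at h1
    have h2 := ih (X / 2) (by positivity) hhalf
    rw [Finset.sum_range_succ']
    simp only [half_div_pow] at h2
    have : X / 2 ^ (0 + 1) = X / 2 := by norm_num
    rw [this]
    linarith

/-- Dyadic decomposition in `r`. [folklore] -/
theorem deltaStarSets_decomp_R (a : ℤ) (z : ℝ) (SM SN SL SQ : Finset ℕ) (k : ℕ) :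
    ∀ X : ℝ, 0 ≤ X → X < 2 ^ k →
      deltaStarSets a z SM SN SL SQ (Icc 1 ⌊X⌋₊) ≤
        ∑ i ∈ Finset.range k, deltaStarSets a z SM SN SL SQ (dyadic (X / 2 ^ (i + 1))) := by
  induction k with
  | zero =>
    intro X hX0 hX
    rw [pow_zero] at hX
    rw [Nat.floor_eq_zero.2 hX, Finset.range_zero, Finset.sum_empty,
      deltaStarSets_eq_zero_of_empty a z _ _ _ _ _ (Or.inr (Or.inr (Or.inr (Or.inr (Finset.Icc_eq_empty (by norm_num))))))]
  | succ k ih =>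
    intro X hX0 hX
    have hhalf : X / 2 < 2 ^ k := by rw [pow_succ] at hX; linarith
    have h1 := (deltaStarSets_Icc_split_R a z SM SN SL SQ (by linarith : X / 2 ≤ X)).le
    rw [Ioc_half_eq_dyadic hX0] at h1
    have h2 := ih (X / 2) (by positivity) hhalf
    rw [Finset.sum_range_succ']
    simp only [half_div_pow] at h2
    have : X / 2 ^ (0 + 1) = X / 2 := by norm_num
    rw [this]
    linarith

/-- **The full dyadic decomposition of `Δ*(M, N, L, Q, R)`** (initial ranges) into at most `k⁵`
dyadic blocks `m ∼ M/2^{i+1}, …`, for `M, N, L, Q, R < 2^k`.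
[cite: BombieriFriedlanderIwaniecActa1986, §14 p. 244] -/
theorem deltaStar_le_sum_blocks (a : ℤ) (z : ℝ) {M N L Q R : ℝ} (hM : 0 ≤ M) (hN : 0 ≤ N) (hL : 0 ≤ L)
    (hQ : 0 ≤ Q) (hR : 0 ≤ R) (k : ℕ) (hMk : M < 2 ^ k) (hNk : N < 2 ^ k) (hLk : L < 2 ^ k) (hQk : Q < 2 ^ k)
    (hRk : R < 2 ^ k) :
    deltaStar a z M N L Q R ≤
      ∑ i₁ ∈ Finset.range k, ∑ i₂ ∈ Finset.range k, ∑ i₃ ∈ Finset.range k, ∑ i₄ ∈ Finset.range k,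
        ∑ i₅ ∈ Finset.range k,
          deltaStarSets a z (dyadic (M / 2 ^ (i₁ + 1))) (dyadic (N / 2 ^ (i₂ + 1))) (dyadic (L / 2 ^ (i₃ + 1)))
            (dyadic (Q / 2 ^ (i₄ + 1))) (dyadic (R / 2 ^ (i₅ + 1))) := by
  rw [deltaStar_eq_deltaStarSets]
  refine (deltaStarSets_decomp_M a z _ _ _ _ k M hM hMk).trans (Finset.sum_le_sum fun i₁ _ => ?_)
  refine (deltaStarSets_decomp_N a z _ _ _ _ k N hN hNk).trans (Finset.sum_le_sum fun i₂ _ => ?_)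
  refine (deltaStarSets_decomp_L a z _ _ _ _ k L hL hLk).trans (Finset.sum_le_sum fun i₃ _ => ?_)
  refine (deltaStarSets_decomp_Q a z _ _ _ _ k Q hQ hQk).trans (Finset.sum_le_sum fun i₄ _ => ?_)
  exact deltaStarSets_decomp_R a z _ _ _ _ k R hR hRk

/-- **A sum of `k⁵` equal bounds.** [folklore] -/
theorem sum5_const_le {k : ℕ} {f : ℕ → ℕ → ℕ → ℕ → ℕ → ℝ} {B : ℝ}
    (h : ∀ i₁ i₂ i₃ i₄ i₅, f i₁ i₂ i₃ i₄ i₅ ≤ B) :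
    ∑ i₁ ∈ Finset.range k, ∑ i₂ ∈ Finset.range k, ∑ i₃ ∈ Finset.range k, ∑ i₄ ∈ Finset.range k,
        ∑ i₅ ∈ Finset.range k, f i₁ i₂ i₃ i₄ i₅ ≤ (k : ℝ) ^ 5 * B := by
  have step : ∀ (g : ℕ → ℝ) (C : ℝ), (∀ i, g i ≤ C) → ∑ i ∈ Finset.range k, g i ≤ k * C := by
    intro g C hg
    calc ∑ i ∈ Finset.range k, g i ≤ ∑ _i ∈ Finset.range k, C := Finset.sum_le_sum fun i _ => hg i
      _ = k * C := by rw [Finset.sum_const, Finset.card_range, nsmul_eq_mul]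
  have e5 : (k : ℝ) ^ 5 * B = k * (k * (k * (k * (k * B)))) := by ring
  rw [e5]
  exact step _ _ fun i₁ => step _ _ fun i₂ => step _ _ fun i₃ => step _ _ fun i₄ => step _ _ fun i₅ =>
    h i₁ i₂ i₃ i₄ i₅

/-- `A ≤ x^c` once `x ≥ (max A 1)^{1/c}` (`c > 0`). [folklore] -/
theorem le_rpow_of_ge_thr {A c x : ℝ} (hc : 0 < c) (hx : (max A 1) ^ (1 / c) ≤ x) : A ≤ x ^ c := by
  have hm1 : (1 : ℝ) ≤ max A 1 := le_max_right _ _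
  have hm0 : 0 ≤ max A 1 := by linarith
  have hthr0 : 0 ≤ (max A 1) ^ (1 / c) := by positivity
  calc A ≤ max A 1 := le_max_left _ _
    _ = ((max A 1) ^ (1 / c)) ^ c := by rw [← Real.rpow_mul hm0]; field_simp; exact (Real.rpow_one _).symm
    _ ≤ x ^ c := Real.rpow_le_rpow hthr0 hx hc.le

/-- `1 ≤ (max A 1)^{1/c}`. [folklore] -/
theorem one_le_thr (A : ℝ) {c : ℝ} (hc : 0 < c) : (1 : ℝ) ≤ (max A 1) ^ (1 / c) :=
  Real.one_le_rpow (le_max_right _ _) (by positivity)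

/-! ### Theorem 7 in the regime (14.4) from the uniform Lemma 1, and Theorem 7* -/

set_option maxHeartbeats 1600000 in
/-- **BFI's Theorem 7 with a power saving, in the regime `Q²R ≤ x` of (14.4), from the uniform
corrected Lemma 1.**  For `a ≠ 0`, `ε > 0` there are `ε₀ > 0`, `C`, `x₀` such that for
`x ≥ x₀`, `M, N, L, Q, R ≥ 1`, `LMN = x`, `Q²R ≤ x`, `LR < x^{1/2−ε}`, `L^{1/2}R < Mx^{−ε}`:
`Δ*(z = 2; M, N, L, Q, R) ≤ C x^{1−ε₀}` (the level condition `QR < xℒ^{−B}` is not needed in this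
regime and `B = 0` is returned).  Proof: global trivial regime `N ≥ x^σ QR` by
`deltaStar_trivial_regime`; otherwise dyadic decomposition (`deltaStar_le_sum_blocks`, `≤ k⁵`
blocks, `k ≍ log x`) and `block_bound` for each block.
[cite: BombieriFriedlanderIwaniecActa1986, §14 (14.1), (14.4)–(14.6), Theorem 7 p. 246] -/
theorem theorem7_smooth_of_DI {κ : ℝ} (hκ : 0 ≤ κ) (hDI : Lemma1BoundUniform κ) :
    ∀ a : ℤ, a ≠ 0 → ∀ ε : ℝ, 0 < ε → ∃ ε₀ B C x₀ : ℝ, 0 < ε₀ ∧ ∀ x : ℝ, x₀ ≤ x →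
      ∀ M N L Q R : ℝ, 1 ≤ M → 1 ≤ N → 1 ≤ L → 1 ≤ Q → 1 ≤ R → L * M * N = x →
      Q ^ 2 * R ≤ x → Q * R < x / Real.log x ^ B →
      L * R < x ^ (1 / 2 - ε) → L ^ (1 / 2 : ℝ) * R < M * x ^ (-ε) →
        deltaStar a 2 M N L Q R ≤ C * x ^ (1 - ε₀) := by
  intro a ha ε hε
  -- the parameters
  set e : ℝ := min ε (1 / 4) with he_def
  have he0 : 0 < e := lt_min hε (by norm_num)
  have heε : e ≤ ε := min_le_left _ _
  have he4 : e ≤ 1 / 4 := min_le_right _ _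
  set σ₁ : ℝ := e / 16 with hσ₁def
  set η : ℝ := e / 64 with hηdef
  set ε₂ : ℝ := η / 20 with hε₂def
  set ε₀ : ℝ := η / (20 * (κ + 1)) with hε₀def
  set ε₁ : ℝ := η * ε₀ with hε₁def
  have hσ0 : 0 < σ₁ := by positivity
  have hη0 : 0 < η := by positivity
  have hε₂0 : 0 < ε₂ := by positivity
  have hε₀0 : 0 < ε₀ := by positivity
  have hε₁0 : 0 < ε₁ := by positivity
  have hκε₀ : κ * ε₀ ≤ η / 20 := by
    rw [hε₀def, mul_div_assoc', div_le_div_iff₀ (by positivity) (by norm_num)]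
    nlinarith [hη0.le, hκ]
  have hε₀1 : ε₀ ≤ 1 / 20 := by
    rw [hε₀def, div_le_div_iff₀ (by positivity) (by norm_num)]
    have : η ≤ 1 := by rw [hηdef]; linarith
    nlinarith [this, hκ]
  have hε₁η20 : ε₁ ≤ η / 20 := by
    rw [hε₁def]
    calc η * ε₀ ≤ η * (1 / 20) := mul_le_mul_of_nonneg_left hε₀1 hη0.le
      _ = η / 20 := by ring
  set s : ℝ := e - σ₁ with hsdef
  set t' : ℝ := 2 * ε₁ + 2 * σ₁ with ht'def
  set em : ℝ := 27 * e / 32 with hemdef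
  set τ : ℝ := 2 * η + ε₁ / 2 with hτdef
  have hε₁' : 2 * ε₁ ≤ 1 := by linarith
  have hσ4 : σ₁ ≤ 1 / 4 := by rw [hσ₁def]; linarith
  have he2 : e ≤ 1 / 2 := by linarith
  have hem0 : 0 ≤ em := by positivity
  have hem1 : em ≤ e - σ₁ - 2 * η := by rw [hemdef, hσ₁def, hηdef]; linarith
  have hsP : τ + 2 * ε₁ ≤ s := by rw [hτdef, hsdef, hσ₁def, hηdef]; linarith
  have hsR : τ + 9 * ε₁ / 2 ≤ s := by rw [hτdef, hsdef, hσ₁def, hηdef]; linarith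
  have hexp : 2 * τ + 2 * ε₁ + 14 * (ε₂ + κ * ε₀) + t' + σ₁ ≤ em := by
    rw [hτdef, ht'def, hemdef, hσ₁def]
    have : ε₂ = η / 20 := hε₂def
    rw [this]
    rw [hηdef] at hκε₀ hε₁η20 ⊢
    linarith
  have hε₁σ : ε₁ ≤ σ₁ / 2 := by rw [hσ₁def]; rw [hηdef] at hε₁η20; linarith
  have hηε₁ : ε₁ < η := by linarith
  -- `j`
  set j : ℕ := ⌈3 / ε₁⌉₊ with hjdef
  have hj3 : (3 : ℝ) / ε₁ ≤ j := Nat.le_ceil _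
  have hj6 : (6 : ℝ) ≤ 3 / ε₁ := by rw [le_div_iff₀ hε₁0]; linarith
  have hj : 2 ≤ j := by
    have : (2 : ℝ) ≤ j := by linarith
    exact_mod_cast this
  have hjε : 2 + 2 * ε₁ ≤ j * ε₁ := by
    have : (3 : ℝ) ≤ j * ε₁ := by
      have := mul_le_mul_of_nonneg_right hj3 hε₁0.le
      rwa [div_mul_cancel₀ _ hε₁0.ne'] at this
    linarith
  -- the constants
  obtain ⟨K, hK0, hK⟩ := uniformBoundAt_of_uniform hDI hε₂0 hε₀0
  obtain ⟨CB, hCB, hB⟩ := block_bound (s := s) (t' := t') (σT := σ₁) (em := em) (τ := τ) (η := η) (e := e)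
    (σ₁ := σ₁) hK0 hK hκ hε₂0.le hε₀0.le ha hε₁0 hε₁' hσ0 hσ4 he2 rfl rfl rfl hem0 hem1 hsP hsR hexp le_rfl hη0.le
    le_rfl hε₁σ hj hjε
  obtain ⟨C₀, hC₀, h₀⟩ := deltaStar_trivial_regime
  obtain ⟨Cℓ, hCℓ, hℓ⟩ := one_add_log_pow_le_of_le (δ := σ₁ / 4) (by positivity) 16
  obtain ⟨C5, hC5, h5ℓ⟩ := one_add_log_pow_le_of_le (δ := ε₁ / 4) (by positivity) 5
  -- the thresholds
  set x₀ : ℝ := max 8 (max ((max 2 1) ^ (1 / ε₁)) (max ((max 4 1) ^ (1 / (η - ε₁)))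
    (max ((max 16 1) ^ (1 / (s - ε₁))) (max ((max (|(a : ℝ)| + 2) 1) ^ (1 / (1 / 2 : ℝ)))
    (max ((max (16 * |(a : ℝ)| + 1) 1) ^ (1 / s)) (max ((max (4 * |(a : ℝ)| + 1) 1) ^ (1 / η))
    ((max 8 1) ^ (1 / (1 / 2 - σ₁))))))))) with hx₀def
  refine ⟨ε₁ / 4, 0, 32 * C5 * CB + C₀ * Cℓ, x₀, by positivity, ?_⟩
  intro x hx M N L Q R hM hN hL hQ hR hLMN hQ2R _hlevel hLR hL6
  -- unpacking the thresholds
  have hx8 : 8 ≤ x := le_trans (le_max_left _ _) hx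
  have hx1 : 1 ≤ x := by linarith
  have hx0 : 0 < x := by linarith
  have hT : ∀ {A c : ℝ}, 0 < c → (max A 1) ^ (1 / c) ≤ x₀ → A ≤ x ^ c :=
    fun hc hle => le_rpow_of_ge_thr hc (hle.trans hx)
  have hsε₁ : 0 < s - ε₁ := by rw [hsdef, hσ₁def]; rw [hηdef] at hηε₁; linarith
  have hhalfσ : 0 < 1 / 2 - σ₁ := by linarith
  have hT1 : (max 2 1 : ℝ) ^ (1 / ε₁) ≤ x₀ := by
    rw [hx₀def]; exact le_max_of_le_right (le_max_left _ _)
  have hT2 : (max 4 1 : ℝ) ^ (1 / (η - ε₁)) ≤ x₀ := by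
    rw [hx₀def]; exact le_max_of_le_right (le_max_of_le_right (le_max_left _ _))
  have hT3 : (max 16 1 : ℝ) ^ (1 / (s - ε₁)) ≤ x₀ := by
    rw [hx₀def]; exact le_max_of_le_right (le_max_of_le_right (le_max_of_le_right (le_max_left _ _)))
  have hT4 : (max (|(a : ℝ)| + 2) 1) ^ (1 / (1 / 2 : ℝ)) ≤ x₀ := by
    rw [hx₀def]
    exact le_max_of_le_right (le_max_of_le_right (le_max_of_le_right (le_max_of_le_right (le_max_left _ _))))
  have hT5 : (max (16 * |(a : ℝ)| + 1) 1) ^ (1 / s) ≤ x₀ := by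
    rw [hx₀def]
    exact le_max_of_le_right (le_max_of_le_right (le_max_of_le_right (le_max_of_le_right
      (le_max_of_le_right (le_max_left _ _)))))
  have hT6 : (max (4 * |(a : ℝ)| + 1) 1) ^ (1 / η) ≤ x₀ := by
    rw [hx₀def]
    exact le_max_of_le_right (le_max_of_le_right (le_max_of_le_right (le_max_of_le_right
      (le_max_of_le_right (le_max_of_le_right (le_max_left _ _))))))
  have hT7 : (max 8 1 : ℝ) ^ (1 / (1 / 2 - σ₁)) ≤ x₀ := by
    rw [hx₀def]
    exact le_max_of_le_right (le_max_of_le_right (le_max_of_le_right (le_max_of_le_right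
      (le_max_of_le_right (le_max_of_le_right (le_max_right _ _))))))
  have hx2 : 2 ≤ x ^ ε₁ := hT hε₁0 hT1
  have hx4 : 4 ≤ x ^ (η - ε₁) := hT (by linarith) hT2
  have hx16 : 16 ≤ x ^ (s - ε₁) := hT hsε₁ hT3
  have hax2 : |(a : ℝ)| + 2 ≤ x ^ (1 / 2 : ℝ) := hT (by norm_num) hT4
  have hax16 : 16 * |(a : ℝ)| < x ^ s := by
    have := hT (by linarith : 0 < s) hT5
    linarith
  have hax4 : 4 * |(a : ℝ)| < x ^ η := by
    have := hT hη0 hT6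
    linarith
  have hx8half : 8 * x ^ (1 / 2 : ℝ) ≤ x ^ (1 - σ₁) := by
    have h := hT hhalfσ hT7
    have : x ^ (1 - σ₁) = x ^ (1 / 2 - σ₁) * x ^ (1 / 2 : ℝ) := by rw [← Real.rpow_add hx0]; ring_nf
    rw [this]
    exact mul_le_mul_of_nonneg_right h (by positivity)
  -- the hypotheses at level `e`
  have hLR' : L * R ≤ x ^ (1 / 2 - e) := hLR.le.trans (Real.rpow_le_rpow_of_exponent_le hx1 (by linarith))
  have hL6' : L ^ (1 / 2 : ℝ) * R ≤ M * x ^ (-e) :=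
    hL6.le.trans (mul_le_mul_of_nonneg_left (Real.rpow_le_rpow_of_exponent_le hx1 (by linarith)) (by linarith))
  have hQx : Q ≤ x := by
    calc Q = Q * 1 * 1 := by ring
      _ ≤ Q * Q * R := by gcongr
      _ = Q ^ 2 * R := by ring
      _ ≤ x := hQ2R
  have hRx : R ≤ x := by
    have hQ2 : (1 : ℝ) ≤ Q ^ 2 := one_le_pow₀ hQ
    calc R = 1 * R := by ring
      _ ≤ Q ^ 2 * R := by gcongr
      _ ≤ x := hQ2R
  have hxε : x ^ (1 - ε₁ / 4) = x ^ (1 - ε₁ / 2) * x ^ (ε₁ / 4) := by rw [← Real.rpow_add hx0]; ring_nf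
  -- the global trivial regime
  by_cases htr : x ^ σ₁ * (Q * R) ≤ N
  · have h := h₀ 2 le_rfl a σ₁ x M N L Q R hx1 (by linarith) (by linarith) hQ hQx hR hRx (by linarith) hLMN htr
    refine h.trans ?_
    have hlog := hℓ x x hx1 hx1 (by linarith)
    have hpow : x ^ (1 - σ₁) * x ^ (σ₁ / 4) ≤ x ^ (1 - ε₁ / 4) := by
      rw [← Real.rpow_add hx0]; exact Real.rpow_le_rpow_of_exponent_le hx1 (by linarith)
    have hl0 : 0 ≤ (1 + Real.log x) ^ 16 := pow_nonneg (by linarith [Real.log_nonneg hx1]) 16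
    calc C₀ * x ^ (1 - σ₁) * (1 + Real.log x) ^ 16 ≤ C₀ * x ^ (1 - σ₁) * (Cℓ * x ^ (σ₁ / 4)) :=
          mul_le_mul_of_nonneg_left hlog (by positivity)
      _ = C₀ * Cℓ * (x ^ (1 - σ₁) * x ^ (σ₁ / 4)) := by ring
      _ ≤ C₀ * Cℓ * x ^ (1 - ε₁ / 4) := mul_le_mul_of_nonneg_left hpow (by positivity)
      _ ≤ (32 * C5 * CB + C₀ * Cℓ) * x ^ (1 - ε₁ / 4) := by
          have : 0 ≤ 32 * C5 * CB * x ^ (1 - ε₁ / 4) := by positivity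
          linarith
  push Not at htr
  -- the dyadic decomposition
  set k : ℕ := ⌊Real.logb 2 x⌋₊ + 1 with hkdef
  have h2k : x < (2 : ℝ) ^ k := by
    have h1 : Real.logb 2 x < k := by rw [hkdef]; push_cast; exact Nat.lt_floor_add_one _
    have := Real.rpow_lt_rpow_of_exponent_lt (by norm_num : (1 : ℝ) < 2) h1
    rwa [Real.rpow_logb (by norm_num) (by norm_num) hx0, Real.rpow_natCast] at this
  have hkle : (k : ℝ) ≤ 2 * (1 + Real.log x) := by
    have h1 : (k : ℝ) ≤ Real.logb 2 x + 1 := by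
      rw [hkdef]; push_cast
      linarith [Nat.floor_le (Real.logb_nonneg (by norm_num : (1 : ℝ) < 2) hx1)]
    have h2 : Real.logb 2 x ≤ 2 * Real.log x := by
      rw [Real.logb, div_le_iff₀ (Real.log_pos (by norm_num))]
      have := Real.log_two_gt_d9
      nlinarith [Real.log_nonneg hx1]
    linarith
  have hMx : M ≤ x := by
    calc M = 1 * M * 1 := by ring
      _ ≤ L * M * N := by gcongr
      _ = x := hLMN
  have hNx : N ≤ x := by
    calc N = 1 * 1 * N := by ring
      _ ≤ L * M * N := by gcongr
      _ = x := hLMN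
  have hLx : L ≤ x := by
    calc L = L * 1 * 1 := by ring
      _ ≤ L * M * N := by gcongr
      _ = x := hLMN
  have hMk : M < (2 : ℝ) ^ k := lt_of_le_of_lt hMx h2k
  have hNk : N < (2 : ℝ) ^ k := lt_of_le_of_lt hNx h2k
  have hLk : L < (2 : ℝ) ^ k := lt_of_le_of_lt hLx h2k
  have hQk : Q < (2 : ℝ) ^ k := lt_of_le_of_lt hQx h2k
  have hRk : R < (2 : ℝ) ^ k := lt_of_le_of_lt hRx h2k
  have hdec := deltaStar_le_sum_blocks a 2 (by linarith) (by linarith) (by linarith) (by linarith) (by linarith) k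
    hMk hNk hLk hQk hRk
  refine hdec.trans ?_
  have hblock : ∀ i₁ i₂ i₃ i₄ i₅ : ℕ,
      deltaStarSets a 2 (dyadic (M / 2 ^ (i₁ + 1))) (dyadic (N / 2 ^ (i₂ + 1))) (dyadic (L / 2 ^ (i₃ + 1)))
        (dyadic (Q / 2 ^ (i₄ + 1))) (dyadic (R / 2 ^ (i₅ + 1))) ≤ CB * x ^ (1 - ε₁ / 2) := by
    intro i₁ i₂ i₃ i₄ i₅
    have hhalf : ∀ (X : ℝ) (i : ℕ), 0 ≤ X → 2 * (X / 2 ^ (i + 1)) ≤ X := by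
      intro X i hX
      rw [pow_succ, ← div_div, mul_div_cancel₀ _ (two_ne_zero)]
      exact div_le_self hX (one_le_pow₀ (by norm_num))
    exact hB x M N L Q R _ _ _ _ _ hx8 hx2 hx4 hx16 hax2 hax16 hax4 hx8half hM hN hL hQ hR hLMN hQ2R hLR' hL6' htr
      (by positivity) (hhalf M i₁ (by linarith)) (by positivity) (hhalf N i₂ (by linarith)) (by positivity)
      (hhalf L i₃ (by linarith)) (by positivity) (hhalf Q i₄ (by linarith)) (by positivity) (hhalf R i₅ (by linarith))
  refine (sum5_const_le hblock).trans ?_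
  -- `k⁵ ≤ 32 (1 + log x)⁵ ≤ 32 C5 x^{ε₁/4}`
  have hk5 : (k : ℝ) ^ 5 ≤ 32 * C5 * x ^ (ε₁ / 4) := by
    have hl0 : 0 ≤ 1 + Real.log x := by linarith [Real.log_nonneg hx1]
    calc (k : ℝ) ^ 5 ≤ (2 * (1 + Real.log x)) ^ 5 := pow_le_pow_left₀ (Nat.cast_nonneg _) hkle 5
      _ = 32 * (1 + Real.log x) ^ 5 := by ring
      _ ≤ 32 * (C5 * x ^ (ε₁ / 4)) := by
          refine mul_le_mul_of_nonneg_left (h5ℓ x x hx1 hx1 (by linarith)) (by norm_num)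
      _ = 32 * C5 * x ^ (ε₁ / 4) := by ring
  have hxe2 : 0 ≤ x ^ (1 - ε₁ / 2) := by positivity
  calc (k : ℝ) ^ 5 * (CB * x ^ (1 - ε₁ / 2)) ≤ (32 * C5 * x ^ (ε₁ / 4)) * (CB * x ^ (1 - ε₁ / 2)) :=
        mul_le_mul_of_nonneg_right hk5 (by positivity)
    _ = 32 * C5 * CB * (x ^ (1 - ε₁ / 2) * x ^ (ε₁ / 4)) := by ring
    _ = 32 * C5 * CB * x ^ (1 - ε₁ / 4) := by rw [hxε]
    _ ≤ (32 * C5 * CB + C₀ * Cℓ) * x ^ (1 - ε₁ / 4) := by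
        have : 0 ≤ C₀ * Cℓ * x ^ (1 - ε₁ / 4) := by positivity
        linarith

end BFI

/-- **Theorem 7* in the regime (14.4) from the uniform corrected Lemma 1.**  Assuming the
Deshouillers–Iwaniec bound for sums of Kloosterman sums in the uniform, corrected form
`BFI.Lemma1BoundUniform κ` (BFI's Lemma 1 with Drappeau's weight dependence and the corrected
`𝓘` of BFI 2019 — not yet in the tree), the statement of
`Literature.NumberTheory.Sieve.BombieriFriedlanderIwaniecTheorem7Star` holds for all
`(M, N, L, Q, R)` with `Q²R ≤ x` (the first condition of (14.4); BFI remove it by the `q ↔ s`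
symmetry of §13, which is not formalised here).  This is §14 of BFI made effective: Theorem 7
for unsieved variables with a power saving (`BFI.theorem7_smooth_of_DI`) followed by the sieve
extension of `…Theorem7Star.restricted_of_smooth`.
[cite: BombieriFriedlanderIwaniecActa1986, §14 Theorems 7, 7* p. 246] -/
theorem _root_.Literature.NumberTheory.Sieve.BombieriFriedlanderIwaniecTheorem7Star.restricted_of_DI
    {κ : ℝ} (hκ : 0 ≤ κ) (hDI : BFI.Lemma1BoundUniform κ)
    {a : ℤ} (ha : a ≠ 0) {ε : ℝ} (hε : 0 < ε) {A : ℝ} (hA : 0 < A) :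
    ∃ B C x₀ : ℝ, ∀ x : ℝ, x₀ ≤ x → ∀ M N L Q R : ℝ,
      1 ≤ M → 1 ≤ N → 1 ≤ L → 1 ≤ Q → 1 ≤ R → L * M * N = x →
      Q ^ 2 * R ≤ x → Q * R < x / Real.log x ^ B →
      L * R < x ^ (1 / 2 - ε) → L ^ (1 / 2 : ℝ) * R < M * x ^ (-ε) →
      ∀ z : ℝ, z ≤ Real.exp (Real.log x / Real.log (Real.log x)) →
        BFI.deltaStar a z M N L Q R ≤ C * x / Real.log x ^ A :=
  Literature.NumberTheory.Sieve.BombieriFriedlanderIwaniecTheorem7Star.restricted_of_smooth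
    (BFI.theorem7_smooth_of_DI hκ hDI) ha hε hA

namespace BFI

end BFI

end Literature.NumberTheory.Sieve
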